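import Literature.Analysis.Pluripotential.NonPluripolarMongeAmpereMass
import Literature.Analysis.Pluripotential.SubharmonicMaxPrinciple
import Literature.NumberTheory.Transcendental.ProjectiveSpaceProofs
import Literature.Geometry.Kaehler.AnalyticSetChart
import HarnessLib

/-!
# Towards Siu's theorem on `ℙᴺ(ℂ)`: elementary potential theory of the Lelong upper level sets
`E_c(T)`, the cases `c > deg T` and `N = 1`, and the reduction to the affine charts

Topic `Literature/Analysis/Pluripotential`; proofs file attached to
`NonPluripolarMongeAmpereMass.lean` (named fact `Siu1974_isAnalyticSet_lelongUpperLevelSet`,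
Siu's analyticity theorem for the Lelong upper level sets of a closed positive `(1,1)`-current on
`ℙᴺ`). The published proofs of Siu's theorem (Siu 1974; Kiselman 1979; Demailly 1987/1992; see
Hörmander, *Notions of Convexity*, Thm. 4.3.3 for Kiselman's version) rest on Hörmander's `L²`
estimates for `∂̄` with plurisubharmonic weights (Bombieri's theorem), Kiselman's attenuation of
singularities and the Noetherian property of analytic sets, none of which is available; this file
develops, sorry-free, the elementary potential theory that every proof starts from, in the
mean-value formalism of `Plurisubharmonic.lean` / `SubharmonicMaxPrinciple.lean` (`EReal`-valued
functions, `circleMean`), and proves the theorem in the trivial range `c > deg T`: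

* `IsSubharmonicOn.add_real` — `u + h` is subharmonic for `u` subharmonic and `h` real, continuous
  with the mean-value property (e.g. `h = β log |τ|` off the origin, `h` constant);
* the **maximum principle** for subharmonic functions in three forms: on circles
  (`IsSubharmonicOn.eq_of_le_on_sphere`), the strong maximum principle on preconnected open
  sets (`IsSubharmonicOn.eqOn_of_isMaxOn`) and the boundary maximum principle on compact subsets
  of the domain (`IsSubharmonicOn.exists_mem_frontier_le`) [cite: HormanderSCV1973, Thm. 1.6.3];
* `IsSubharmonicOn.eq_bot_of_growth` — a Liouville-type lemma off the origin: growth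
  `≤ γ log |τ| + O(1)` at `0` and `≤ c log |τ| + O(1)` at `∞` with `c < γ` forces `u ≡ -∞`;
* `ClosedPositiveOneOneCurrent.lelongNumber_le_degree` — **`ν(T, x) ≤ deg T`** for every closed
  positive `(1,1)`-current `T` on `ℙᴺ(ℂ)` and every `x` (slices of the cone potential through
  `x.rep` are subharmonic on `ℂ` with logarithmic growth `deg T` at infinity);
* `ClosedPositiveOneOneCurrent.lelongUpperLevelSet_eq_empty`,
  `isAnalyticSet_lelongUpperLevelSet_of_degree_lt` — `E_c(T) = ∅`, hence analytic, for
  `c > deg T` (so `Siu1974_isAnalyticSet_lelongUpperLevelSet` holds in that range, in particular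
  for all currents of degree `0`). The range `0 < c ≤ deg T` is Siu's theorem proper (open here);
* `IsPlurisubharmonicOn.le_three_balls` — Hadamard's three-balls inequality for psh functions on
  a complex normed space (convexity of `log r ↦ sup_{B̄(a,r)} V`), with its consequences
  `IsPlurisubharmonicOn.lelongNumber_le_quotient` (`ν(V, b) ≤ (m_r - m_ρ)/(log r - log ρ)`),
  `IsPlurisubharmonicOn.bddAbove_lelongSlopes`, `mem_lelongSlopes_of_forall_sSup_le` and the
  **upper semicontinuity of the Lelong number** `IsPlurisubharmonicOn.eventually_lelongNumber_lt`;
* `ClosedPositiveOneOneCurrent.isClosed_lelongUpperLevelSet` — **`E_c(T)` is closed** for every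
  `c` (the elementary, necessary part of analyticity);
* `IsSubharmonicOn.eq_bot_of_growth_finset` (Liouville-type lemma with finitely many poles) and
  the **case `N = 1`**: on `ℙ¹(ℂ)` at most `deg T / c` points of a chart carry `ν(T, ·) ≥ c`
  (`card_mul_le_degree_of_le_lelongNumber`), so `E_c(T)` is finite
  (`finite_lelongUpperLevelSet_of_projectiveLine`) and analytic
  (`isAnalyticSet_lelongUpperLevelSet_of_projectiveLine`): Siu's theorem for `N = 1`;
* `IsPlurisubharmonicOn.lelongNumber_mem_lelongSlopes`, `lelongSlopes_eq_Icc` — the Lelong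
  number is an admissible slope (the slope set is `[0, ν]`);
  `lintegral_ball_norm_sub_rpow_neg_finrank_eq_top` (`‖x - z‖^{-dim}` is not integrable at `z`)
  and **Hörmander's Lemma 4.3.1** in sup form,
  `IsPlurisubharmonicOn.lintegral_exp_neg_eq_top_of_finrank_le_lelongNumber`
  (`ν(V, z) ≥ dim_ℝ ⟹ e^{-V} ∉ L¹` near `z`) — the first lemma of Kiselman's proof;
* `ClosedPositiveOneOneCurrent.card_mul_le_degree_of_le_lelongNumber_line`,
  `finite_lelongUpperLevelSet_inter_line` — for every `N` and `c > 0`, `E_c(T)` meets each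
  projective line on which the cone potential is not identically `-∞` in at most `deg T / c`
  chart points (the ℙ¹ argument along the line, `circleMean_eq_bot_of_eq_bot_off_finite`);
* `ClosedPositiveOneOneCurrent.isAnalyticSet_lelongUpperLevelSet_of_charts`,
  `isPlurisubharmonicOn_pot_insertNth`, `lelongNumber_pot_insertNth`,
  `isAnalyticSet_lelongUpperLevelSet_of_chartPotentials` — **reduction to the charts**: the chart
  potentials `gᵢ = V ∘ ιᵢ` are psh on `ℂᴺ`, `ν(V, ιᵢ w) = ν(gᵢ, w)`, and `E_c(T)` is analytic as
  soon as the `N + 1` chart level sets `{ν(gᵢ, ·) ≥ c} ⊆ ℂᴺ` are (so the named fact is exactly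
  Siu's theorem for the psh functions `gᵢ` on `ℂᴺ`);
* `ClosedPositiveOneOneCurrent.pot_eq_bot_of_lelongNumber_pos`,
  `lelongUpperLevelSet_subset_image_poleSet`, `interior_lelongUpperLevelSet_eq_empty`,
  `lelongUpperLevelSet_ne_univ` — for `c > 0`, `E_c(T)` lies over the pole set `{V = -∞}` and
  has empty interior;
* **algebraic logarithmic potentials** (sections `LogPoly`, `VanishingOrder`, `OrderLevelSets`,
  `AlgebraicHelpers`): `log |p|` is subharmonic on `ℂ` for `p ∈ ℂ[X]`
  (`isSubharmonicOn_log_enorm_polynomial_eval`) and `log |g|` is psh on `ℂᴺ` for every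
  polynomial `g` (`isPlurisubharmonicOn_log_enorm_mvPolynomial_eval`); the Lelong number of
  `log |g|` at `w` is the order of vanishing of `g` at `w` (Hörmander, *Notions of Convexity*,
  Cor. 4.1.18: `exists_lelongNumber_log_enorm_eval_eq`, `natCast_le_lelongNumber_log_enorm_eval_iff`);
  the vanishing-order level sets are common zero sets of finitely many polynomials
  (`isAnalyticSet_setOf_homogeneousComponent_eq_zero`), whence **Siu's theorem for `log |g|` on
  `ℂᴺ`** (`isAnalyticSet_lelongUpperLevelSet_log_enorm_eval`); with the chart reduction this gives
  Siu's theorem for the currents `(c/d)[F = 0]` of homogeneous polynomials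
  (`HomogeneousPolynomialCurrent.lean`).

## References

* [HormanderSCV1973] L. Hörmander, An introduction to complex analysis in several variables,
  2nd ed. (1973): §1.6 (Thms. 1.6.2, 1.6.3).
* L. Hörmander, Notions of Convexity (1994), §4.3, Thm. 4.3.3 (Siu's theorem, Kiselman's proof),
  Lemma 4.3.1, Cor. 4.1.18.
* [Siu1974] Y.-T. Siu, Analyticity of sets associated to Lelong numbers and the extension of
  closed positive currents, Invent. Math. 27 (1974) 53–156: Main Theorem.
-/

noncomputable section

open scoped Topology ENNReal Manifold ContDiff LinearAlgebra.Projectivization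
open MeasureTheory Filter Set Metric

namespace Literature.Analysis.Pluripotential

/-! ### Subharmonic plus (mean-value) harmonic is subharmonic -/

section AddReal

variable {u : ℂ → EReal} {U : Set ℂ}

/-- A real function, continuous on `U` and with the mean-value property over every closed disc in
`U` (e.g. a harmonic function: `β log |τ| + β'` off the origin, affine functions, constants), is
subharmonic on `U` as an `[-∞, +∞)`-valued function. [cite: HormanderSCV1973, Thm. 1.6.2] -/
theorem isSubharmonicOn_coe_of_circleAverage_eq {h : ℂ → ℝ} (hhc : ContinuousOn h U)
    (hmv : ∀ ⦃c : ℂ⦄ ⦃R : ℝ⦄, 0 < R → closedBall c R ⊆ U → Real.circleAverage h c R = h c) :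
    IsSubharmonicOn (fun z ↦ ((h z : ℝ) : EReal)) U := by
  refine ⟨upperSemicontinuousOn_of_continuousOn (continuous_coe_real_ereal.comp_continuousOn hhc),
    fun z _ ↦ EReal.coe_lt_top _, fun c R hR hcl ↦ ?_⟩
  have hS : sphere c |R| ⊆ U := by
    rw [abs_of_pos hR]; exact sphere_subset_closedBall.trans hcl
  rw [circleMean_coe_eq_circleAverage h c R ((hhc.mono hS).circleIntegrable'), hmv hR hcl]

/-- **Subharmonic + harmonic.** If `u` is subharmonic on `U` and `h : ℂ → ℝ` is continuous on `U`
with the mean-value property over every closed disc in `U` (e.g. `h` harmonic, such as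
`β log |τ| + β'` off the origin, or constant), then `u + h` is subharmonic on `U`.
[cite: HormanderSCV1973, Thm. 1.6.2 and Def. 1.6.1] -/
theorem IsSubharmonicOn.add_real (hu : IsSubharmonicOn u U) {h : ℂ → ℝ} (hhc : ContinuousOn h U)
    (hmv : ∀ ⦃c : ℂ⦄ ⦃R : ℝ⦄, 0 < R → closedBall c R ⊆ U → Real.circleAverage h c R = h c) :
    IsSubharmonicOn (fun z ↦ u z + (h z : EReal)) U :=
  hu.add (isSubharmonicOn_coe_of_circleAverage_eq hhc hmv)

/-- Adding a real constant preserves subharmonicity. [folklore] -/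
theorem IsSubharmonicOn.add_const (hu : IsSubharmonicOn u U) (a : ℝ) :
    IsSubharmonicOn (fun z ↦ u z + (a : EReal)) U :=
  hu.add_real continuousOn_const fun c R _ _ ↦ Real.circleAverage_const a c R

end AddReal

/-! ### The maximum principle -/

section MaximumPrinciple

variable {u : ℂ → EReal} {U : Set ℂ}

/-- **Maximum principle on a circle.** If `u` is subharmonic on `U ⊇ D̄(z₁, R)` and
`u ≤ u(z₁)` on the circle `|z - z₁| = R`, then `u = u(z₁)` on that circle: otherwise `u < u(z₁) - η`
on an open arc (upper semicontinuity), which makes the circle mean `< u(z₁)`.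
[cite: HormanderSCV1973, Thm. 1.6.3 (proof)] -/
theorem IsSubharmonicOn.eq_of_le_on_sphere (hu : IsSubharmonicOn u U) {z₁ : ℂ} {R : ℝ}
    (hR : 0 < R) (hcl : closedBall z₁ R ⊆ U) (hle : ∀ z ∈ sphere z₁ R, u z ≤ u z₁) :
    ∀ z ∈ sphere z₁ R, u z = u z₁ := by
  classical
  have hpi : 0 < 2 * Real.pi := by positivity
  by_contra hcon
  push Not at hcon
  obtain ⟨z₂, hz₂, hne⟩ := hcon
  have hlt : u z₂ < u z₁ := (hle z₂ hz₂).lt_of_ne hne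
  -- `u z₁` is a real number `m`
  have htop : u z₁ ≠ ⊤ := (hu.lt_top (hcl (mem_closedBall_self hR.le))).ne
  have hbot : u z₁ ≠ ⊥ := by rintro h; rw [h] at hlt; exact not_lt_bot hlt
  set m := (u z₁).toReal with hm
  have hm' : u z₁ = (m : EReal) := (EReal.coe_toReal htop hbot).symm
  -- the shifted function `v = u - m`
  set v : ℂ → EReal := fun z ↦ u z + ((-m : ℝ) : EReal) with hv
  have hv_sub : IsSubharmonicOn v U := hu.add_const (-m)
  have hv1 : v z₁ = 0 := by
    simp only [hv, hm', ← EReal.coe_add, add_neg_cancel, EReal.coe_zero]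
  have hvle : ∀ z ∈ sphere z₁ R, v z ≤ 0 := fun z hz ↦ by
    have := add_le_add (hle z hz) (le_refl (((-m : ℝ)) : EReal))
    rwa [hm', ← EReal.coe_add, add_neg_cancel, EReal.coe_zero] at this
  have hv2 : v z₂ < 0 := by
    have : v z₂ < v z₁ := EReal.add_lt_add_right_coe hlt (-m)
    rwa [hv1] at this
  -- a real `η > 0` with `v z₂ < -η`
  obtain ⟨t, ht1, ht2⟩ := EReal.lt_iff_exists_real_btwn.1 hv2
  have ht0 : t < 0 := by exact_mod_cast ht2
  set η : ℝ := -t with hη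
  have hη0 : 0 < η := by rw [hη]; linarith
  have htη : (t : EReal) = ((-η : ℝ) : EReal) := by rw [hη, neg_neg]
  -- upper semicontinuity at `z₂`: `v < -η` on `V ∩ U`, `V` an open neighbourhood of `z₂`
  have hz₂U : z₂ ∈ U := hcl (sphere_subset_closedBall hz₂)
  have husc : ∀ᶠ z in 𝓝[U] z₂, v z < ((-η : ℝ) : EReal) := by
    rw [← htη]; exact hv_sub.upperSemicontinuousOn z₂ hz₂U _ ht1
  obtain ⟨V, hVo, hz₂V, hV⟩ := mem_nhdsWithin.1 husc
  -- comparison step function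
  set w : ℂ → EReal := fun z ↦ if z ∈ V then ((-η : ℝ) : EReal) else 0 with hw
  have hw_in : ∀ {z}, z ∈ V → w z = ((-η : ℝ) : EReal) := fun hz ↦ by
    simp only [hw]; rw [if_pos hz]
  have hw_out : ∀ {z}, z ∉ V → w z = 0 := fun hz ↦ by
    simp only [hw]; rw [if_neg hz]
  have hvw : ∀ θ ∈ Ioc (0 : ℝ) (2 * Real.pi), v (circleMap z₁ R θ) ≤ w (circleMap z₁ R θ) := by
    intro θ _
    have hsph : circleMap z₁ R θ ∈ sphere z₁ R := circleMap_mem_sphere z₁ hR.le θ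
    by_cases hV' : circleMap z₁ R θ ∈ V
    · rw [hw_in hV']
      exact (hV ⟨hV', hcl (sphere_subset_closedBall hsph)⟩).le
    · rw [hw_out hV']
      exact hvle _ hsph
  have hmean_le : circleMean v z₁ R ≤ circleMean w z₁ R := circleMean_mono hvw
  -- the mean of the step function
  set S : Set ℝ := (circleMap z₁ R) ⁻¹' V with hS
  have hSo : IsOpen S := hVo.preimage (continuous_circleMap z₁ R)
  have hup : circleUpperMean w z₁ R = 0 := by
    unfold circleUpperMean
    have h0 : ∀ θ, (w (circleMap z₁ R θ)).toENNReal = 0 := fun θ ↦ by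
      apply EReal.toENNReal_of_nonpos
      by_cases hV' : circleMap z₁ R θ ∈ V
      · rw [hw_in hV']
        exact_mod_cast (neg_nonpos.2 hη0.le)
      · rw [hw_out hV']
    simp [h0]
  have hlo : circleLowerMean w z₁ R = ENNReal.ofReal η * volume (S ∩ Ioc (0 : ℝ) (2 * Real.pi)) /
      ENNReal.ofReal (2 * Real.pi) := by
    unfold circleLowerMean
    have h1 : ∀ θ, (-w (circleMap z₁ R θ)).toENNReal =
        S.indicator (fun _ ↦ ENNReal.ofReal η) θ := fun θ ↦ by
      by_cases hθ : θ ∈ S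
      · have hV' : circleMap z₁ R θ ∈ V := hθ
        rw [indicator_of_mem hθ, hw_in hV', ← EReal.coe_neg, neg_neg,
          EReal.toENNReal_of_ne_top (EReal.coe_ne_top η), EReal.toReal_coe]
      · have hV' : circleMap z₁ R θ ∉ V := hθ
        rw [indicator_of_notMem hθ, hw_out hV', neg_zero, EReal.toENNReal_zero]
    simp_rw [h1]
    rw [lintegral_indicator_const hSo.measurableSet, Measure.restrict_apply hSo.measurableSet]
  -- the arc `S ∩ ]0, 2π]` has positive measure: it contains a parameter of `z₂`
  have hpos : volume (S ∩ Ioc (0 : ℝ) (2 * Real.pi)) ≠ 0 := by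
    have hz₂' : z₂ ∈ circleMap z₁ R '' Ioc 0 (2 * Real.pi) := by
      rw [image_circleMap_Ioc, abs_of_pos hR]; exact hz₂
    obtain ⟨θ₂, hθ₂, hθ₂z⟩ := hz₂'
    have hθ₂S : θ₂ ∈ S := by
      change circleMap z₁ R θ₂ ∈ V
      rw [hθ₂z]; exact hz₂V
    have hne' : (S ∩ Ioo (0 : ℝ) (2 * Real.pi)).Nonempty := by
      have hcl' : θ₂ ∈ closure (Ioo (0 : ℝ) (2 * Real.pi)) := by
        rw [closure_Ioo hpi.ne]; exact Ioc_subset_Icc_self hθ₂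
      exact mem_closure_iff_nhds.1 hcl' S (hSo.mem_nhds hθ₂S)
    have hpos' : 0 < volume (S ∩ Ioo (0 : ℝ) (2 * Real.pi)) :=
      (hSo.inter isOpen_Ioo).measure_pos volume hne'
    have hmono : volume (S ∩ Ioo (0 : ℝ) (2 * Real.pi)) ≤ volume (S ∩ Ioc (0 : ℝ) (2 * Real.pi)) :=
      measure_mono (inter_subset_inter_right _ Ioo_subset_Ioc_self)
    exact (hpos'.trans_le hmono).ne'
  have hp' : ENNReal.ofReal (2 * Real.pi) ≠ ⊤ := ENNReal.ofReal_ne_top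
  have hw_neg : circleMean w z₁ R < 0 := by
    rw [circleMean_def, hup, hlo, EReal.coe_ennreal_zero, zero_sub, EReal.neg_lt_zero,
      EReal.coe_ennreal_pos]
    exact ENNReal.div_pos_iff.2 ⟨mul_ne_zero (ENNReal.ofReal_pos.2 hη0).ne' hpos, hp'⟩
  have key := hv_sub.le_circleMean hR hcl
  rw [hv1] at key
  exact absurd (key.trans hmean_le) (not_le.2 hw_neg)

/-- **Strong maximum principle.** A subharmonic function on a preconnected open set `U` which
attains its supremum over `U` at a point of `U` is constant on `U`.
[cite: HormanderSCV1973, Thm. 1.6.3 (and the remark on the maximum principle after Def. 1.6.1)] -/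
theorem IsSubharmonicOn.eqOn_of_isMaxOn (hu : IsSubharmonicOn u U) (hUo : IsOpen U)
    (hUc : IsPreconnected U) {z₀ : ℂ} (hz₀ : z₀ ∈ U) (hmax : ∀ z ∈ U, u z ≤ u z₀) :
    EqOn u (fun _ ↦ u z₀) U := by
  set S : Set ℂ := {z | z ∈ U ∧ u z = u z₀} with hS
  set T : Set ℂ := {z | z ∈ U ∧ u z < u z₀} with hT
  have hSo : IsOpen S := by
    refine Metric.isOpen_iff.2 fun z₁ hz₁ ↦ ?_
    obtain ⟨hz₁U, hz₁⟩ := hz₁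
    obtain ⟨ε, hε, hball⟩ := Metric.isOpen_iff.1 hUo z₁ hz₁U
    refine ⟨ε / 2, half_pos hε, fun z hz ↦ ?_⟩
    have hzε : dist z z₁ < ε := (mem_ball.1 hz).trans (half_lt_self hε)
    have hzU : z ∈ U := hball (mem_ball.2 hzε)
    refine ⟨hzU, ?_⟩
    rcases eq_or_ne z z₁ with rfl | hne
    · exact hz₁
    · have hr : 0 < dist z z₁ := dist_pos.2 hne
      have hcl : closedBall z₁ (dist z z₁) ⊆ U := (closedBall_subset_ball hzε).trans hball
      have hle : ∀ y ∈ sphere z₁ (dist z z₁), u y ≤ u z₁ := fun y hy ↦ by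
        rw [hz₁]; exact hmax y (hcl (sphere_subset_closedBall hy))
      rw [← hz₁]
      exact hu.eq_of_le_on_sphere hr hcl hle z (mem_sphere.2 rfl)
  have hTo : IsOpen T := by
    rw [isOpen_iff_mem_nhds]
    rintro z ⟨hzU, hzlt⟩
    have h1 : ∀ᶠ y in 𝓝[U] z, u y < u z₀ := hu.upperSemicontinuousOn z hzU _ hzlt
    rw [eventually_nhdsWithin_iff] at h1
    filter_upwards [h1, hUo.mem_nhds hzU] with y hy hyU using ⟨hyU, hy hyU⟩
  have hsub : U ⊆ S ∪ T := fun z hz ↦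
    (hmax z hz).eq_or_lt.elim (fun h ↦ Or.inl ⟨hz, h⟩) fun h ↦ Or.inr ⟨hz, h⟩
  have hdisj : Disjoint S T := Set.disjoint_left.2 fun z hzS hzT ↦ hzT.2.ne hzS.2
  have hne : (U ∩ S).Nonempty := ⟨z₀, hz₀, hz₀, rfl⟩
  have key := hUc.subset_left_of_subset_union hSo hTo hdisj hsub hne
  exact fun z hz ↦ (key hz).2

/-- **Boundary maximum principle.** If `u` is subharmonic on a set `U` and `K ⊆ U` is
compact, the supremum of `u` over `K` is attained on the frontier of `K`: every value `u(z)`,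
`z ∈ K`, is bounded by some boundary value. (Apply the strong maximum principle on the connected
component of the interior of `K` containing a maximum point.)
[cite: HormanderSCV1973, Thm. 1.6.3 and Def. 1.6.1] -/
theorem IsSubharmonicOn.exists_mem_frontier_le (hu : IsSubharmonicOn u U)
    {K : Set ℂ} (hK : IsCompact K) (hKU : K ⊆ U) {z : ℂ} (hz : z ∈ K) :
    ∃ y ∈ frontier K, u z ≤ u y := by
  obtain ⟨zM, hzM, hmax⟩ := UpperSemicontinuousOn.exists_isMaxOn ⟨z, hz⟩ hK
    (hu.upperSemicontinuousOn.mono hKU)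
  have hmax' : ∀ y ∈ K, u y ≤ u zM := fun y hy ↦ hmax hy
  suffices h : ∃ y ∈ frontier K, u zM ≤ u y by
    obtain ⟨y, hy, hle⟩ := h
    exact ⟨y, hy, (hmax' z hz).trans hle⟩
  have hKc : IsClosed K := hK.isClosed
  by_cases hfr : zM ∈ frontier K
  · exact ⟨zM, hfr, le_rfl⟩
  · have hint : zM ∈ interior K := by
      rw [hKc.frontier_eq] at hfr
      by_contra h
      exact hfr ⟨hzM, h⟩
    set C : Set ℂ := connectedComponentIn (interior K) zM with hC
    have hCo : IsOpen C := isOpen_interior.connectedComponentIn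
    have hCc : IsPreconnected C := isPreconnected_connectedComponentIn
    have hCK : C ⊆ K := (connectedComponentIn_subset _ _).trans interior_subset
    have hzC : zM ∈ C := mem_connectedComponentIn hint
    -- `u` is constant on `C`
    have hconst : EqOn u (fun _ ↦ u zM) C :=
      (hu.mono (hCK.trans hKU)).eqOn_of_isMaxOn hCo hCc hzC fun y hy ↦ hmax' y (hCK hy)
    -- `C` is open, nonempty and not the whole plane, hence not closed
    have hCne : C ≠ univ := fun h ↦ by
      have hKu : K = univ := eq_univ_of_univ_subset (h ▸ hCK)
      exact noncompact_univ ℂ (hKu ▸ hK)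
    have hCncl : ¬IsClosed C := fun h ↦ by
      rcases isClopen_iff.1 ⟨h, hCo⟩ with h0 | h1
      · rw [h0] at hzC; exact hzC
      · exact hCne h1
    obtain ⟨y, hycl, hyC⟩ : ∃ y ∈ closure C, y ∉ C := by
      by_contra h
      push Not at h
      exact hCncl (closure_subset_iff_isClosed.1 h)
    have hyK : y ∈ K := closure_minimal hCK hKc hycl
    -- `y` is not an interior point of `K` (maximality of the component `C`)
    have hyint : y ∉ interior K := fun hy ↦ by
      obtain ⟨δ, hδ, hball⟩ := Metric.isOpen_iff.1 isOpen_interior y hy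
      obtain ⟨p, hpB, hpC⟩ : (ball y δ ∩ C).Nonempty :=
        mem_closure_iff_nhds.1 hycl _ (ball_mem_nhds y hδ)
      have hpre : IsPreconnected (ball y δ ∪ C) :=
        IsPreconnected.union p hpB hpC (convex_ball y δ).isPreconnected hCc
      have hsub : ball y δ ∪ C ⊆ C :=
        hpre.subset_connectedComponentIn (Or.inr hzC)
          (union_subset hball (connectedComponentIn_subset _ _))
      exact hyC (hsub (Or.inl (mem_ball_self hδ)))
    have hyfr : y ∈ frontier K := by
      rw [hKc.frontier_eq]; exact ⟨hyK, hyint⟩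
    refine ⟨y, hyfr, ?_⟩
    -- upper semicontinuity at `y` along `C`, where `u ≡ u zM`
    by_contra hlt
    push Not at hlt
    have h1 : ∀ᶠ w in 𝓝[U] y, u w < u zM := hu.upperSemicontinuousOn y (hKU hyK) _ hlt
    have h2 : ∀ᶠ w in 𝓝[C] y, u w < u zM := h1.filter_mono (nhdsWithin_mono y (hCK.trans hKU))
    have h3 : ∀ᶠ w in 𝓝[C] y, False := by
      filter_upwards [h2, self_mem_nhdsWithin] with w hw hwC
      rw [hconst hwC] at hw
      exact lt_irrefl _ hw
    have hbot : (𝓝[C] y).NeBot := mem_closure_iff_nhdsWithin_neBot.1 hycl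
    exact hbot.ne (eventually_false_iff_eq_bot.1 h3)

end MaximumPrinciple

/-! ### A Liouville-type lemma off the origin and the bound `ν(T, x) ≤ deg T` -/

section Growth

/-- Mean-value property of `β log |τ|` over circles not enclosing the origin:
`(2π)⁻¹ ∫ β log |c + R e^{iθ}| dθ = β log |c|` for `0 < R < |c|` (Jensen/Gauss).
[cite: HormanderSCV1973, Thm. 1.6.2 (harmonic functions have the mean-value property)] -/
theorem circleAverage_mul_log_norm {c : ℂ} {R : ℝ} (hR : 0 < R) (hc : R < ‖c‖) (β : ℝ) :
    Real.circleAverage (fun τ : ℂ ↦ β * Real.log ‖τ‖) c R = β * Real.log ‖c‖ := by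
  have h1 := circleAverage_log_norm_sub_const_eq_log_radius_add_posLog (c := c) (a := (0 : ℂ))
    hR.ne'
  simp only [sub_zero] at h1
  have hc0 : 0 < ‖c‖ := hR.trans hc
  have hone : 1 ≤ R⁻¹ * ‖c‖ := by
    rw [le_inv_mul_iff₀ hR, mul_one]; exact hc.le
  have h2 : Real.posLog (R⁻¹ * ‖c‖) = Real.log (R⁻¹ * ‖c‖) :=
    Real.posLog_eq_log (by rwa [abs_of_nonneg (by positivity)])
  have hsmul : Real.circleAverage (fun τ : ℂ ↦ β * Real.log ‖τ‖) c R =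
      β * Real.circleAverage (fun τ : ℂ ↦ Real.log ‖τ‖) c R := by
    rw [← smul_eq_mul, ← Real.circleAverage_fun_smul]
    rfl
  rw [hsmul, h1, h2, Real.log_mul (inv_ne_zero hR.ne') hc0.ne', Real.log_inv]
  ring

/-- Off the origin, `u + β log |τ|` is subharmonic whenever `u` is (`log |τ|` is harmonic there).
[cite: HormanderSCV1973, Thm. 1.6.2] -/
theorem IsSubharmonicOn.add_mul_log_norm {u : ℂ → EReal} {U : Set ℂ} (hu : IsSubharmonicOn u U)
    (hU : U ⊆ {0}ᶜ) (β : ℝ) :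
    IsSubharmonicOn (fun τ ↦ u τ + ((β * Real.log ‖τ‖ : ℝ) : EReal)) U := by
  refine hu.add_real ?_ fun c R hR hcl ↦ ?_
  · exact continuousOn_const.mul
      ((continuous_norm.continuousOn).log fun τ hτ ↦ norm_ne_zero_iff.2 (hU hτ))
  · have hc : R < ‖c‖ := by
      by_contra h
      push Not at h
      have h0 : (0 : ℂ) ∈ closedBall c R := by
        rw [mem_closedBall, dist_comm, dist_zero_right]; exact h
      exact hU (hcl h0) rfl
    exact circleAverage_mul_log_norm hR hc β

/-- **A Liouville-type lemma.** Let `f` be subharmonic on `ℂ ∖ {0}` with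
`f(τ) ≤ γ log |τ| + C₁` near `0` and `f(τ) ≤ c log |τ| + A` near `∞`, where `c < γ`. Then
`f ≡ -∞` on `ℂ ∖ {0}`: for `δ = (γ - c)/2` the subharmonic function `f + (δ - γ) log |τ|` tends to
`-∞` at both ends, so the boundary maximum principle on large annuli forces it to be `-∞`.
[cite: HormanderSCV1973, Thm. 1.6.3 (maximum principle); classical] -/
theorem IsSubharmonicOn.eq_bot_of_growth {f : ℂ → EReal} (hf : IsSubharmonicOn f {0}ᶜ)
    {γ c C₁ A ε R₀ : ℝ} (hγc : c < γ) (hε : 0 < ε)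
    (h0 : ∀ τ : ℂ, τ ≠ 0 → ‖τ‖ < ε → f τ ≤ ((γ * Real.log ‖τ‖ + C₁ : ℝ) : EReal))
    (hinf : ∀ τ : ℂ, R₀ ≤ ‖τ‖ → f τ ≤ ((c * Real.log ‖τ‖ + A : ℝ) : EReal)) :
    ∀ τ : ℂ, τ ≠ 0 → f τ = ⊥ := by
  intro τ₀ hτ₀
  by_contra hne
  have hτ₀pos : 0 < ‖τ₀‖ := norm_pos_iff.2 hτ₀
  set δ : ℝ := (γ - c) / 2 with hδ
  have hδ0 : 0 < δ := by rw [hδ]; linarith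
  set β : ℝ := δ - γ with hβ
  -- `g = f + β log |τ|` is subharmonic off the origin and tends to `-∞` at `0` and at `∞`
  set g : ℂ → EReal := fun τ ↦ f τ + ((β * Real.log ‖τ‖ : ℝ) : EReal) with hg
  have hg_sub : IsSubharmonicOn g {0}ᶜ := hf.add_mul_log_norm Subset.rfl β
  have hg0 : ∀ τ : ℂ, τ ≠ 0 → ‖τ‖ < ε → g τ ≤ ((δ * Real.log ‖τ‖ + C₁ : ℝ) : EReal) := by
    intro τ hτ hτε
    calc g τ ≤ ((γ * Real.log ‖τ‖ + C₁ : ℝ) : EReal) + ((β * Real.log ‖τ‖ : ℝ) : EReal) :=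
          add_le_add (h0 τ hτ hτε) le_rfl
      _ = ((δ * Real.log ‖τ‖ + C₁ : ℝ) : EReal) := by
          rw [← EReal.coe_add, hβ]; congr 1; ring
  have hginf : ∀ τ : ℂ, R₀ ≤ ‖τ‖ → g τ ≤ ((A - δ * Real.log ‖τ‖ : ℝ) : EReal) := by
    intro τ hτ
    calc g τ ≤ ((c * Real.log ‖τ‖ + A : ℝ) : EReal) + ((β * Real.log ‖τ‖ : ℝ) : EReal) :=
          add_le_add (hinf τ hτ) le_rfl
      _ = ((A - δ * Real.log ‖τ‖ : ℝ) : EReal) := by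
          rw [← EReal.coe_add, hβ, hδ]; congr 1; ring
  -- `g τ₀` is a real number, `> b`
  have hgτ₀_bot : g τ₀ ≠ ⊥ := EReal.add_ne_bot_iff.2 ⟨hne, EReal.coe_ne_bot _⟩
  have hgτ₀_top : g τ₀ ≠ ⊤ := (hg_sub.lt_top hτ₀).ne
  set b : ℝ := (g τ₀).toReal - 1 with hb
  have hb_lt : (b : EReal) < g τ₀ := by
    rw [← EReal.coe_toReal hgτ₀_top hgτ₀_bot, EReal.coe_lt_coe_iff, hb]
    linarith
  -- radii: `δ log r + C₁ < b` and `A - δ log Rb < b`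
  obtain ⟨r, hr0, hrε, hrτ₀, hr_bound⟩ :
      ∃ r : ℝ, 0 < r ∧ r < ε ∧ r < ‖τ₀‖ ∧ δ * Real.log r + C₁ < b := by
    refine ⟨min (ε / 2) (min (‖τ₀‖ / 2) (Real.exp ((b - C₁ - 1) / δ))), ?_, ?_, ?_, ?_⟩
    · positivity
    · exact (min_le_left _ _).trans_lt (half_lt_self hε)
    · exact ((min_le_right _ _).trans (min_le_left _ _)).trans_lt (half_lt_self hτ₀pos)
    · have hle : Real.log (min (ε / 2) (min (‖τ₀‖ / 2) (Real.exp ((b - C₁ - 1) / δ)))) ≤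
          (b - C₁ - 1) / δ :=
        calc Real.log (min (ε / 2) (min (‖τ₀‖ / 2) (Real.exp ((b - C₁ - 1) / δ))))
            ≤ Real.log (Real.exp ((b - C₁ - 1) / δ)) :=
              Real.log_le_log (by positivity) ((min_le_right _ _).trans (min_le_right _ _))
          _ = (b - C₁ - 1) / δ := Real.log_exp _
      have := mul_le_mul_of_nonneg_left hle hδ0.le
      rw [mul_div_cancel₀ _ hδ0.ne'] at this
      linarith
  obtain ⟨Rb, hRbR₀, hRbτ₀, hRb_bound⟩ :
      ∃ Rb : ℝ, R₀ ≤ Rb ∧ ‖τ₀‖ < Rb ∧ A - δ * Real.log Rb < b := by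
    refine ⟨max (max R₀ (‖τ₀‖ + 1)) (Real.exp ((A - b + 1) / δ)), ?_, ?_, ?_⟩
    · exact le_max_of_le_left (le_max_left _ _)
    · exact lt_max_of_lt_left (lt_max_of_lt_right (lt_add_one _))
    · have hle : (A - b + 1) / δ ≤
          Real.log (max (max R₀ (‖τ₀‖ + 1)) (Real.exp ((A - b + 1) / δ))) :=
        calc (A - b + 1) / δ = Real.log (Real.exp ((A - b + 1) / δ)) := (Real.log_exp _).symm
          _ ≤ Real.log (max (max R₀ (‖τ₀‖ + 1)) (Real.exp ((A - b + 1) / δ))) :=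
              Real.log_le_log (Real.exp_pos _) (le_max_right _ _)
      have := mul_le_mul_of_nonneg_left hle hδ0.le
      rw [mul_div_cancel₀ _ hδ0.ne'] at this
      linarith
  have hrRb : r < Rb := hrτ₀.trans hRbτ₀
  -- the closed annulus `r ≤ |τ| ≤ Rb`
  set K : Set ℂ := (fun τ : ℂ ↦ ‖τ‖) ⁻¹' Icc r Rb with hK
  have hKc : IsCompact K :=
    Metric.isCompact_of_isClosed_isBounded (isClosed_Icc.preimage continuous_norm)
      (isBounded_closedBall.subset fun τ hτ ↦ mem_closedBall_zero_iff.2 hτ.2)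
  have hK0 : K ⊆ {0}ᶜ := by
    intro τ hτ h0
    have : r ≤ ‖τ‖ := hτ.1
    rw [h0, norm_zero] at this
    exact (not_le.2 hr0) this
  have hτ₀K : τ₀ ∈ K := ⟨hrτ₀.le, hRbτ₀.le⟩
  obtain ⟨y, hyfr, hy⟩ := hg_sub.exists_mem_frontier_le hKc hK0 hτ₀K
  -- the frontier of the annulus consists of the two circles
  have hyn : ‖y‖ = r ∨ ‖y‖ = Rb := by
    have := continuous_norm.frontier_preimage_subset (Icc r Rb) hyfr
    rw [frontier_Icc hrRb.le] at this
    simpa using this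
  have hgy : g y < (b : EReal) := by
    rcases hyn with h | h
    · have hy0 : y ≠ 0 := by rw [← norm_pos_iff, h]; exact hr0
      calc g y ≤ ((δ * Real.log ‖y‖ + C₁ : ℝ) : EReal) := hg0 y hy0 (by rw [h]; exact hrε)
        _ < (b : EReal) := by rw [h]; exact_mod_cast hr_bound
    · calc g y ≤ ((A - δ * Real.log ‖y‖ : ℝ) : EReal) := hginf y (by rw [h]; exact hRbR₀)
        _ < (b : EReal) := by rw [h]; exact_mod_cast hRb_bound
  exact absurd (hb_lt.trans_le hy) (not_lt.2 hgy.le)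

/-- Mean-value property of `log |τ - a|` over circles not enclosing `a`:
`(2π)⁻¹ ∫ log |c + R e^{iθ} - a| dθ = log |c - a|` for `0 < R < |c - a|`.
[cite: HormanderSCV1973, Thm. 1.6.2] -/
theorem circleAverage_log_norm_sub {c a : ℂ} {R : ℝ} (hR : 0 < R) (hc : R < ‖c - a‖) :
    Real.circleAverage (fun τ : ℂ ↦ Real.log ‖τ - a‖) c R = Real.log ‖c - a‖ := by
  have h1 := circleAverage_log_norm_sub_const_eq_log_radius_add_posLog (c := c) (a := a) hR.ne'
  have hc0 : 0 < ‖c - a‖ := hR.trans hc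
  have hone : 1 ≤ R⁻¹ * ‖c - a‖ := by
    rw [le_inv_mul_iff₀ hR, mul_one]; exact hc.le
  have h2 : Real.posLog (R⁻¹ * ‖c - a‖) = Real.log (R⁻¹ * ‖c - a‖) :=
    Real.posLog_eq_log (by rwa [abs_of_nonneg (by positivity)])
  rw [h2, Real.log_mul (inv_ne_zero hR.ne') hc0.ne', Real.log_inv] at h1
  rw [h1]
  ring

/-- **Liouville-type lemma with finitely many poles.** Let `P ⊂ ℂ` be finite, `f` subharmonic on
`ℂ ∖ P` with `f(τ) ≤ γ log |τ - a| + C_a` near each `a ∈ P` and `f(τ) ≤ c log |τ| + A` near `∞`,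
where `0 ≤ c < #P · γ`. Then `f ≡ -∞` on `ℂ ∖ P`: with `β = (γ + c/#P)/2` the subharmonic
function `f - β Σ_{a ∈ P} log |τ - a|` tends to `-∞` at every pole (`β < γ`) and at infinity
(`#P β > c`), and the boundary maximum principle on `{|τ| ≤ R} ∖ ⋃ B(a, r)` forces it to be `-∞`.
[cite: HormanderSCV1973, Thm. 1.6.3 (maximum principle); classical] -/
theorem IsSubharmonicOn.eq_bot_of_growth_finset {f : ℂ → EReal} {P : Finset ℂ}
    (hf : IsSubharmonicOn f ((↑P : Set ℂ)ᶜ)) {γ c : ℝ} (hc : 0 ≤ c) (hk : c < P.card * γ)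
    (h0 : ∀ a ∈ P, ∃ C ε : ℝ, 0 < ε ∧ ∀ τ : ℂ, τ ≠ a → ‖τ - a‖ < ε →
      f τ ≤ ((γ * Real.log ‖τ - a‖ + C : ℝ) : EReal))
    {A R₀ : ℝ} (hinf : ∀ τ : ℂ, R₀ ≤ ‖τ‖ → f τ ≤ ((c * Real.log ‖τ‖ + A : ℝ) : EReal)) :
    ∀ τ : ℂ, τ ∉ P → f τ = ⊥ := by
  classical
  intro τ₀ hτ₀
  by_contra hne
  -- numerology: `k = #P ≥ 1`, `γ > 0`, `β = (γ + c/k)/2 ∈ (0, γ)`, `k β > c`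
  set k : ℕ := P.card with hk_def
  have hkγ : 0 < (k : ℝ) * γ := hc.trans_lt hk
  have hk0 : k ≠ 0 := by
    rintro h
    rw [h, Nat.cast_zero, zero_mul] at hkγ
    exact lt_irrefl _ hkγ
  have hkpos : 0 < (k : ℝ) := by exact_mod_cast Nat.pos_of_ne_zero hk0
  have hγpos : 0 < γ := (mul_pos_iff_of_pos_left hkpos).1 hkγ
  have hPne : P.Nonempty := Finset.card_pos.1 (Nat.pos_of_ne_zero hk0)
  set β : ℝ := (γ + c / k) / 2 with hβ
  have hck : c / k < γ := by rw [div_lt_iff₀ hkpos]; linarith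
  have hβγ : β < γ := by rw [hβ]; linarith
  have hβ0 : 0 < β := by
    have : 0 ≤ c / k := div_nonneg hc hkpos.le
    rw [hβ]; linarith
  have hkβ : c < k * β := by
    have : (k : ℝ) * β = (k * γ + c) / 2 := by
      rw [hβ]; field_simp
    rw [this]; linarith
  set δ : ℝ := γ - β with hδ
  have hδ0 : 0 < δ := sub_pos.2 hβγ
  set κ : ℝ := k * β - c with hκ
  have hκ0 : 0 < κ := sub_pos.2 hkβ
  -- the harmonic correction `h = -β Σ log |τ - a|` and `g = f + h`
  set h : ℂ → ℝ := fun τ ↦ ∑ a ∈ P, (-β) * Real.log ‖τ - a‖ with hh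
  have hcont_term : ∀ a : ℂ, ContinuousOn (fun τ : ℂ ↦ (-β) * Real.log ‖τ - a‖) {a}ᶜ :=
    fun a ↦ continuousOn_const.mul (((continuous_id.sub continuous_const).norm.continuousOn).log
      fun τ hτ ↦ norm_ne_zero_iff.2 (sub_ne_zero.2 hτ))
  have hhc : ContinuousOn h ((↑P : Set ℂ)ᶜ) := by
    refine continuousOn_finsetSum _ fun a ha ↦ (hcont_term a).mono fun τ hτ h' ↦ hτ ?_
    rw [mem_singleton_iff] at h'
    rw [h']; exact ha
  have hmv : ∀ ⦃c₀ : ℂ⦄ ⦃R : ℝ⦄, 0 < R → closedBall c₀ R ⊆ ((↑P : Set ℂ)ᶜ) →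
      Real.circleAverage h c₀ R = h c₀ := by
    intro c₀ R hR hcl
    have hfar : ∀ a ∈ P, R < ‖c₀ - a‖ := fun a ha ↦ by
      by_contra h'
      push Not at h'
      exact hcl (mem_closedBall_iff_norm'.2 h') ha
    have hint : ∀ a ∈ P, CircleIntegrable (fun τ : ℂ ↦ (-β) * Real.log ‖τ - a‖) c₀ R := by
      intro a _
      have : CircleIntegrable (fun τ : ℂ ↦ Real.log ‖τ - a‖) c₀ R :=
        MeromorphicOn.circleIntegrable_log_norm (fun _ _ ↦ by fun_prop)
      exact this.const_smul (a := -β)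
    rw [hh, Real.circleAverage_fun_sum hint]
    refine Finset.sum_congr rfl fun a ha ↦ ?_
    have hsm : Real.circleAverage (fun τ : ℂ ↦ -β * Real.log ‖τ - a‖) c₀ R =
        -β * Real.circleAverage (fun τ : ℂ ↦ Real.log ‖τ - a‖) c₀ R := by
      rw [← smul_eq_mul, ← Real.circleAverage_fun_smul]
      rfl
    rw [hsm, circleAverage_log_norm_sub hR (hfar a ha)]
  set g : ℂ → EReal := fun τ ↦ f τ + (h τ : EReal) with hg
  have hg_sub : IsSubharmonicOn g ((↑P : Set ℂ)ᶜ) := hf.add_real hhc hmv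
  -- behaviour near the poles: `g ≤ δ log |τ - a| + C'`
  have hnear : ∀ a ∈ P, ∃ C' ε' : ℝ, 0 < ε' ∧ ∀ τ : ℂ, τ ≠ a → ‖τ - a‖ < ε' →
      g τ ≤ ((δ * Real.log ‖τ - a‖ + C' : ℝ) : EReal) := by
    intro a ha
    obtain ⟨C, ε, hε, hCε⟩ := h0 a ha
    set h' : ℂ → ℝ := fun τ ↦ ∑ a' ∈ P.erase a, (-β) * Real.log ‖τ - a'‖ with hh'
    have hh'c : ContinuousAt h' a := by
      have hopen : IsOpen ((↑(P.erase a) : Set ℂ)ᶜ) := (P.erase a).finite_toSet.isClosed.isOpen_compl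
      have hmem : a ∈ ((↑(P.erase a) : Set ℂ)ᶜ) := fun h ↦ (P.notMem_erase a) h
      have hco : ContinuousOn h' ((↑(P.erase a) : Set ℂ)ᶜ) := by
        refine continuousOn_finsetSum _ fun a' ha' ↦ (hcont_term a').mono fun τ hτ h'' ↦ hτ ?_
        rw [mem_singleton_iff] at h''
        rw [h'']; exact ha'
      exact hco.continuousAt (hopen.mem_nhds hmem)
    obtain ⟨η, hη, hηb⟩ : ∃ η > 0, ∀ τ : ℂ, ‖τ - a‖ < η → h' τ ≤ h' a + 1 := by
      obtain ⟨η, hη, hη'⟩ := (Metric.continuousAt_iff.1 hh'c) 1 one_pos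
      refine ⟨η, hη, fun τ hτ ↦ ?_⟩
      have := hη' (by rwa [dist_eq_norm])
      rw [Real.dist_eq] at this
      linarith [(abs_lt.1 this).2]
    refine ⟨C + (h' a + 1), min ε η, lt_min hε hη, fun τ hτa hτ ↦ ?_⟩
    have hτε : ‖τ - a‖ < ε := hτ.trans_le (min_le_left _ _)
    have hτη : ‖τ - a‖ < η := hτ.trans_le (min_le_right _ _)
    have hsplit : h τ = (-β) * Real.log ‖τ - a‖ + h' τ := by
      rw [hh, hh']
      exact (Finset.add_sum_erase P (fun a' ↦ (-β) * Real.log ‖τ - a'‖) ha).symm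
    have hb' := hηb τ hτη
    calc g τ = f τ + ((h τ : ℝ) : EReal) := rfl
      _ ≤ ((γ * Real.log ‖τ - a‖ + C : ℝ) : EReal) + ((h τ : ℝ) : EReal) :=
          add_le_add (hCε τ hτa hτε) le_rfl
      _ = (((γ * Real.log ‖τ - a‖ + C) + ((-β) * Real.log ‖τ - a‖ + h' τ) : ℝ) : EReal) := by
          rw [← EReal.coe_add, hsplit]
      _ ≤ ((δ * Real.log ‖τ - a‖ + (C + (h' a + 1)) : ℝ) : EReal) := by
          rw [EReal.coe_le_coe_iff, hδ, sub_mul]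
          linarith
  choose! Cf εf hεf hgε using hnear
  set ε₀ : ℝ := P.inf' hPne εf with hε₀
  have hε₀pos : 0 < ε₀ := (Finset.lt_inf'_iff hPne).2 fun a ha ↦ hεf a ha
  have hε₀le : ∀ a ∈ P, ε₀ ≤ εf a := fun a ha ↦ Finset.inf'_le _ ha
  set C₀ : ℝ := P.sup' hPne Cf with hC₀
  have hC₀ge : ∀ a ∈ P, Cf a ≤ C₀ := fun a ha ↦ Finset.le_sup' Cf ha
  -- behaviour at infinity: `g ≤ A' - κ log |τ|`
  set Ra : ℝ := ∑ a ∈ P, ‖a‖ with hRa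
  have hRa_ge : ∀ a ∈ P, ‖a‖ ≤ Ra := fun a ha ↦
    Finset.single_le_sum (f := fun a : ℂ ↦ ‖a‖) (fun a _ ↦ norm_nonneg a) ha
  set A' : ℝ := A + k * (β * Real.log 2) with hA'
  set R₁ : ℝ := max (max R₀ 1) (2 * Ra) with hR₁
  have hginf : ∀ τ : ℂ, R₁ ≤ ‖τ‖ → g τ ≤ ((A' - κ * Real.log ‖τ‖ : ℝ) : EReal) := by
    intro τ hτ
    have hτR₀ : R₀ ≤ ‖τ‖ := ((le_max_left _ _).trans (le_max_left _ _)).trans hτ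
    have hτ1 : 1 ≤ ‖τ‖ := ((le_max_right _ _).trans (le_max_left _ _)).trans hτ
    have hτRa : 2 * Ra ≤ ‖τ‖ := (le_max_right _ _).trans hτ
    have hτpos : 0 < ‖τ‖ := one_pos.trans_le hτ1
    have hterm : ∀ a ∈ P, (-β) * Real.log ‖τ - a‖ ≤ -β * Real.log ‖τ‖ + β * Real.log 2 := by
      intro a ha
      have h1 : ‖τ‖ / 2 ≤ ‖τ - a‖ := by
        have := norm_sub_norm_le τ a
        have := hRa_ge a ha
        linarith
      have h2 : Real.log (‖τ‖ / 2) ≤ Real.log ‖τ - a‖ := Real.log_le_log (by positivity) h1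
      rw [Real.log_div hτpos.ne' two_ne_zero] at h2
      have := mul_le_mul_of_nonpos_left h2 (neg_nonpos.2 hβ0.le)
      linarith
    have hsum : h τ ≤ k * (-β * Real.log ‖τ‖ + β * Real.log 2) := by
      rw [hh]
      calc ∑ a ∈ P, (-β) * Real.log ‖τ - a‖
          ≤ ∑ a ∈ P, (-β * Real.log ‖τ‖ + β * Real.log 2) := Finset.sum_le_sum hterm
        _ = k * (-β * Real.log ‖τ‖ + β * Real.log 2) := by
          rw [Finset.sum_const, nsmul_eq_mul, hk_def]
    calc g τ ≤ ((c * Real.log ‖τ‖ + A : ℝ) : EReal) + ((h τ : ℝ) : EReal) :=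
          add_le_add (hinf τ hτR₀) le_rfl
      _ ≤ ((c * Real.log ‖τ‖ + A : ℝ) : EReal) +
            ((k * (-β * Real.log ‖τ‖ + β * Real.log 2) : ℝ) : EReal) :=
          add_le_add le_rfl (EReal.coe_le_coe_iff.2 hsum)
      _ = ((A' - κ * Real.log ‖τ‖ : ℝ) : EReal) := by
          rw [← EReal.coe_add, hA', hκ]; congr 1; ring
  -- `g τ₀` is a real number `> b`
  have hτ₀' : τ₀ ∈ ((↑P : Set ℂ)ᶜ) := fun h ↦ hτ₀ (Finset.mem_coe.1 h)
  have hgbot : g τ₀ ≠ ⊥ := EReal.add_ne_bot_iff.2 ⟨hne, EReal.coe_ne_bot _⟩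
  have hgtop : g τ₀ ≠ ⊤ := (hg_sub.lt_top hτ₀').ne
  set b : ℝ := (g τ₀).toReal - 1 with hb
  have hb_lt : (b : EReal) < g τ₀ := by
    rw [← EReal.coe_toReal hgtop hgbot, EReal.coe_lt_coe_iff, hb]
    linarith
  -- distance from `τ₀` to the poles
  set m₀ : ℝ := P.inf' hPne (fun a ↦ ‖τ₀ - a‖) with hm₀
  have hm₀pos : 0 < m₀ :=
    (Finset.lt_inf'_iff hPne).2 fun a ha ↦ norm_pos_iff.2 (sub_ne_zero.2 fun h ↦ hτ₀ (h ▸ ha))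
  have hm₀le : ∀ a ∈ P, m₀ ≤ ‖τ₀ - a‖ := fun a ha ↦ Finset.inf'_le _ ha
  -- radii
  obtain ⟨r, hr0, hrε, hrm, hr_bound⟩ :
      ∃ r : ℝ, 0 < r ∧ r < ε₀ ∧ r < m₀ ∧ δ * Real.log r + C₀ < b := by
    refine ⟨min (ε₀ / 2) (min (m₀ / 2) (Real.exp ((b - C₀ - 1) / δ))), ?_, ?_, ?_, ?_⟩
    · positivity
    · exact (min_le_left _ _).trans_lt (half_lt_self hε₀pos)
    · exact ((min_le_right _ _).trans (min_le_left _ _)).trans_lt (half_lt_self hm₀pos)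
    · have hle : Real.log (min (ε₀ / 2) (min (m₀ / 2) (Real.exp ((b - C₀ - 1) / δ)))) ≤
          (b - C₀ - 1) / δ :=
        calc Real.log (min (ε₀ / 2) (min (m₀ / 2) (Real.exp ((b - C₀ - 1) / δ))))
            ≤ Real.log (Real.exp ((b - C₀ - 1) / δ)) :=
              Real.log_le_log (by positivity) ((min_le_right _ _).trans (min_le_right _ _))
          _ = (b - C₀ - 1) / δ := Real.log_exp _
      have := mul_le_mul_of_nonneg_left hle hδ0.le
      rw [mul_div_cancel₀ _ hδ0.ne'] at this
      linarith
  obtain ⟨Rb, hRbR₁, hRbτ₀, hRb_bound⟩ :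
      ∃ Rb : ℝ, R₁ ≤ Rb ∧ ‖τ₀‖ < Rb ∧ A' - κ * Real.log Rb < b := by
    refine ⟨max (max R₁ (‖τ₀‖ + 1)) (Real.exp ((A' - b + 1) / κ)), ?_, ?_, ?_⟩
    · exact le_max_of_le_left (le_max_left _ _)
    · exact lt_max_of_lt_left (lt_max_of_lt_right (lt_add_one _))
    · have hle : (A' - b + 1) / κ ≤
          Real.log (max (max R₁ (‖τ₀‖ + 1)) (Real.exp ((A' - b + 1) / κ))) :=
        calc (A' - b + 1) / κ = Real.log (Real.exp ((A' - b + 1) / κ)) := (Real.log_exp _).symm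
          _ ≤ Real.log (max (max R₁ (‖τ₀‖ + 1)) (Real.exp ((A' - b + 1) / κ))) :=
              Real.log_le_log (Real.exp_pos _) (le_max_right _ _)
      have := mul_le_mul_of_nonneg_left hle hκ0.le
      rw [mul_div_cancel₀ _ hκ0.ne'] at this
      linarith
  -- the compact set `K = {|τ| ≤ Rb} ∩ ⋂_{a ∈ P} {|τ - a| ≥ r}`
  set K : Set ℂ := closedBall (0 : ℂ) Rb ∩ {τ | ∀ a ∈ P, r ≤ ‖τ - a‖} with hK
  have hKclosed : IsClosed {τ : ℂ | ∀ a ∈ P, r ≤ ‖τ - a‖} := by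
    have : {τ : ℂ | ∀ a ∈ P, r ≤ ‖τ - a‖} = ⋂ a ∈ P, {τ : ℂ | r ≤ ‖τ - a‖} := by
      ext τ; simp
    rw [this]
    exact isClosed_biInter fun a _ ↦
      isClosed_le continuous_const (continuous_id.sub continuous_const).norm
  have hKc : IsCompact K := (isCompact_closedBall 0 Rb).inter_right hKclosed
  have hKP : K ⊆ ((↑P : Set ℂ)ᶜ) := by
    intro τ hτ hτP
    have := hτ.2 τ (Finset.mem_coe.1 hτP)
    rw [sub_self, norm_zero] at this
    exact (not_le.2 hr0) this
  have hτ₀K : τ₀ ∈ K :=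
    ⟨mem_closedBall_zero_iff.2 hRbτ₀.le, fun a ha ↦ hrm.le.trans (hm₀le a ha)⟩
  obtain ⟨y, hyfr, hy⟩ := hg_sub.exists_mem_frontier_le hKc hKP hτ₀K
  have hyK : y ∈ K := hKc.isClosed.frontier_subset hyfr
  -- `y` lies on the outer circle or on a small circle about a pole
  have hyalt : ‖y‖ = Rb ∨ ∃ a ∈ P, ‖y - a‖ = r := by
    by_contra hcon
    push Not at hcon
    obtain ⟨hy1, hy2⟩ := hcon
    have hy1' : ‖y‖ < Rb := lt_of_le_of_ne (mem_closedBall_zero_iff.1 hyK.1) hy1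
    have hy2' : ∀ a ∈ P, r < ‖y - a‖ := fun a ha ↦
      lt_of_le_of_ne (hyK.2 a ha) fun h ↦ hy2 a ha h.symm
    have hO : IsOpen (ball (0 : ℂ) Rb ∩ {τ | ∀ a ∈ P, r < ‖τ - a‖}) := by
      refine isOpen_ball.inter ?_
      have : {τ : ℂ | ∀ a ∈ P, r < ‖τ - a‖} = ⋂ a ∈ P, {τ : ℂ | r < ‖τ - a‖} := by
        ext τ; simp
      rw [this]
      exact isOpen_biInter_finset fun a _ ↦
        isOpen_lt continuous_const (continuous_id.sub continuous_const).norm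
    have hyint : y ∈ interior K := by
      rw [mem_interior_iff_mem_nhds]
      refine mem_of_superset (hO.mem_nhds ⟨mem_ball_zero_iff.2 hy1', hy2'⟩) ?_
      rintro τ ⟨hτ1, hτ2⟩
      exact ⟨ball_subset_closedBall hτ1, fun a ha ↦ (hτ2 a ha).le⟩
    exact hyfr.2 hyint
  have hgy : g y < (b : EReal) := by
    rcases hyalt with h | ⟨a, ha, h⟩
    · calc g y ≤ ((A' - κ * Real.log ‖y‖ : ℝ) : EReal) := hginf y (by rw [h]; exact hRbR₁)
        _ < (b : EReal) := by rw [h]; exact_mod_cast hRb_bound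
    · have hya : y ≠ a := by
        intro h'
        rw [h', sub_self, norm_zero] at h
        exact hr0.ne' h.symm
      have hyr : ‖y - a‖ < εf a := by rw [h]; exact hrε.trans_le (hε₀le a ha)
      calc g y ≤ ((δ * Real.log ‖y - a‖ + Cf a : ℝ) : EReal) := hgε a ha y hya hyr
        _ ≤ ((δ * Real.log r + C₀ : ℝ) : EReal) := by
            rw [h]; exact_mod_cast add_le_add (le_refl _) (hC₀ge a ha)
        _ < (b : EReal) := by exact_mod_cast hr_bound
  exact absurd (hb_lt.trans_le hy) (not_lt.2 hgy.le)

end Growth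


/-! ### Admissible slopes below the Lelong number -/

section Slopes

variable {E : Type*} [NormedAddCommGroup E]

/-- The admissible Lelong slopes are downward closed in `[0, ∞)`: near `a`, `log ‖z - a‖ ≤ 0`.
(Private copy of `mem_lelongSlopes_of_le` of `RegularLocusLeviForm.lean`, to keep the import
graph of this file small.) [folklore] -/
private theorem mem_lelongSlopes_of_le_aux {u : E → EReal} {a : E} {γ γ' : ℝ} (hγ : γ ∈ lelongSlopes u a)
    (h0 : 0 ≤ γ') (hle : γ' ≤ γ) : γ' ∈ lelongSlopes u a := by
  obtain ⟨-, C, hC⟩ := hγ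
  refine ⟨h0, C, ?_⟩
  have hball : ∀ᶠ z in 𝓝[≠] a, z ∈ ball a 1 := mem_nhdsWithin_of_mem_nhds (ball_mem_nhds a one_pos)
  filter_upwards [hC, hball] with z hz hzb
  refine hz.trans ?_
  have hlog : Real.log ‖z - a‖ ≤ 0 :=
    Real.log_nonpos (norm_nonneg _) (mem_ball_iff_norm.1 hzb).le
  exact_mod_cast add_le_add (mul_le_mul_of_nonpos_right hle hlog) (le_refl C)

/-- Every `γ ∈ [0, ν(u, a))` is an admissible Lelong slope at `a`. [folklore] -/
theorem mem_lelongSlopes_of_lt_lelongNumber {u : E → EReal} {a : E} {γ : ℝ} (h0 : 0 ≤ γ)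
    (hγ : γ < lelongNumber u a) : γ ∈ lelongSlopes u a := by
  rw [lelongNumber_eq_sSup] at hγ
  have hne : (lelongSlopes u a).Nonempty := by
    by_contra h
    rw [not_nonempty_iff_eq_empty] at h
    rw [h, Real.sSup_empty] at hγ
    exact (not_lt.2 h0) hγ
  obtain ⟨γ₁, hγ₁, hlt⟩ := exists_lt_of_lt_csSup hne hγ
  exact mem_lelongSlopes_of_le_aux hγ₁ h0 hlt.le

end Slopes

/-! ### Cone potentials: slices through a point, `ν(T, x) ≤ deg T`, and `E_c(T) = ∅` for `c > deg T` -/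

namespace ClosedPositiveOneOneCurrent

variable {N : ℕ} (T : ClosedPositiveOneOneCurrent N)

/-- **Growth of the cone potential along an affine line missing the vertex**: if
`v + τ w ≠ 0` for all `τ` (and `w ≠ 0`) then `V(v + τ w) ≤ deg T · log |τ| + A` for `|τ| ≥ R₀`,
by log-homogeneity (`v + τ w = τ (w + τ⁻¹ v)`) and upper semicontinuity of `V` at `w`.
[folklore] -/
theorem exists_pot_add_smul_le {v w : Fin (N + 1) → ℂ} (hw0 : w ≠ 0)
    (hvw : ∀ τ : ℂ, v + τ • w ≠ 0) :
    ∃ A R₀ : ℝ, ∀ τ : ℂ, R₀ ≤ ‖τ‖ →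
      T.pot (v + τ • w) ≤ ((T.degree * Real.log ‖τ‖ + A : ℝ) : EReal) := by
  obtain ⟨A, hA⟩ : ∃ A : ℝ, ∀ᶠ y in 𝓝 w, T.pot y ≤ (A : EReal) := by
    obtain ⟨A, hwA, -⟩ := EReal.lt_iff_exists_real_btwn.1 (T.pot_lt_top hw0)
    refine ⟨A, ?_⟩
    have h1 : ∀ᶠ y in 𝓝[({0}ᶜ : Set (Fin (N + 1) → ℂ))] w, T.pot y < (A : EReal) :=
      T.isPlurisubharmonicOn_pot.upperSemicontinuousOn w hw0 _ hwA
    have h2 : ({0}ᶜ : Set (Fin (N + 1) → ℂ)) ∈ 𝓝 w := isOpen_compl_singleton.mem_nhds hw0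
    rw [nhdsWithin_eq_nhds.2 h2] at h1
    exact h1.mono fun y hy ↦ hy.le
  obtain ⟨ρ, hρ, hball⟩ := Metric.eventually_nhds_iff_ball.1 hA
  have hvρ : 0 ≤ ‖v‖ / ρ := by positivity
  refine ⟨A, ‖v‖ / ρ + 1, fun τ hτ ↦ ?_⟩
  have hτpos : 0 < ‖τ‖ := lt_of_lt_of_le (by linarith) hτ
  have hτ0 : τ ≠ 0 := norm_pos_iff.1 hτpos
  have hdecomp : v + τ • w = τ • (w + τ⁻¹ • v) := by
    rw [smul_add, smul_inv_smul₀ hτ0]; exact add_comm _ _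
  have hne : w + τ⁻¹ • v ≠ 0 := by
    intro h; apply hvw τ; rw [hdecomp, h, smul_zero]
  have hmem : w + τ⁻¹ • v ∈ ball w ρ := by
    rw [mem_ball, dist_eq_norm, add_sub_cancel_left, norm_smul, norm_inv,
      inv_mul_lt_iff₀ hτpos]
    have : ‖v‖ / ρ < ‖τ‖ := lt_of_lt_of_le (lt_add_one _) hτ
    rw [div_lt_iff₀ hρ] at this
    linarith
  calc T.pot (v + τ • w) = T.pot (τ • (w + τ⁻¹ • v)) := by rw [hdecomp]
    _ = T.pot (w + τ⁻¹ • v) + ((T.degree * Real.log ‖τ‖ : ℝ) : EReal) := T.pot_smul hτ0 hne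
    _ ≤ (A : EReal) + ((T.degree * Real.log ‖τ‖ : ℝ) : EReal) :=
        add_le_add (hball _ hmem) le_rfl
    _ = ((T.degree * Real.log ‖τ‖ + A : ℝ) : EReal) := by rw [← EReal.coe_add, add_comm]

/-- **Transport of an admissible slope to the parameter plane**: an admissible Lelong slope `γ` of
`V` at `v + a w` (`w ≠ 0`) gives `V(v + τ w) ≤ γ log |τ - a| + C` for `τ ≠ a` near `a`.
[folklore] -/
theorem exists_pot_add_smul_le_of_mem_lelongSlopes {v w : Fin (N + 1) → ℂ} (hw0 : w ≠ 0)
    {a : ℂ} {γ : ℝ} (hγ : γ ∈ lelongSlopes T.pot (v + a • w)) :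
    ∃ C ε : ℝ, 0 < ε ∧ ∀ τ : ℂ, τ ≠ a → ‖τ - a‖ < ε →
      T.pot (v + τ • w) ≤ ((γ * Real.log ‖τ - a‖ + C : ℝ) : EReal) := by
  obtain ⟨-, C, hC⟩ := hγ
  have htend : Tendsto (fun τ : ℂ ↦ v + τ • w) (𝓝[≠] a) (𝓝[≠] (v + a • w)) := by
    refine tendsto_nhdsWithin_of_tendsto_nhds_of_eventually_within _ ?_ ?_
    · have hc : Continuous (fun τ : ℂ ↦ v + τ • w) := by fun_prop
      exact (hc.continuousAt (x := a)).mono_left nhdsWithin_le_nhds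
    · refine eventually_nhdsWithin_of_forall fun τ hτ ↦ ?_
      intro h
      have h' : τ • w = a • w := add_left_cancel (mem_singleton_iff.1 h)
      have h'' : (τ - a) • w = 0 := by rw [sub_smul, h', sub_self]
      exact (smul_eq_zero.1 h'').elim (fun h₃ ↦ hτ (sub_eq_zero.1 h₃)) hw0
  have h1 := htend.eventually hC
  rw [eventually_nhdsWithin_iff, Metric.eventually_nhds_iff_ball] at h1
  obtain ⟨ε, hε, hball⟩ := h1
  refine ⟨C + γ * Real.log ‖w‖, ε, hε, fun τ hτ hτε ↦ ?_⟩
  have key := hball τ (mem_ball_iff_norm.2 hτε) hτ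
  have hdiff : v + τ • w - (v + a • w) = (τ - a) • w := by rw [sub_smul]; abel
  rw [hdiff, norm_smul,
    Real.log_mul (norm_ne_zero_iff.2 (sub_ne_zero.2 hτ)) (norm_ne_zero_iff.2 hw0)] at key
  calc T.pot (v + τ • w) ≤ ((γ * (Real.log ‖τ - a‖ + Real.log ‖w‖) + C : ℝ) : EReal) := key
    _ = ((γ * Real.log ‖τ - a‖ + (C + γ * Real.log ‖w‖) : ℝ) : EReal) := by congr 1; ring

/-- **Slices with too large a slope are polar.** Let `v ≠ 0`, let `w` lie off the line `ℂ v`, and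
suppose the cone potential `V` of `T` admits the Lelong slope `γ > deg T` at `v`. Then
`V(v + τ w) = -∞` for every `τ ≠ 0`: the slice `f(τ) = V(v + τ w)` is subharmonic on `ℂ`,
`≤ γ log |τ| + C` near `0`, and `≤ deg T · log |τ| + A` near `∞` by log-homogeneity
(`v + τ w = τ (w + τ⁻¹ v)` with `V` bounded above near `w`), so the Liouville-type lemma
`IsSubharmonicOn.eq_bot_of_growth` applies. [folklore] -/
theorem pot_add_smul_eq_bot_of_degree_lt {v w : Fin (N + 1) → ℂ} (hv : v ≠ 0)
    (hw : ∀ a : ℂ, w ≠ a • v) {γ : ℝ} (hγ : γ ∈ lelongSlopes T.pot v) (hγc : T.degree < γ) :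
    ∀ τ : ℂ, τ ≠ 0 → T.pot (v + τ • w) = ⊥ := by
  -- the slice never meets the vertex, and `w ≠ 0`
  have hw0 : w ≠ 0 := fun h ↦ hw 0 (by rw [h, zero_smul])
  have hvw : ∀ τ : ℂ, v + τ • w ≠ 0 := by
    intro τ h
    rcases eq_or_ne τ 0 with rfl | hτ
    · rw [zero_smul, add_zero] at h; exact hv h
    · have h1 : τ • w = -v := eq_neg_of_add_eq_zero_right h
      apply hw (-τ⁻¹)
      calc w = τ⁻¹ • (τ • w) := by rw [inv_smul_smul₀ hτ]
        _ = -τ⁻¹ • v := by rw [h1, smul_neg, neg_smul]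
  have hf_sub : IsSubharmonicOn (fun τ : ℂ ↦ T.pot (v + τ • w)) {0}ᶜ :=
    (T.isPlurisubharmonicOn_pot.isSubharmonicOn_line v w).mono fun τ _ ↦ hvw τ
  obtain ⟨A, R₀, hinf⟩ := T.exists_pot_add_smul_le hw0 hvw
  have hγ' : γ ∈ lelongSlopes T.pot (v + (0 : ℂ) • w) := by rwa [zero_smul, add_zero]
  obtain ⟨C₁, ε, hε, h0⟩ := T.exists_pot_add_smul_le_of_mem_lelongSlopes hw0 hγ'
  refine hf_sub.eq_bot_of_growth (C₁ := C₁) hγc hε (fun τ hτ hτε ↦ ?_) hinf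
  have := h0 τ hτ (by rwa [sub_zero])
  rwa [sub_zero] at this

/-- In `ℂ^{N+1}` with `N ≥ 1`, through every `v ≠ 0` there is a coordinate vector `e_j` off the
line `ℂ v`. [folklore] -/
theorem exists_single_notMem_line {v : Fin (N + 1) → ℂ} (hv : v ≠ 0) (hN : 1 ≤ N) :
    ∃ j : Fin (N + 1), ∀ a : ℂ, (Pi.single j (1 : ℂ) : Fin (N + 1) → ℂ) ≠ a • v := by
  obtain ⟨i, hi⟩ : ∃ i, v i ≠ 0 := by
    by_contra h
    push Not at h
    exact hv (funext h)
  obtain ⟨j, hj⟩ : ∃ j : Fin (N + 1), j ≠ i := by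
    by_cases h0 : i = 0
    · exact ⟨⟨1, by omega⟩, fun h ↦ by rw [h0] at h; exact absurd (congrArg Fin.val h) (by simp)⟩
    · exact ⟨0, fun h ↦ h0 h.symm⟩
  refine ⟨j, fun a h ↦ ?_⟩
  have hi' : (Pi.single j (1 : ℂ) : Fin (N + 1) → ℂ) i = a * v i := by
    rw [h]; rfl
  rw [Pi.single_eq_of_ne hj.symm] at hi'
  have ha : a = 0 := by
    rcases mul_eq_zero.1 hi'.symm with ha | hvi
    · exact ha
    · exact absurd hvi hi
  have hj' : (Pi.single j (1 : ℂ) : Fin (N + 1) → ℂ) j = a * v j := by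
    rw [h]; rfl
  rw [Pi.single_eq_same, ha, zero_mul] at hj'
  exact one_ne_zero hj'

/-- **Lelong numbers are bounded by the degree**: `ν(V, v) ≤ deg T` at every `v ≠ 0`, for the cone
potential `V` of a closed positive `(1,1)`-current `T` on `ℙᴺ` (classically: `ν(T, x)` is at most
the mass `∫ T ∧ ω^{N-1} = deg T`). Proof: an admissible slope `γ > deg T` at `v` would make `V ≡ -∞`
on every slice `v + ℂ w`, `w ∉ ℂ v` (`pot_add_smul_eq_bot_of_degree_lt`), i.e. off the line `ℂ v`,
contradicting `V ≢ -∞` near the points off that line; for `N = 0` the potential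
`V(a) = V(1) + c log |a|` is continuous and `ν = 0`. [folklore] -/
theorem lelongNumber_pot_le_degree {v : Fin (N + 1) → ℂ} (hv : v ≠ 0) :
    Pluripotential.lelongNumber T.pot v ≤ T.degree := by
  rcases Nat.eq_zero_or_pos N with hN | hN
  · -- `N = 0`: the potential is continuous and finite near `v`
    subst hN
    have hv0 : v 0 ≠ 0 := fun h ↦ hv (funext fun i ↦ by fin_cases i; exact h)
    have hrep : ∀ y : Fin 1 → ℂ, y = (y 0 / v 0) • v := fun y ↦ by
      funext i; fin_cases i; simp [div_mul_cancel₀ _ hv0]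
    -- `pot v` is a real number
    have hvbot : T.pot v ≠ ⊥ := by
      obtain ⟨y, hy, hyv⟩ : ∃ y : Fin 1 → ℂ, T.pot y ≠ ⊥ ∧ y 0 ≠ 0 := by
        have h1 : ∀ᶠ y in 𝓝 v, y 0 ≠ (0 : ℂ) :=
          (isOpen_ne.preimage (continuous_apply 0)).eventually_mem hv0
        exact ((T.frequently_ne_bot v hv).and_eventually h1).exists
      have hy0 : y 0 / v 0 ≠ 0 := div_ne_zero hyv hv0
      rw [hrep y, T.pot_smul hy0 hv] at hy
      exact fun h ↦ hy (by rw [h, EReal.bot_add])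
    have hvtop : T.pot v ≠ ⊤ := (T.pot_lt_top hv).ne
    set p : ℝ := (T.pot v).toReal with hp
    have hp' : T.pot v = (p : EReal) := (EReal.coe_toReal hvtop hvbot).symm
    refine le_of_eq_of_le ?_ T.degree_nonneg
    refine lelongNumber_eq_zero_of_continuousAt
      (f := fun y ↦ p + T.degree * Real.log ‖y 0 / v 0‖) ?_ ?_
    · refine continuousAt_const.add (continuousAt_const.mul ?_)
      have hc0 : Continuous fun y : Fin (0 + 1) → ℂ ↦ y 0 := continuous_apply 0
      refine ((hc0.div_const (v 0)).norm).continuousAt.log ?_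
      rw [div_self hv0, norm_one]; exact one_ne_zero
    · have h1 : ∀ᶠ y in 𝓝 v, y 0 ≠ (0 : ℂ) :=
        (isOpen_ne.preimage (continuous_apply 0)).eventually_mem hv0
      filter_upwards [nhdsWithin_le_nhds h1] with y hy
      have hy0 : y 0 / v 0 ≠ 0 := div_ne_zero hy hv0
      conv_lhs => rw [hrep y]
      rw [T.pot_smul hy0 hv, hp', ← EReal.coe_add]
  · -- `N ≥ 1`: every admissible slope is `≤ deg T`
    have h0S : (0 : ℝ) ∈ lelongSlopes T.pot v := by
      obtain ⟨C, hvC, -⟩ := EReal.lt_iff_exists_real_btwn.1 (T.pot_lt_top hv)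
      have h1 : ∀ᶠ y in 𝓝[({0}ᶜ : Set (Fin (N + 1) → ℂ))] v, T.pot y < (C : EReal) :=
        T.isPlurisubharmonicOn_pot.upperSemicontinuousOn v hv _ hvC
      have h2 : ({0}ᶜ : Set (Fin (N + 1) → ℂ)) ∈ 𝓝 v := isOpen_compl_singleton.mem_nhds hv
      rw [nhdsWithin_eq_nhds.2 h2] at h1
      exact zero_mem_lelongSlopes (C := C) ((h1.mono fun y hy ↦ hy.le).filter_mono nhdsWithin_le_nhds)
    rw [lelongNumber_eq_sSup]
    refine csSup_le ⟨0, h0S⟩ fun γ hγ ↦ ?_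
    by_contra hlt
    push Not at hlt
    -- `V = -∞` off the line `ℂ v`
    have hoff : ∀ z : Fin (N + 1) → ℂ, (∀ a : ℂ, z ≠ a • v) → T.pot z = ⊥ := by
      intro z hz
      have hw : ∀ a : ℂ, z - v ≠ a • v := fun a h ↦ hz (a + 1) (by rw [add_smul, one_smul, ← h, sub_add_cancel])
      have := T.pot_add_smul_eq_bot_of_degree_lt hv hw hγ hlt 1 one_ne_zero
      rwa [one_smul, add_sub_cancel] at this
    -- a point off the line, with a neighbourhood off the line
    obtain ⟨j, hj⟩ := exists_single_notMem_line hv hN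
    set w₀ : Fin (N + 1) → ℂ := Pi.single j 1 with hw₀
    have hw₀0 : w₀ ≠ 0 := fun h ↦ hj 0 (by rw [h, zero_smul])
    have hL : IsClosed (↑(Submodule.span ℂ ({v} : Set (Fin (N + 1) → ℂ))) : Set (Fin (N + 1) → ℂ)) :=
      (Submodule.span ℂ {v}).closed_of_finiteDimensional
    have hw₀L : w₀ ∉ (↑(Submodule.span ℂ ({v} : Set (Fin (N + 1) → ℂ))) : Set (Fin (N + 1) → ℂ)) := by
      intro h
      obtain ⟨a, ha⟩ := Submodule.mem_span_singleton.1 h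
      exact hj a ha.symm
    have hev : ∀ᶠ y in 𝓝 w₀, T.pot y = ⊥ := by
      filter_upwards [hL.isOpen_compl.mem_nhds hw₀L] with y hy
      refine hoff y fun a h ↦ hy ?_
      exact Submodule.mem_span_singleton.2 ⟨a, h.symm⟩
    exact (T.frequently_ne_bot w₀ hw₀0) (hev.mono fun y hy ↦ not_ne_iff.2 hy)

/-- **`ν(T, x) ≤ deg T`** for every point `x ∈ ℙᴺ(ℂ)`. [folklore] -/
theorem lelongNumber_le_degree (x : ℙ ℂ (Fin (N + 1) → ℂ)) : T.lelongNumber x ≤ T.degree :=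
  T.lelongNumber_pot_le_degree x.rep_nonzero

/-- The Lelong upper level sets above the degree are empty: `E_c(T) = ∅` for `c > deg T`.
[folklore] -/
theorem lelongUpperLevelSet_eq_empty {c : ℝ} (hc : T.degree < c) : T.lelongUpperLevelSet c = ∅ :=
  eq_empty_of_forall_notMem fun x hx ↦ (not_le.2 hc) (hx.trans (T.lelongNumber_le_degree x))

end ClosedPositiveOneOneCurrent

/-! ### Siu's theorem in the range `c > deg T` -/

section SiuLargeLevel

/-- **Siu's theorem above the degree** (trivial range): for `c > deg T` the level set
`E_c(T)` is empty, hence an analytic subset of `ℙᴺ(ℂ)`. In particular the conclusion of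
`Siu1974_isAnalyticSet_lelongUpperLevelSet` holds for all currents of degree `0` and, for a
current of degree `d`, for every level `c > d`. [cite: Siu1974, Main Theorem (special case)] -/
theorem isAnalyticSet_lelongUpperLevelSet_of_degree_lt {N : ℕ} (T : ClosedPositiveOneOneCurrent N)
    {c : ℝ} (hc : T.degree < c) :
    Literature.Geometry.Kaehler.IsAnalyticSet 𝓘(ℂ, Fin N → ℂ) (T.lelongUpperLevelSet c) := by
  rw [T.lelongUpperLevelSet_eq_empty hc]
  exact Literature.Geometry.Kaehler.isAnalyticSet_empty

end SiuLargeLevel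

/-! ### Suprema over closed balls and the three-balls inequality (Hadamard) for psh functions -/

section ThreeBalls

variable {E : Type*} [NormedAddCommGroup E]

/-- The supremum of an u.s.c. function `< +∞` over a compact ball inside its domain is `< +∞`.
[folklore] -/
theorem sSup_image_closedBall_lt_top [ProperSpace E] {V : E → EReal} {Ω : Set E}
    (hV : UpperSemicontinuousOn V Ω) (hlt : ∀ z ∈ Ω, V z < ⊤) {a : E} {r : ℝ}
    (hsub : closedBall a r ⊆ Ω) : sSup (V '' closedBall a r) < ⊤ := by
  rcases lt_or_ge r 0 with hr | hr
  · rw [closedBall_eq_empty.2 hr, image_empty, sSup_empty]; exact bot_lt_top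
  · obtain ⟨z₀, hz₀, hmax⟩ := UpperSemicontinuousOn.exists_isMaxOn (nonempty_closedBall.2 hr)
      (isCompact_closedBall a r) (hV.mono hsub)
    refine lt_of_le_of_lt (sSup_le ?_) (hlt z₀ (hsub hz₀))
    rintro _ ⟨z, hz, rfl⟩
    exact hmax hz

/-- A supremum over a ball containing a point where `V > -∞` is `> -∞`. [folklore] -/
theorem sSup_image_closedBall_ne_bot {V : E → EReal} {a : E} {r : ℝ}
    (h : ∃ z ∈ closedBall a r, V z ≠ ⊥) : sSup (V '' closedBall a r) ≠ ⊥ := by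
  obtain ⟨z, hz, hne⟩ := h
  exact fun hbot ↦ hne (eq_bot_iff.2 (hbot ▸ le_sSup ⟨z, hz, rfl⟩))

variable [NormedSpace ℂ E]

/-- **Three-balls inequality (Hadamard) for plurisubharmonic functions.** Let `V` be psh on
`Ω ⊇ B̄(a, r₂)`, `0 < r₁ < r₂`, with `V ≤ M₁` on `B̄(a, r₁)` and `V ≤ M₂` on `B̄(a, r₂)`. Then on the
shell `r₁ ≤ ‖z - a‖ ≤ r₂`,
`V(z) ≤ M₁ + (M₂ - M₁) (log ‖z - a‖ - log r₁) / (log r₂ - log r₁)`: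
restrict `V` to the complex line through `a` and `z`, subtract the harmonic function
`α log |τ| + β` matching `M₁, M₂` on the two circles, and apply the boundary maximum principle on
the annulus. (Hence `log r ↦ sup_{B̄(a,r)} V` is convex.)
[cite: HormanderSCV1973, Thm. 1.6.3 and Cor. 1.6.6 (Hadamard's three-circles theorem)] -/
theorem IsPlurisubharmonicOn.le_three_balls {V : E → EReal} {Ω : Set E}
    (hV : IsPlurisubharmonicOn V Ω) {a : E} {r₁ r₂ M₁ M₂ : ℝ} (hr₁ : 0 < r₁) (hr₁₂ : r₁ < r₂)
    (hΩ : closedBall a r₂ ⊆ Ω) (h₁ : ∀ z ∈ closedBall a r₁, V z ≤ M₁)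
    (h₂ : ∀ z ∈ closedBall a r₂, V z ≤ M₂) {z : E} (hz : z ∈ closedBall a r₂)
    (hz₁ : r₁ ≤ ‖z - a‖) :
    V z ≤ ((M₁ + (M₂ - M₁) * (Real.log ‖z - a‖ - Real.log r₁) / (Real.log r₂ - Real.log r₁) :
      ℝ) : EReal) := by
  have hlog : Real.log r₁ < Real.log r₂ := Real.log_lt_log hr₁ hr₁₂
  set d : ℝ := ‖z - a‖ with hd
  have hd0 : 0 < d := hr₁.trans_le hz₁
  have hdr₂ : d ≤ r₂ := mem_closedBall_iff_norm.1 hz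
  -- unit direction `w` with `z = a + d • w`
  set w : E := ((d⁻¹ : ℝ) : ℂ) • (z - a) with hw
  have hw1 : ‖w‖ = 1 := by
    rw [hw, norm_smul, Complex.norm_real, Real.norm_eq_abs, abs_of_pos (inv_pos.2 hd0), ← hd,
      inv_mul_cancel₀ hd0.ne']
  have hzw : z = a + ((d : ℝ) : ℂ) • w := by
    rw [hw, smul_smul, ← Complex.ofReal_mul, mul_inv_cancel₀ hd0.ne', Complex.ofReal_one,
      one_smul, add_sub_cancel]
  have hnorm : ∀ τ : ℂ, ‖a + τ • w - a‖ = ‖τ‖ := fun τ ↦ by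
    rw [add_sub_cancel_left, norm_smul, hw1, mul_one]
  -- the slice and its domain off the origin
  set U' : Set ℂ := {τ | τ ≠ 0 ∧ a + τ • w ∈ Ω} with hU'
  set u : ℂ → EReal := fun τ ↦ V (a + τ • w) with hu
  have hu_sub : IsSubharmonicOn u U' := (hV.isSubharmonicOn_line a w).mono fun τ hτ ↦ hτ.2
  set α : ℝ := (M₂ - M₁) / (Real.log r₂ - Real.log r₁) with hα
  set β : ℝ := M₁ - α * Real.log r₁ with hβ
  set g : ℂ → EReal := fun τ ↦ u τ + ((-α * Real.log ‖τ‖ : ℝ) : EReal) + ((-β : ℝ) : EReal)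
    with hg
  have hg_sub : IsSubharmonicOn g U' :=
    (hu_sub.add_mul_log_norm (fun τ hτ ↦ hτ.1) (-α)).add_const (-β)
  -- the annulus `r₁ ≤ |τ| ≤ r₂`
  set K : Set ℂ := (fun τ : ℂ ↦ ‖τ‖) ⁻¹' Icc r₁ r₂ with hK
  have hKc : IsCompact K :=
    Metric.isCompact_of_isClosed_isBounded (isClosed_Icc.preimage continuous_norm)
      (isBounded_closedBall.subset fun τ hτ ↦ mem_closedBall_zero_iff.2 hτ.2)
  have hKU : K ⊆ U' := by
    intro τ hτ
    refine ⟨fun h0 ↦ ?_, hΩ (mem_closedBall_iff_norm.2 (by rw [hnorm]; exact hτ.2))⟩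
    have : r₁ ≤ ‖τ‖ := hτ.1
    rw [h0, norm_zero] at this
    exact (not_le.2 hr₁) this
  have hdnorm : ‖((d : ℝ) : ℂ)‖ = d := by
    rw [Complex.norm_real, Real.norm_eq_abs, abs_of_pos hd0]
  have hτ₀K : ((d : ℝ) : ℂ) ∈ K := by
    show ‖((d : ℝ) : ℂ)‖ ∈ Icc r₁ r₂
    rw [hdnorm]
    exact ⟨hz₁, hdr₂⟩
  obtain ⟨y, hyfr, hy⟩ := hg_sub.exists_mem_frontier_le hKc hKU hτ₀K
  have hyn : ‖y‖ = r₁ ∨ ‖y‖ = r₂ := by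
    have := continuous_norm.frontier_preimage_subset (Icc r₁ r₂) hyfr
    rw [frontier_Icc hr₁₂.le] at this
    simpa using this
  -- `g ≤ 0` on both circles
  have hval : ∀ {ρ M : ℝ}, ‖y‖ = ρ → (∀ z ∈ closedBall a ρ, V z ≤ M) →
      α * Real.log ρ + β = M → g y ≤ 0 := by
    intro ρ M hyρ hVM hhM
    have h1 : u y ≤ (M : EReal) := hVM _ (mem_closedBall_iff_norm.2 (by rw [hnorm, hyρ]))
    have h2 : M + (-α * Real.log ρ + -β) = 0 := by rw [← hhM]; ring
    calc g y = u y + ((-α * Real.log ‖y‖ + -β : ℝ) : EReal) := by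
          simp only [hg, add_assoc, ← EReal.coe_add]
      _ ≤ (M : EReal) + ((-α * Real.log ‖y‖ + -β : ℝ) : EReal) := add_le_add h1 le_rfl
      _ = 0 := by rw [← EReal.coe_add, hyρ, h2, EReal.coe_zero]
  have hg_le : g y ≤ 0 := by
    rcases hyn with h | h
    · exact hval h h₁ (by rw [hβ]; ring)
    · refine hval h h₂ ?_
      have hne : Real.log r₂ - Real.log r₁ ≠ 0 := (sub_pos.2 hlog).ne'
      rw [hβ, hα]
      field_simp
      ring
  -- conclude at `τ₀ = d`
  have hgd : g ((d : ℝ) : ℂ) ≤ 0 := hy.trans hg_le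
  have hud : u ((d : ℝ) : ℂ) ≤ ((α * Real.log d + β : ℝ) : EReal) := by
    have h1 := add_le_add hgd (le_refl (((α * Real.log d + β : ℝ)) : EReal))
    rw [zero_add] at h1
    refine le_trans (le_of_eq ?_) h1
    simp only [hg, add_assoc, ← EReal.coe_add, hdnorm]
    rw [show (-α * Real.log d + (-β + (α * Real.log d + β))) = (0 : ℝ) by ring, EReal.coe_zero,
      add_zero]
  have huz : u ((d : ℝ) : ℂ) = V z := by
    simp only [hu]; rw [← hzw]
  rw [← huz]
  refine hud.trans_eq ?_
  congr 1
  rw [hβ, hα]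
  ring

/-- An admissible Lelong slope `γ ≥ 0` at `b` (`V ≤ γ log ‖z - b‖ + C` on a punctured ball of
radius `ε`) bounds the suprema over small closed balls: `sup_{B̄(b,s)} V ≤ γ log s + C` for
`0 < s < ε` — at the centre itself by the sub-mean-value inequality along any complex line.
[folklore] -/
theorem IsPlurisubharmonicOn.sSup_image_closedBall_le_of_slope [Nontrivial E] {V : E → EReal}
    {Ω : Set E} (hV : IsPlurisubharmonicOn V Ω) {b : E} {γ C ε : ℝ} (hγ : 0 ≤ γ)
    (hΩ : closedBall b ε ⊆ Ω)
    (hC : ∀ z : E, z ≠ b → ‖z - b‖ < ε → V z ≤ ((γ * Real.log ‖z - b‖ + C : ℝ) : EReal))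
    {s : ℝ} (hs : 0 < s) (hsε : s < ε) :
    sSup (V '' closedBall b s) ≤ ((γ * Real.log s + C : ℝ) : EReal) := by
  -- a unit vector
  obtain ⟨w₀, hw₀⟩ := exists_ne (0 : E)
  set w : E := ((‖w₀‖⁻¹ : ℝ) : ℂ) • w₀ with hw
  have hw1 : ‖w‖ = 1 := by
    rw [hw, norm_smul, Complex.norm_real, Real.norm_eq_abs, abs_of_pos (inv_pos.2 (norm_pos_iff.2 hw₀)),
      inv_mul_cancel₀ (norm_ne_zero_iff.2 hw₀)]
  have hw0 : w ≠ 0 := fun h ↦ by rw [h, norm_zero] at hw1; exact zero_ne_one hw1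
  -- points at distance in `(0, s]` obey the bound
  have hpt : ∀ z : E, z ≠ b → ‖z - b‖ ≤ s → V z ≤ ((γ * Real.log s + C : ℝ) : EReal) := by
    intro z hzb hzs
    refine (hC z hzb (hzs.trans_lt hsε)).trans ?_
    have hpos : 0 < ‖z - b‖ := norm_pos_iff.2 (sub_ne_zero.2 hzb)
    exact_mod_cast add_le_add (mul_le_mul_of_nonneg_left (Real.log_le_log hpos hzs) hγ) (le_refl C)
  refine sSup_le ?_
  rintro _ ⟨z, hz, rfl⟩
  rcases eq_or_ne z b with rfl | hzb
  · -- the centre: sub-mean value over the circle of radius `s` in the line `z + ℂ w`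
    have hΩ' : ∀ τ : ℂ, ‖τ‖ ≤ s → z + τ • w ∈ Ω := fun τ hτ ↦
      hΩ (mem_closedBall_iff_norm.2 (by
        rw [add_sub_cancel_left, norm_smul, hw1, mul_one]; exact hτ.trans hsε.le))
    refine (hV.le_circleMean z w hs hΩ').trans ?_
    refine (circleMean_mono (v := fun _ ↦ ((γ * Real.log s + C : ℝ) : EReal)) fun θ _ ↦ ?_).trans
      (le_of_eq (circleMean_const _ 0 s))
    have hτ : ‖circleMap 0 s θ‖ = s := by
      have := circleMap_mem_sphere' 0 s θ
      rwa [mem_sphere, dist_zero_right, abs_of_pos hs] at this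
    refine hpt _ ?_ ?_
    · intro h
      have : circleMap 0 s θ • w = 0 := by
        have h' := congrArg (· - z) h
        simpa using h'
      rcases smul_eq_zero.1 this with h0 | h0
      · rw [h0, norm_zero] at hτ; exact hs.ne' hτ.symm
      · exact hw0 h0
    · rw [add_sub_cancel_left, norm_smul, hw1, mul_one, hτ]
  · exact hpt z hzb (mem_closedBall_iff_norm.1 hz)

/-- **Slopes versus difference quotients.** For `V` psh on `Ω ⊇ B̄(b, r)` and `0 < ρ < r`, every
admissible Lelong slope `γ` at `b` satisfies `γ (log r - log ρ) ≤ m_r - m_ρ` whenever `m_ρ` is a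
real lower bound for `sup_{B̄(b,ρ)} V` and `m_r` a real upper bound for `V` on `B̄(b, r)` (the
difference quotients of the convex function `log s ↦ sup_{B̄(b,s)} V` decrease to `ν(V, b)` as the
interval shrinks to `-∞`). [cite: HormanderSCV1973, Thm. 1.6.3 and Cor. 1.6.6] -/
theorem IsPlurisubharmonicOn.slope_mul_log_le [Nontrivial E] {V : E → EReal} {Ω : Set E}
    (hV : IsPlurisubharmonicOn V Ω) {b : E} {γ : ℝ} (hγ : γ ∈ lelongSlopes V b) {ρ r : ℝ}
    (hρ : 0 < ρ) (hρr : ρ < r) (hΩ : closedBall b r ⊆ Ω) {mρ mr : ℝ}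
    (hmρ : (mρ : EReal) ≤ sSup (V '' closedBall b ρ)) (hmr : ∀ z ∈ closedBall b r, V z ≤ mr) :
    γ * (Real.log r - Real.log ρ) ≤ mr - mρ := by
  obtain ⟨hγ0, C, hC⟩ := hγ
  have hL : 0 < Real.log r - Real.log ρ := sub_pos.2 (Real.log_lt_log hρ hρr)
  -- `mρ ≤ mr`
  have hρr' : mρ ≤ mr := by
    have : sSup (V '' closedBall b ρ) ≤ (mr : EReal) := by
      refine sSup_le ?_
      rintro _ ⟨z, hz, rfl⟩
      exact hmr z (closedBall_subset_closedBall hρr.le hz)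
    exact_mod_cast hmρ.trans this
  rcases hγ0.eq_or_lt with rfl | hγpos
  · rw [zero_mul]; linarith
  -- the punctured-ball estimate, with a radius `ε ≤ r`
  obtain ⟨ε, hε, hεr, hball⟩ : ∃ ε > 0, ε ≤ r ∧ ∀ z : E, z ≠ b → ‖z - b‖ < ε →
      V z ≤ ((γ * Real.log ‖z - b‖ + C : ℝ) : EReal) := by
    rw [eventually_nhdsWithin_iff, Metric.eventually_nhds_iff_ball] at hC
    obtain ⟨ε, hε, h⟩ := hC
    exact ⟨min ε r, lt_min hε (hρ.trans hρr), min_le_right _ _, fun z hzb hz ↦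
      h z (mem_ball_iff_norm.2 (hz.trans_le (min_le_left _ _))) hzb⟩
  have hΩε : closedBall b ε ⊆ Ω := (closedBall_subset_closedBall hεr).trans hΩ
  by_contra hcon
  push Not at hcon
  set L : ℝ := Real.log r - Real.log ρ with hLdef
  set p : ℝ := mr - γ * L with hp
  have hpm : p < mρ := by rw [hp]; linarith
  set q : ℝ := L * C + mr * Real.log ρ with hq
  -- `y = log s`, very negative
  set y : ℝ := min (min (Real.log (min ε ρ / 2)) ((q - mρ * Real.log r) / (p - mρ)))
    ((mr - C) / γ) - 1 with hy
  have hyA : y < Real.log (min ε ρ / 2) := by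
    have h1 := min_le_left (min (Real.log (min ε ρ / 2)) ((q - mρ * Real.log r) / (p - mρ)))
      ((mr - C) / γ)
    have h2 := min_le_left (Real.log (min ε ρ / 2)) ((q - mρ * Real.log r) / (p - mρ))
    rw [hy]; linarith
  have hyB : y < (q - mρ * Real.log r) / (p - mρ) := by
    have h1 := min_le_left (min (Real.log (min ε ρ / 2)) ((q - mρ * Real.log r) / (p - mρ)))
      ((mr - C) / γ)
    have h2 := min_le_right (Real.log (min ε ρ / 2)) ((q - mρ * Real.log r) / (p - mρ))
    rw [hy]; linarith
  have hyC : y < (mr - C) / γ := by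
    have h1 := min_le_right (min (Real.log (min ε ρ / 2)) ((q - mρ * Real.log r) / (p - mρ)))
      ((mr - C) / γ)
    rw [hy]; linarith
  set s : ℝ := Real.exp y with hsdef
  have hs0 : 0 < s := Real.exp_pos y
  have hlogs : Real.log s = y := Real.log_exp y
  have hmin0 : 0 < min ε ρ := lt_min hε hρ
  have hmin : 0 < min ε ρ / 2 := half_pos hmin0
  have hs_lt : s < min ε ρ / 2 := by
    rw [hsdef, ← Real.exp_log hmin]
    exact Real.exp_lt_exp.2 hyA
  have hsε : s < ε := hs_lt.trans_le ((half_le_self hmin0.le).trans (min_le_left _ _))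
  have hsρ : s < ρ := hs_lt.trans_le ((half_le_self hmin0.le).trans (min_le_right _ _))
  have hlog_sr : Real.log s < Real.log r := Real.log_lt_log hs0 (hsρ.trans hρr)
  have hlog_sρ : Real.log s < Real.log ρ := Real.log_lt_log hs0 hsρ
  -- the two bounds for the three-balls inequality with radii `s < r`
  set M₁ : ℝ := γ * Real.log s + C with hM₁
  have hM₁₂ : M₁ ≤ mr := by
    rw [hM₁, hlogs]
    have := (lt_div_iff₀ hγpos).1 hyC
    linarith
  have h₁ : ∀ z ∈ closedBall b s, V z ≤ M₁ := fun z hz ↦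
    (le_sSup (mem_image_of_mem V hz)).trans
      (hV.sSup_image_closedBall_le_of_slope hγ0 hΩε hball hs0 hsε)
  -- the supremum over `B̄(b, ρ)` is at most the interpolated value `combo`
  set combo : ℝ := M₁ + (mr - M₁) * (Real.log ρ - Real.log s) / (Real.log r - Real.log s)
    with hcombo
  have hcoef : 0 ≤ (mr - M₁) / (Real.log r - Real.log s) :=
    div_nonneg (sub_nonneg.2 hM₁₂) (sub_nonneg.2 hlog_sr.le)
  have hcomboM₁ : M₁ ≤ combo := by
    have : 0 ≤ (mr - M₁) / (Real.log r - Real.log s) * (Real.log ρ - Real.log s) :=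
      mul_nonneg hcoef (sub_nonneg.2 hlog_sρ.le)
    calc M₁ ≤ M₁ + (mr - M₁) / (Real.log r - Real.log s) * (Real.log ρ - Real.log s) := by linarith
      _ = combo := by rw [hcombo]; ring
  have hsup : sSup (V '' closedBall b ρ) ≤ (combo : EReal) := by
    refine sSup_le ?_
    rintro _ ⟨z, hz, rfl⟩
    rcases lt_or_ge ‖z - b‖ s with hzs | hzs
    · exact (h₁ z (mem_closedBall_iff_norm.2 hzs.le)).trans (by exact_mod_cast hcomboM₁)
    · have hzr : z ∈ closedBall b r := closedBall_subset_closedBall hρr.le hz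
      refine (hV.le_three_balls hs0 (hsρ.trans hρr) hΩ h₁ hmr hzr hzs).trans ?_
      have hzρ : Real.log ‖z - b‖ ≤ Real.log ρ :=
        Real.log_le_log (hs0.trans_le hzs) (mem_closedBall_iff_norm.1 hz)
      rw [EReal.coe_le_coe_iff]
      have := mul_le_mul_of_nonneg_left (sub_le_sub_right hzρ (Real.log s)) hcoef
      calc M₁ + (mr - M₁) * (Real.log ‖z - b‖ - Real.log s) / (Real.log r - Real.log s)
          = M₁ + (mr - M₁) / (Real.log r - Real.log s) * (Real.log ‖z - b‖ - Real.log s) := by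
            ring
        _ ≤ M₁ + (mr - M₁) / (Real.log r - Real.log s) * (Real.log ρ - Real.log s) := by
            linarith
        _ = combo := by rw [hcombo]; ring
  -- but `combo < mρ` by the choice of `y`
  have hcombo_lt : combo < mρ := by
    have hden : 0 < Real.log r - y := by rw [← hlogs]; exact sub_pos.2 hlog_sr
    have hpm' : p - mρ < 0 := sub_neg.2 hpm
    have h1 : q - mρ * Real.log r < y * (p - mρ) := (lt_div_iff_of_neg hpm').1 hyB
    have hcombo_eq : combo * (Real.log r - y) = q - p * y := by
      rw [hcombo, hM₁, hlogs, hq, hp, hLdef]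
      field_simp
      ring
    by_contra hge
    push Not at hge
    have key : mρ * (Real.log r - y) ≤ combo * (Real.log r - y) :=
      mul_le_mul_of_nonneg_right hge hden.le
    rw [hcombo_eq] at key
    have e1 : mρ * Real.log r - mρ * y ≤ q - p * y := by linarith [key, mul_sub mρ (Real.log r) y]
    have e2 : q - mρ * Real.log r < y * p - y * mρ := by linarith [h1, mul_sub y p mρ]
    have e3 : y * p = p * y := mul_comm _ _
    have e4 : y * mρ = mρ * y := mul_comm _ _
    linarith
  exact absurd (hmρ.trans hsup) (not_le.2 (by exact_mod_cast hcombo_lt))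

/-- The admissible Lelong slopes of a psh function at a point are bounded above (by any
difference quotient of `log s ↦ sup_{B̄(b,s)} V` with finite endpoints). [folklore] -/
theorem IsPlurisubharmonicOn.bddAbove_lelongSlopes [Nontrivial E] {V : E → EReal} {Ω : Set E}
    (hV : IsPlurisubharmonicOn V Ω) {b : E} {ρ r : ℝ} (hρ : 0 < ρ) (hρr : ρ < r)
    (hΩ : closedBall b r ⊆ Ω) {mρ mr : ℝ} (hmρ : (mρ : EReal) ≤ sSup (V '' closedBall b ρ))
    (hmr : ∀ z ∈ closedBall b r, V z ≤ mr) : BddAbove (lelongSlopes V b) := by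
  refine ⟨(mr - mρ) / (Real.log r - Real.log ρ), fun γ hγ ↦ ?_⟩
  exact (le_div_iff₀ (sub_pos.2 (Real.log_lt_log hρ hρr))).2
    (hV.slope_mul_log_le hγ hρ hρr hΩ hmρ hmr)

/-- **Upper bound for the Lelong number by difference quotients**:
`ν(V, b) ≤ (m_r - m_ρ) / (log r - log ρ)` for `0 < ρ < r`, `B̄(b, r) ⊆ Ω`, `m_ρ ≤ sup_{B̄(b,ρ)} V`
and `V ≤ m_r` on `B̄(b, r)`. [cite: HormanderSCV1973, Thm. 1.6.3 and Cor. 1.6.6] -/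
theorem IsPlurisubharmonicOn.lelongNumber_le_quotient [Nontrivial E] {V : E → EReal} {Ω : Set E}
    (hV : IsPlurisubharmonicOn V Ω) {b : E} {ρ r : ℝ} (hρ : 0 < ρ) (hρr : ρ < r)
    (hΩ : closedBall b r ⊆ Ω) {mρ mr : ℝ} (hmρ : (mρ : EReal) ≤ sSup (V '' closedBall b ρ))
    (hmr : ∀ z ∈ closedBall b r, V z ≤ mr) :
    lelongNumber V b ≤ (mr - mρ) / (Real.log r - Real.log ρ) := by
  have h0 : (0 : ℝ) ∈ lelongSlopes V b := by
    refine zero_mem_lelongSlopes (C := mr) ?_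
    have : ∀ᶠ z in 𝓝 b, z ∈ closedBall b r := closedBall_mem_nhds b (hρ.trans hρr)
    exact (this.mono fun z hz ↦ hmr z hz).filter_mono nhdsWithin_le_nhds
  rw [lelongNumber_eq_sSup]
  exact csSup_le ⟨0, h0⟩ fun γ hγ ↦
    (le_div_iff₀ (sub_pos.2 (Real.log_lt_log hρ hρr))).2 (hV.slope_mul_log_le hγ hρ hρr hΩ hmρ hmr)

omit [NormedSpace ℂ E] in
/-- Conversely, uniform control of the difference quotients at a fixed outer radius gives an
admissible slope: if `sup_{B̄(a,ρ)} V ≤ m_r - c' (log r - log ρ)` for all `0 < ρ < r` then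
`c' ∈ lelongSlopes V a`. [folklore] -/
theorem mem_lelongSlopes_of_forall_sSup_le {V : E → EReal} {a : E} {c' r mr : ℝ} (hc' : 0 ≤ c')
    (hr : 0 < r)
    (hq : ∀ ρ : ℝ, 0 < ρ → ρ < r →
      sSup (V '' closedBall a ρ) ≤ ((mr - c' * (Real.log r - Real.log ρ) : ℝ) : EReal)) :
    c' ∈ lelongSlopes V a := by
  refine ⟨hc', mr - c' * Real.log r, ?_⟩
  have hball : ∀ᶠ z in 𝓝 a, z ∈ ball a r := ball_mem_nhds a hr
  filter_upwards [self_mem_nhdsWithin, mem_nhdsWithin_of_mem_nhds hball] with z hza hzr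
  have hρ : 0 < ‖z - a‖ := norm_pos_iff.2 (sub_ne_zero.2 hza)
  have hρr : ‖z - a‖ < r := mem_ball_iff_norm.1 hzr
  refine (le_sSup (mem_image_of_mem V (mem_closedBall_iff_norm.2 le_rfl))).trans
    ((hq _ hρ hρr).trans_eq ?_)
  congr 1
  ring

/-- **Upper semicontinuity of the Lelong number** (in the point): if `V` is psh on
`Ω ⊇ B̄(a, r₀)`, not identically `-∞` near `a`, and `ν(V, a) < c`, then `ν(V, b) < c` for all `b`
near `a`. Proof: `ν(V, b) ≤ (m_a(r₀) - m_a(ρ)) / (log (r₀ - d) - log (ρ + d))`, `d = ‖b - a‖`,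
by `lelongNumber_le_quotient` at `b` with the radii `ρ + d < r₀ - d` and the comparisons
`B̄(a, ρ) ⊆ B̄(b, ρ + d)`, `B̄(b, r₀ - d) ⊆ B̄(a, r₀)`; at `a` the quotient
`(m_a(r₀) - m_a(ρ)) / (log r₀ - log ρ)` can be made `< c` (`mem_lelongSlopes_of_forall_sSup_le`),
and the denominator depends continuously on `d`.
[cite: HormanderSCV1973, Thm. 1.6.3; classical (Siu 1974, Demailly)] -/
theorem IsPlurisubharmonicOn.eventually_lelongNumber_lt [Nontrivial E] [ProperSpace E]
    {V : E → EReal} {Ω : Set E} (hV : IsPlurisubharmonicOn V Ω) {a : E} {r₀ : ℝ} (hr₀ : 0 < r₀)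
    (hΩ : closedBall a r₀ ⊆ Ω) (hnb : ∀ ρ : ℝ, 0 < ρ → ∃ z ∈ closedBall a ρ, V z ≠ ⊥) {c : ℝ}
    (hc : lelongNumber V a < c) : ∀ᶠ b in 𝓝 a, lelongNumber V b < c := by
  have hfin : ∀ {ρ : ℝ}, 0 < ρ → ρ ≤ r₀ →
      sSup (V '' closedBall a ρ) ≠ ⊥ ∧ sSup (V '' closedBall a ρ) ≠ ⊤ := fun hρ hρr ↦
    ⟨sSup_image_closedBall_ne_bot (hnb _ hρ),
      (sSup_image_closedBall_lt_top hV.upperSemicontinuousOn (fun z hz ↦ hV.lt_top hz)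
        ((closedBall_subset_closedBall hρr).trans hΩ)).ne⟩
  set mr : ℝ := (sSup (V '' closedBall a r₀)).toReal with hmr_def
  have hmr_eq : (mr : EReal) = sSup (V '' closedBall a r₀) :=
    EReal.coe_toReal (hfin hr₀ le_rfl).2 (hfin hr₀ le_rfl).1
  have hmr : ∀ z ∈ closedBall a r₀, V z ≤ mr := fun z hz ↦ by
    rw [hmr_eq]; exact le_sSup ⟨z, hz, rfl⟩
  -- slopes at `a` are bounded above
  have hbdd : BddAbove (lelongSlopes V a) := by
    have h2 := hfin (half_pos hr₀) (half_le_self hr₀.le)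
    exact hV.bddAbove_lelongSlopes (half_pos hr₀) (half_lt_self hr₀) hΩ
      (EReal.coe_toReal h2.2 h2.1).le hmr
  -- an intermediate level `c'`
  have hν0 := lelongNumber_nonneg V a
  set c' : ℝ := (lelongNumber V a + c) / 2 with hc'
  have hc'1 : lelongNumber V a < c' := by rw [hc']; linarith
  have hc'2 : c' < c := by rw [hc']; linarith
  have hc'0 : 0 < c' := by rw [hc']; linarith
  have hc0 : 0 < c := hν0.trans_lt hc
  -- `c'` is not admissible at `a`, so some quotient at `a` is below `c'`
  obtain ⟨ρ, hρ, hρr, hlt⟩ : ∃ ρ : ℝ, 0 < ρ ∧ ρ < r₀ ∧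
      ((mr - c' * (Real.log r₀ - Real.log ρ) : ℝ) : EReal) < sSup (V '' closedBall a ρ) := by
    by_contra h
    push Not at h
    have hmem : c' ∈ lelongSlopes V a :=
      mem_lelongSlopes_of_forall_sSup_le hc'0.le hr₀ fun ρ hρ hρr ↦ h ρ hρ hρr
    exact (not_le.2 hc'1) (le_csSup hbdd hmem)
  set mρ : ℝ := mr - c' * (Real.log r₀ - Real.log ρ) with hmρ_def
  have hL₀ : 0 < Real.log r₀ - Real.log ρ := sub_pos.2 (Real.log_lt_log hρ hρr)
  -- continuity of the perturbed denominator in `d = ‖b - a‖`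
  have hcont : ContinuousAt (fun d : ℝ ↦ c * (Real.log (r₀ - d) - Real.log (ρ + d))) 0 := by
    refine continuousAt_const.mul ((ContinuousAt.log ?_ ?_).sub (ContinuousAt.log ?_ ?_))
    · exact continuousAt_const.sub continuousAt_id
    · rw [sub_zero]; exact hr₀.ne'
    · exact continuousAt_const.add continuousAt_id
    · rw [add_zero]; exact hρ.ne'
  have hev : ∀ᶠ d in 𝓝 (0 : ℝ),
      c' * (Real.log r₀ - Real.log ρ) < c * (Real.log (r₀ - d) - Real.log (ρ + d)) := by
    refine hcont.eventually (lt_mem_nhds ?_)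
    simp only [sub_zero, add_zero]
    exact mul_lt_mul_of_pos_right hc'2 hL₀
  obtain ⟨δ, hδ, hδ'⟩ := Metric.eventually_nhds_iff_ball.1 hev
  rw [Metric.eventually_nhds_iff_ball]
  refine ⟨min δ (r₀ / 2), lt_min hδ (half_pos hr₀), fun b hb ↦ ?_⟩
  set d : ℝ := ‖b - a‖ with hd
  have hbd : dist b a = d := dist_eq_norm b a
  have hdδ : d < δ := by rw [← hbd]; exact (mem_ball.1 hb).trans_le (min_le_left _ _)
  have hdr : d < r₀ / 2 := by rw [← hbd]; exact (mem_ball.1 hb).trans_le (min_le_right _ _)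
  have hd0 : 0 ≤ d := norm_nonneg _
  have hkey := hδ' d (by
    rw [mem_ball, dist_zero_right, Real.norm_eq_abs, abs_of_nonneg hd0]; exact hdδ)
  have hLd : 0 < Real.log (r₀ - d) - Real.log (ρ + d) := by
    have : 0 < c * (Real.log (r₀ - d) - Real.log (ρ + d)) := (mul_pos hc'0 hL₀).trans hkey
    exact (mul_pos_iff_of_pos_left hc0).1 this
  have hρd : 0 < ρ + d := by linarith
  have hr₀d : 0 < r₀ - d := by linarith
  have hρr' : ρ + d < r₀ - d := (Real.log_lt_log_iff hρd hr₀d).1 (sub_pos.1 hLd)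
  -- the data at `b`
  have hba : ∀ {ε₁ ε₂ : ℝ}, ε₁ + d ≤ ε₂ → closedBall b ε₁ ⊆ closedBall a ε₂ := fun h ↦
    closedBall_subset_closedBall' (by rw [hbd]; exact h)
  have hab : ∀ {ε₁ ε₂ : ℝ}, ε₁ + d ≤ ε₂ → closedBall a ε₁ ⊆ closedBall b ε₂ := fun h ↦
    closedBall_subset_closedBall' (by rw [dist_comm, hbd]; exact h)
  have hΩb : closedBall b (r₀ - d) ⊆ Ω := (hba (by linarith)).trans hΩ
  have hmr' : ∀ z ∈ closedBall b (r₀ - d), V z ≤ mr := fun z hz ↦ hmr z (hba (by linarith) hz)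
  have hmρ' : (mρ : EReal) ≤ sSup (V '' closedBall b (ρ + d)) :=
    hlt.le.trans (sSup_le_sSup (image_mono (hab le_rfl)))
  have hνb := hV.lelongNumber_le_quotient hρd hρr' hΩb hmρ' hmr'
  refine hνb.trans_lt ?_
  rw [div_lt_iff₀ hLd, hmρ_def]
  linarith

end ThreeBalls


/-! ### The Lelong number is an admissible slope; non-integrability of `e^{-V}` (Hörmander's
Lemma 4.3.1) -/

section LelongSlopeAttained

variable {E : Type*} [NormedAddCommGroup E] [NormedSpace ℂ E]

/-- **The Lelong number is itself an admissible slope**: for `V` psh on `Ω ⊇ B̄(a, r₀)`,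
`V(z) ≤ ν(V, a) log ‖z - a‖ + C` near `a` (the slope set is the closed interval `[0, ν(V,a)]`).
Proof: `sup_{B̄(a,ρ)} V ≤ m_{r₀} - ν (log r₀ - log ρ)` for all `0 < ρ < r₀` by
`lelongNumber_le_quotient`. [cite: HormanderSCV1973, Thm. 1.6.3 and Cor. 1.6.6; classical] -/
theorem IsPlurisubharmonicOn.lelongNumber_mem_lelongSlopes [Nontrivial E] [ProperSpace E]
    {V : E → EReal} {Ω : Set E} (hV : IsPlurisubharmonicOn V Ω) {a : E} {r₀ : ℝ} (hr₀ : 0 < r₀)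
    (hΩ : closedBall a r₀ ⊆ Ω) : lelongNumber V a ∈ lelongSlopes V a := by
  have hν0 := lelongNumber_nonneg V a
  have hlt : sSup (V '' closedBall a r₀) < ⊤ :=
    sSup_image_closedBall_lt_top hV.upperSemicontinuousOn (fun z hz ↦ hV.lt_top hz) hΩ
  rcases eq_or_ne (sSup (V '' closedBall a r₀)) ⊥ with hbot | hbot
  · -- `V ≡ -∞` on the ball: every slope is admissible
    refine ⟨hν0, 0, ?_⟩
    have hball : ∀ᶠ z in 𝓝 a, z ∈ closedBall a r₀ := closedBall_mem_nhds a hr₀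
    filter_upwards [mem_nhdsWithin_of_mem_nhds hball] with z hz
    have : V z ≤ sSup (V '' closedBall a r₀) := le_sSup (mem_image_of_mem V hz)
    rw [hbot] at this
    exact (le_bot_iff.1 this).symm ▸ bot_le
  · set mr : ℝ := (sSup (V '' closedBall a r₀)).toReal with hmr_def
    have hmr_eq : (mr : EReal) = sSup (V '' closedBall a r₀) := EReal.coe_toReal hlt.ne hbot
    have hmr : ∀ z ∈ closedBall a r₀, V z ≤ mr := fun z hz ↦ by
      rw [hmr_eq]; exact le_sSup (mem_image_of_mem V hz)
    refine mem_lelongSlopes_of_forall_sSup_le (mr := mr) hν0 hr₀ fun ρ hρ hρr ↦ ?_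
    rcases eq_or_ne (sSup (V '' closedBall a ρ)) ⊥ with hρbot | hρbot
    · rw [hρbot]; exact bot_le
    · have hρlt : sSup (V '' closedBall a ρ) < ⊤ :=
        sSup_image_closedBall_lt_top hV.upperSemicontinuousOn (fun z hz ↦ hV.lt_top hz)
          ((closedBall_subset_closedBall hρr.le).trans hΩ)
      set mρ : ℝ := (sSup (V '' closedBall a ρ)).toReal with hmρ_def
      have hmρ_eq : (mρ : EReal) = sSup (V '' closedBall a ρ) := EReal.coe_toReal hρlt.ne hρbot
      have hq := hV.lelongNumber_le_quotient hρ hρr hΩ hmρ_eq.le hmr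
      rw [le_div_iff₀ (sub_pos.2 (Real.log_lt_log hρ hρr))] at hq
      rw [← hmρ_eq, EReal.coe_le_coe_iff]
      linarith

/-- For a psh function not identically `-∞` near `a`, the admissible Lelong slopes at `a` form
exactly the closed interval `[0, ν(V, a)]`. [folklore] -/
theorem IsPlurisubharmonicOn.lelongSlopes_eq_Icc [Nontrivial E] [ProperSpace E]
    {V : E → EReal} {Ω : Set E} (hV : IsPlurisubharmonicOn V Ω) {a : E} {r₀ : ℝ} (hr₀ : 0 < r₀)
    (hΩ : closedBall a r₀ ⊆ Ω) (hnb : ∀ ρ : ℝ, 0 < ρ → ∃ z ∈ closedBall a ρ, V z ≠ ⊥) :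
    lelongSlopes V a = Icc 0 (lelongNumber V a) := by
  -- slopes are bounded above
  have hbdd : BddAbove (lelongSlopes V a) := by
    have hlt : sSup (V '' closedBall a r₀) < ⊤ :=
      sSup_image_closedBall_lt_top hV.upperSemicontinuousOn (fun z hz ↦ hV.lt_top hz) hΩ
    have hbot : sSup (V '' closedBall a r₀) ≠ ⊥ := sSup_image_closedBall_ne_bot (hnb _ hr₀)
    have hmr : ∀ z ∈ closedBall a r₀, V z ≤ (sSup (V '' closedBall a r₀)).toReal := fun z hz ↦ by
      rw [EReal.coe_toReal hlt.ne hbot]; exact le_sSup (mem_image_of_mem V hz)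
    have h2 : sSup (V '' closedBall a (r₀ / 2)) ≠ ⊥ := sSup_image_closedBall_ne_bot (hnb _ (half_pos hr₀))
    have h2' : sSup (V '' closedBall a (r₀ / 2)) < ⊤ :=
      sSup_image_closedBall_lt_top hV.upperSemicontinuousOn (fun z hz ↦ hV.lt_top hz)
        ((closedBall_subset_closedBall (half_le_self hr₀.le)).trans hΩ)
    exact hV.bddAbove_lelongSlopes (half_pos hr₀) (half_lt_self hr₀) hΩ
      (EReal.coe_toReal h2'.ne h2).le hmr
  ext γ
  refine ⟨fun hγ ↦ ⟨hγ.1, le_csSup hbdd hγ⟩, fun hγ ↦ ?_⟩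
  exact mem_lelongSlopes_of_le_aux (hV.lelongNumber_mem_lelongSlopes hr₀ hΩ) hγ.1 hγ.2

end LelongSlopeAttained

section NonIntegrability

variable {F : Type*} [NormedAddCommGroup F] [NormedSpace ℝ F] [MeasurableSpace F] [BorelSpace F]
  [FiniteDimensional ℝ F] [Nontrivial F] (μ : Measure F) [μ.IsAddHaarMeasure]

/-- **`‖x - z‖^{-d}` is not integrable at `z` in dimension `d`**: for an additive Haar measure `μ`
on a real normed space of dimension `d ≥ 1` and every `r > 0`,
`∫_{B(z, r)} ‖x - z‖^{-d} dμ = ∞` (each dyadic shell `r 2^{-j-1} ≤ ‖x - z‖ < r 2^{-j}` contributes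
at least `(1 - 2^{-d}) μ(B(0,1))`). [folklore] -/
theorem lintegral_ball_norm_sub_rpow_neg_finrank_eq_top (z : F) {r : ℝ} (hr : 0 < r) :
    ∫⁻ x in ball z r, ENNReal.ofReal (‖x - z‖ ^ (-(Module.finrank ℝ F : ℝ))) ∂μ = ⊤ := by
  set d : ℕ := Module.finrank ℝ F with hd
  have hdpos : 0 < d := Module.finrank_pos
  -- dyadic radii and shells
  set a : ℕ → ℝ := fun j ↦ r / 2 ^ j with ha
  have hapos : ∀ j, 0 < a j := fun j ↦ by positivity
  have hasucc : ∀ j, a (j + 1) = a j / 2 := fun j ↦ by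
    simp only [ha, pow_succ]; ring
  have hanti : ∀ {i j : ℕ}, i ≤ j → a j ≤ a i := fun {i j} hij ↦ by
    simp only [ha]
    exact div_le_div_of_nonneg_left hr.le (by positivity) (pow_le_pow_right₀ one_le_two hij)
  have hale : ∀ j, a j ≤ r := fun j ↦ by
    have := hanti (Nat.zero_le j)
    simpa [ha] using this
  set S : ℕ → Set F := fun j ↦ ball z (a j) \ ball z (a (j + 1)) with hS
  have hSm : ∀ j, MeasurableSet (S j) := fun j ↦ measurableSet_ball.diff measurableSet_ball
  have hSsub : ∀ j, S j ⊆ ball z r := fun j x hx ↦ ball_subset_ball (hale j) hx.1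
  have hdisj_lt : ∀ {i j : ℕ}, i < j → Disjoint (S i) (S j) := by
    intro i j hlt
    refine Set.disjoint_left.2 fun x hxi hxj ↦ ?_
    have h1 : ¬ (dist x z < a (i + 1)) := fun h ↦ hxi.2 (mem_ball.2 h)
    have h2 : dist x z < a j := mem_ball.1 hxj.1
    exact h1 (h2.trans_le (hanti hlt))
  have hdisj : Set.PairwiseDisjoint (univ : Set ℕ) S := by
    intro i _ j _ hij
    rcases lt_or_gt_of_ne hij with hlt | hlt
    · exact hdisj_lt hlt
    · exact (hdisj_lt hlt).symm
  -- measure of a shell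
  set c₀ : ℝ≥0∞ := ENNReal.ofReal (1 - (1 / 2) ^ d) * μ (ball 0 1) with hc₀
  have hc₀pos : c₀ ≠ 0 := by
    refine mul_ne_zero ?_ (measure_ball_pos μ 0 one_pos).ne'
    rw [Ne, ENNReal.ofReal_eq_zero, not_le, sub_pos]
    exact pow_lt_one₀ (by norm_num) (by norm_num) hdpos.ne'
  have hshell : ∀ j, ENNReal.ofReal ((a j) ^ (-(d : ℝ))) * μ (S j) = c₀ := by
    intro j
    have hμ : μ (S j) = ENNReal.ofReal ((a j) ^ d - (a (j + 1)) ^ d) * μ (ball 0 1) := by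
      rw [hS]
      simp only
      rw [measure_sdiff (ball_subset_ball (hanti (Nat.le_succ j))) measurableSet_ball.nullMeasurableSet
        measure_ball_lt_top.ne, Measure.addHaar_ball μ z (hapos j).le,
        Measure.addHaar_ball μ z (hapos (j + 1)).le, ← ENNReal.sub_mul (fun _ _ ↦ measure_ball_lt_top.ne),
        ← ENNReal.ofReal_sub _ (pow_nonneg (hapos _).le _)]
    have key : ∀ t : ℝ, 0 < t → t ^ (-(d : ℝ)) * (t ^ d - (t / 2) ^ d) = 1 - (1 / 2) ^ d := by
      intro t ht
      have htd : t ^ d ≠ 0 := pow_ne_zero d ht.ne'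
      rw [Real.rpow_neg ht.le, Real.rpow_natCast, div_pow, mul_sub, inv_mul_cancel₀ htd,
        div_pow, one_pow, ← div_eq_inv_mul, div_div_cancel_left' htd, one_div]
    rw [hμ, ← mul_assoc, ← ENNReal.ofReal_mul (Real.rpow_nonneg (hapos j).le _), hc₀, hasucc,
      key (a j) (hapos j)]
  -- lower bound by `n` shells
  have hlow : ∀ n : ℕ, (n : ℝ≥0∞) * c₀ ≤
      ∫⁻ x in ball z r, ENNReal.ofReal (‖x - z‖ ^ (-(d : ℝ))) ∂μ := by
    intro n
    have hU : (⋃ j ∈ Finset.range n, S j) ⊆ ball z r :=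
      iUnion₂_subset fun j _ ↦ hSsub j
    calc (n : ℝ≥0∞) * c₀ = ∑ j ∈ Finset.range n, c₀ := by
          rw [Finset.sum_const, Finset.card_range, nsmul_eq_mul]
      _ = ∑ j ∈ Finset.range n, ENNReal.ofReal ((a j) ^ (-(d : ℝ))) * μ (S j) := by
          refine Finset.sum_congr rfl fun j _ ↦ (hshell j).symm
      _ ≤ ∑ j ∈ Finset.range n, ∫⁻ x in S j, ENNReal.ofReal (‖x - z‖ ^ (-(d : ℝ))) ∂μ := by
          refine Finset.sum_le_sum fun j _ ↦ ?_
          rw [← setLIntegral_const]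
          refine setLIntegral_mono' (hSm j) fun x hx ↦ ENNReal.ofReal_le_ofReal ?_
          have hxlt : ‖x - z‖ < a j := by rw [← dist_eq_norm]; exact mem_ball.1 hx.1
          have hxpos : 0 < ‖x - z‖ := by
            have : a (j + 1) ≤ dist x z := not_lt.1 fun h ↦ hx.2 (mem_ball.2 h)
            rw [dist_eq_norm] at this
            exact (hapos _).trans_le this
          exact Real.rpow_le_rpow_of_nonpos hxpos hxlt.le (by simp)
      _ = ∫⁻ x in ⋃ j ∈ Finset.range n, S j, ENNReal.ofReal (‖x - z‖ ^ (-(d : ℝ))) ∂μ :=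
          (lintegral_biUnion_finset (hdisj.subset (subset_univ _)) (fun j _ ↦ hSm j) _).symm
      _ ≤ ∫⁻ x in ball z r, ENNReal.ofReal (‖x - z‖ ^ (-(d : ℝ))) ∂μ :=
          lintegral_mono_set hU
  by_contra hne
  obtain ⟨n, hn⟩ := ENNReal.exists_nat_mul_gt hc₀pos hne
  exact (not_le.2 hn) (hlow n)

end NonIntegrability

section HormanderLemma

variable {E : Type*} [NormedAddCommGroup E] [NormedSpace ℂ E] [MeasurableSpace E] [BorelSpace E]
  [FiniteDimensional ℂ E] [Nontrivial E] (μ : Measure E) [μ.IsAddHaarMeasure]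

/-- **Hörmander's Lemma 4.3.1 (sup form of the Lelong number)**: if `V` is psh near `z` and
`ν(V, z) ≥ dim_ℝ E`, then `e^{-V}` is not integrable on any ball about `z`:
`V(ζ) ≤ ν log ‖ζ - z‖ + C` near `z` (`lelongNumber_mem_lelongSlopes`), so
`e^{-V(ζ)} ≥ e^{-C} ‖ζ - z‖^{-ν} ≥ e^{-C} ‖ζ - z‖^{-dim}` on a small ball, which is not integrable.
(In Hörmander's normalisation `dim_ℝ ℂⁿ = 2n`: "`ν_φ(z) ≥ 2n` implies `e^{-φ} ∉ L¹_{loc}` at `z`",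
the contrapositive of Lemma 4.3.1.)
[cite: HormanderSCV1973, Thm. 1.6.3; Hörmander, Notions of Convexity, Lemma 4.3.1] -/
theorem IsPlurisubharmonicOn.lintegral_exp_neg_eq_top_of_finrank_le_lelongNumber
    {V : E → EReal} {Ω : Set E} (hV : IsPlurisubharmonicOn V Ω) {z : E} {r₀ : ℝ} (hr₀ : 0 < r₀)
    (hΩ : closedBall z r₀ ⊆ Ω) (hν : (Module.finrank ℝ E : ℝ) ≤ lelongNumber V z) {r : ℝ}
    (hr : 0 < r) : ∫⁻ ζ in ball z r, EReal.exp (-V ζ) ∂μ = ⊤ := by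
  haveI : ProperSpace E := FiniteDimensional.proper ℂ E
  set d : ℕ := Module.finrank ℝ E with hd
  set ν : ℝ := lelongNumber V z with hνdef
  obtain ⟨-, C, hC⟩ := hV.lelongNumber_mem_lelongSlopes hr₀ hΩ
  rw [eventually_nhdsWithin_iff, Metric.eventually_nhds_iff_ball] at hC
  obtain ⟨ε, hε, hball⟩ := hC
  -- a small radius `r₁ ≤ min r ε 1`
  set r₁ : ℝ := min r (min ε 1) with hr₁
  have hr₁pos : 0 < r₁ := lt_min hr (lt_min hε one_pos)
  have hr₁r : r₁ ≤ r := min_le_left _ _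
  have hr₁ε : r₁ ≤ ε := (min_le_right _ _).trans (min_le_left _ _)
  have hr₁1 : r₁ ≤ 1 := (min_le_right _ _).trans (min_le_right _ _)
  -- pointwise lower bound on `B(z, r₁)` off the centre
  have hpt : ∀ ζ ∈ ball z r₁, ζ ≠ z →
      ENNReal.ofReal (Real.exp (-C)) * ENNReal.ofReal (‖ζ - z‖ ^ (-(d : ℝ))) ≤
        EReal.exp (-V ζ) := by
    intro ζ hζ hζz
    have hρ : 0 < ‖ζ - z‖ := norm_pos_iff.2 (sub_ne_zero.2 hζz)
    have hρ1 : ‖ζ - z‖ ≤ 1 := by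
      have : dist ζ z < r₁ := mem_ball.1 hζ
      rw [dist_eq_norm] at this
      exact this.le.trans hr₁1
    have h1 : V ζ ≤ ((ν * Real.log ‖ζ - z‖ + C : ℝ) : EReal) :=
      hball ζ (ball_subset_ball hr₁ε hζ) hζz
    -- `e^{-V ζ} ≥ e^{-(ν log ρ + C)} = e^{-C} ρ^{-ν} ≥ e^{-C} ρ^{-d}`
    have h2 : EReal.exp (-((ν * Real.log ‖ζ - z‖ + C : ℝ) : EReal)) ≤ EReal.exp (-V ζ) :=
      EReal.exp_monotone (EReal.neg_le_neg_iff.2 h1)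
    refine le_trans ?_ h2
    rw [← EReal.coe_neg, EReal.exp_coe, ← ENNReal.ofReal_mul (Real.exp_pos _).le]
    refine ENNReal.ofReal_le_ofReal ?_
    rw [neg_add, Real.exp_add, mul_comm, ← Real.log_rpow hρ, ← Real.log_inv,
      Real.exp_log (inv_pos.2 (Real.rpow_pos_of_pos hρ _)), ← Real.rpow_neg hρ.le]
    refine mul_le_mul_of_nonneg_right ?_ (Real.exp_pos _).le
    -- `ρ^{-d} ≤ ρ^{-ν}` for `ρ ≤ 1` and `d ≤ ν`
    exact Real.rpow_le_rpow_of_exponent_ge hρ hρ1 (neg_le_neg hν)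
  -- integrate
  have hsub : ∫⁻ ζ in ball z r₁, EReal.exp (-V ζ) ∂μ ≤ ∫⁻ ζ in ball z r, EReal.exp (-V ζ) ∂μ :=
    lintegral_mono_set (ball_subset_ball hr₁r)
  refine eq_top_iff.2 (le_trans ?_ hsub)
  have hz0 : μ {z} = 0 := measure_singleton z
  have key : ∫⁻ ζ in ball z r₁, ENNReal.ofReal (Real.exp (-C)) *
      ENNReal.ofReal (‖ζ - z‖ ^ (-(d : ℝ))) ∂μ ≤ ∫⁻ ζ in ball z r₁, EReal.exp (-V ζ) ∂μ := by
    refine setLIntegral_mono_ae' measurableSet_ball ?_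
    have : ∀ᵐ ζ ∂μ, ζ ≠ z := by
      rw [ae_iff]
      simp only [not_not, setOf_eq_eq_singleton]
      exact hz0
    filter_upwards [this] with ζ hζz hζ using hpt ζ hζ hζz
  refine le_trans ?_ key
  rw [lintegral_const_mul' _ _ ENNReal.ofReal_ne_top,
    lintegral_ball_norm_sub_rpow_neg_finrank_eq_top μ z hr₁pos,
    ENNReal.mul_top (ENNReal.ofReal_pos.2 (Real.exp_pos _)).ne']

end HormanderLemma

/-! ### Closedness of the Lelong upper level sets on `ℙᴺ` -/

namespace ClosedPositiveOneOneCurrent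

variable {N : ℕ} (T : ClosedPositiveOneOneCurrent N)

/-- **The Lelong upper level sets `E_c(T)` are closed** (upper semicontinuity of `x ↦ ν(T, x)`;
a necessary condition for, and the elementary part of, their analyticity).
[cite: Siu1974, Main Theorem (closedness part)] -/
theorem isClosed_lelongUpperLevelSet (c : ℝ) : IsClosed (T.lelongUpperLevelSet c) := by
  rw [← isOpen_compl_iff, isOpen_iff_mem_nhds]
  intro x hx
  rw [mem_compl_iff, mem_lelongUpperLevelSet_iff, not_le] at hx
  set v := x.rep with hv
  have hv0 : v ≠ 0 := x.rep_nonzero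
  have hvpos : 0 < ‖v‖ := norm_pos_iff.2 hv0
  have hr₀ : 0 < ‖v‖ / 2 := half_pos hvpos
  have hΩ : closedBall v (‖v‖ / 2) ⊆ ({0}ᶜ : Set (Fin (N + 1) → ℂ)) := by
    intro z hz h0
    rw [mem_singleton_iff] at h0
    rw [h0, mem_closedBall, dist_comm, dist_zero_right] at hz
    linarith
  have hnb : ∀ ρ : ℝ, 0 < ρ → ∃ z ∈ closedBall v ρ, T.pot z ≠ ⊥ := fun ρ hρ ↦ by
    obtain ⟨z, hz1, hz2⟩ :=
      ((T.frequently_ne_bot v hv0).and_eventually (closedBall_mem_nhds v hρ)).exists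
    exact ⟨z, hz2, hz1⟩
  have hx' : Pluripotential.lelongNumber T.pot v < c := hx
  have hev := T.isPlurisubharmonicOn_pot.eventually_lelongNumber_lt hr₀ hΩ hnb hx'
  obtain ⟨W, hWsub, hWo, hvW⟩ :=
    _root_.eventually_nhds_iff.1 (hev.and (isOpen_compl_singleton.eventually_mem hv0))
  set W' : Set {u : Fin (N + 1) → ℂ // u ≠ 0} := Subtype.val ⁻¹' W with hW'
  have hW'o : IsOpen W' := hWo.preimage continuous_subtype_val
  have himg : IsOpen ((fun u : {u : Fin (N + 1) → ℂ // u ≠ 0} ↦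
      Projectivization.mk ℂ u.1 u.2) '' W') := Projectivization.isOpenMap_mk _ hW'o
  refine mem_of_superset (himg.mem_nhds ⟨⟨v, hv0⟩, hvW, Projectivization.mk_rep x⟩) ?_
  rintro _ ⟨⟨u, hu0⟩, huW, rfl⟩
  rw [mem_compl_iff, mem_lelongUpperLevelSet_iff, not_le, T.lelongNumber_mk hu0]
  exact (hWsub u huW).1



/-! ### Positive Lelong numbers sit on the pole set; `E_c(T)`, `c > 0`, has empty interior -/

section Poles

variable {N : ℕ} (T : ClosedPositiveOneOneCurrent N)

/-- **A point of positive Lelong number is a pole**: `ν(V, v) > 0` forces `V(v) = -∞`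
(`V(v) ≤ sup_{B̄(v,s)} V ≤ γ log s + C → -∞`). [cite: HormanderSCV1973, Thm. 1.6.3; classical] -/
theorem pot_eq_bot_of_lelongNumber_pos {v : Fin (N + 1) → ℂ} (hv : v ≠ 0)
    (hpos : 0 < Pluripotential.lelongNumber T.pot v) : T.pot v = ⊥ := by
  set γ : ℝ := Pluripotential.lelongNumber T.pot v / 2 with hγ
  have hγ0 : 0 < γ := by rw [hγ]; linarith
  have hγν : γ < Pluripotential.lelongNumber T.pot v := by rw [hγ]; linarith
  obtain ⟨-, C, hC⟩ := mem_lelongSlopes_of_lt_lelongNumber hγ0.le hγν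
  -- a punctured ball on which the slope estimate holds, inside `ℂ^{N+1} ∖ {0}`
  obtain ⟨ε, hε, hεv, hball⟩ : ∃ ε > 0, ε < ‖v‖ ∧ ∀ z : Fin (N + 1) → ℂ, z ≠ v → ‖z - v‖ < ε →
      T.pot z ≤ ((γ * Real.log ‖z - v‖ + C : ℝ) : EReal) := by
    rw [eventually_nhdsWithin_iff, Metric.eventually_nhds_iff_ball] at hC
    obtain ⟨ε, hε, h⟩ := hC
    have hvpos : 0 < ‖v‖ := norm_pos_iff.2 hv
    exact ⟨min ε (‖v‖ / 2), lt_min hε (half_pos hvpos),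
      (min_le_right _ _).trans_lt (half_lt_self hvpos),
      fun z hzv hz ↦ h z (mem_ball_iff_norm.2 (hz.trans_le (min_le_left _ _))) hzv⟩
  have hΩ : closedBall v ε ⊆ ({0}ᶜ : Set (Fin (N + 1) → ℂ)) := by
    intro z hz h0
    rw [mem_singleton_iff] at h0
    rw [h0, mem_closedBall, dist_comm, dist_zero_right] at hz
    linarith
  by_contra hne
  have htop : T.pot v ≠ ⊤ := (T.pot_lt_top hv).ne
  set p : ℝ := (T.pot v).toReal with hp
  have hp' : T.pot v = (p : EReal) := (EReal.coe_toReal htop hne).symm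
  -- a radius `s` with `γ log s + C < p`
  set s : ℝ := min (ε / 2) (Real.exp ((p - C - 1) / γ)) with hs
  have hs0 : 0 < s := by positivity
  have hsε : s < ε := (min_le_left _ _).trans_lt (half_lt_self hε)
  have hbound : γ * Real.log s + C < p := by
    have hle : Real.log s ≤ (p - C - 1) / γ :=
      calc Real.log s ≤ Real.log (Real.exp ((p - C - 1) / γ)) :=
            Real.log_le_log hs0 (min_le_right _ _)
        _ = (p - C - 1) / γ := Real.log_exp _
    have := mul_le_mul_of_nonneg_left hle hγ0.le
    rw [mul_div_cancel₀ _ hγ0.ne'] at this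
    linarith
  have key : T.pot v ≤ ((γ * Real.log s + C : ℝ) : EReal) :=
    (le_sSup (mem_image_of_mem T.pot (mem_closedBall_self hs0.le))).trans
      (T.isPlurisubharmonicOn_pot.sSup_image_closedBall_le_of_slope hγ0.le hΩ hball hs0 hsε)
  rw [hp', EReal.coe_le_coe_iff] at key
  exact (not_lt.2 key) hbound

/-- For `c > 0` the level set `E_c(T)` lies in the image of the pole set `{V = -∞}` of the cone
potential. [cite: Siu1974, Main Theorem; classical] -/
theorem lelongUpperLevelSet_subset_image_poleSet {c : ℝ} (hc : 0 < c) :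
    T.lelongUpperLevelSet c ⊆ (fun u : {u : Fin (N + 1) → ℂ // u ≠ 0} ↦
      Projectivization.mk ℂ u.1 u.2) '' {u | T.pot u.1 = ⊥} := by
  intro x hx
  rw [mem_lelongUpperLevelSet_iff] at hx
  refine ⟨⟨x.rep, x.rep_nonzero⟩, ?_, Projectivization.mk_rep x⟩
  exact T.pot_eq_bot_of_lelongNumber_pos x.rep_nonzero (hc.trans_le hx)

/-- **`E_c(T)` has empty interior for `c > 0`**: an interior point would give an open set of
`ℂ^{N+1} ∖ {0}` on which the cone potential is `-∞`, against `V ≢ -∞` near every point. (So once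
`E_c(T)` is known to be analytic, it is a proper analytic subset.) [folklore] -/
theorem interior_lelongUpperLevelSet_eq_empty {c : ℝ} (hc : 0 < c) :
    interior (T.lelongUpperLevelSet c) = ∅ := by
  by_contra hne
  obtain ⟨x, hx⟩ := nonempty_iff_ne_empty.2 hne
  set q : {u : Fin (N + 1) → ℂ // u ≠ 0} → ℙ ℂ (Fin (N + 1) → ℂ) :=
    fun u ↦ Projectivization.mk ℂ u.1 u.2 with hq
  have hqc : Continuous q := Projectivization.continuous_mk
  set W : Set (Fin (N + 1) → ℂ) := Subtype.val '' (q ⁻¹' interior (T.lelongUpperLevelSet c))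
    with hW
  have hWo : IsOpen W :=
    isOpen_compl_singleton.isOpenMap_subtype_val _ (isOpen_interior.preimage hqc)
  have hvW : x.rep ∈ W := ⟨⟨x.rep, x.rep_nonzero⟩, by
    show q ⟨x.rep, x.rep_nonzero⟩ ∈ interior (T.lelongUpperLevelSet c)
    rw [hq]; simpa only [Projectivization.mk_rep] using hx, rfl⟩
  have hbot : ∀ u ∈ W, T.pot u = ⊥ := by
    rintro _ ⟨⟨u, hu0⟩, hu, rfl⟩
    have hmem : Projectivization.mk ℂ u hu0 ∈ T.lelongUpperLevelSet c := interior_subset hu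
    rw [mem_lelongUpperLevelSet_iff, T.lelongNumber_mk hu0] at hmem
    exact T.pot_eq_bot_of_lelongNumber_pos hu0 (hc.trans_le hmem)
  have hev : ∀ᶠ y in 𝓝 x.rep, T.pot y = ⊥ := by
    filter_upwards [hWo.mem_nhds hvW] with y hy using hbot y hy
  exact (T.frequently_ne_bot x.rep x.rep_nonzero) (hev.mono fun y hy ↦ not_ne_iff.2 hy)

/-- For `c > 0` the level set `E_c(T)` is not all of `ℙᴺ(ℂ)`. [folklore] -/
theorem lelongUpperLevelSet_ne_univ {c : ℝ} (hc : 0 < c) : T.lelongUpperLevelSet c ≠ univ := by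
  intro h
  have h1 := T.interior_lelongUpperLevelSet_eq_empty hc
  rw [h, interior_univ] at h1
  have hne : (univ : Set (ℙ ℂ (Fin (N + 1) → ℂ))).Nonempty :=
    ⟨Projectivization.mk ℂ (Pi.single 0 1) (by
      intro h0; have := congrFun h0 0; simp at this), mem_univ _⟩
  rw [h1] at hne
  exact not_nonempty_empty hne

end Poles

/-! ### Siu's theorem on `ℙ¹(ℂ)`: the level sets `E_c(T)`, `c > 0`, are finite -/

section ProjectiveLine

variable (T : ClosedPositiveOneOneCurrent 1)

/-- **Counting Lelong numbers on `ℙ¹`.** If `k` distinct points `[1 : a]` of the chart `{z₀ ≠ 0}`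
all have `ν(T, [1 : a]) ≥ c > 0`, then `k c ≤ deg T`: otherwise, for `c''` slightly below `c`
with `k c'' > deg T`, the slice `τ ↦ V(e₀ + τ e₁)` (subharmonic on `ℂ`, `≤ deg T · log |τ| + A`
at infinity, slope `c''` at each `a`) would be `≡ -∞` off the `k` points by
`IsSubharmonicOn.eq_bot_of_growth_finset`, forcing `V ≡ -∞` near every other point of the chart.
[cite: Siu1974, Main Theorem (case of ℙ¹: ν(T, x) is the point mass of T at x)] -/
theorem card_mul_le_degree_of_le_lelongNumber {c : ℝ} (S : Finset ℂ)
    (hS : ∀ a ∈ S, c ≤ Pluripotential.lelongNumber T.pot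
      ((Pi.single 0 1 : Fin (1 + 1) → ℂ) + a • (Pi.single 1 1 : Fin (1 + 1) → ℂ))) :
    (S.card : ℝ) * c ≤ T.degree := by
  classical
  set e₀ : Fin (1 + 1) → ℂ := Pi.single 0 1 with he₀
  set e₁ : Fin (1 + 1) → ℂ := Pi.single 1 1 with he₁
  have he₁0 : e₁ ≠ 0 := by
    intro h
    have := congrFun h 1
    simp [he₁] at this
  have hvw : ∀ τ : ℂ, e₀ + τ • e₁ ≠ 0 := by
    intro τ h
    have := congrFun h 0
    simp [he₀, he₁] at this
  by_contra hlt
  push Not at hlt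
  have hk0 : S.card ≠ 0 := by
    rintro h
    rw [h, Nat.cast_zero, zero_mul] at hlt
    exact (not_lt.2 T.degree_nonneg) hlt
  have hkpos : 0 < (S.card : ℝ) := by exact_mod_cast Nat.pos_of_ne_zero hk0
  set c'' : ℝ := (c + T.degree / S.card) / 2 with hc''
  have h1 : T.degree / S.card < c := by rw [div_lt_iff₀ hkpos]; linarith
  have hc''c : c'' < c := by rw [hc'']; linarith
  have hc''0 : 0 < c'' := by
    have := div_nonneg T.degree_nonneg hkpos.le
    rw [hc'']; linarith
  have hdeg : T.degree < S.card * c'' := by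
    have : (S.card : ℝ) * c'' = (S.card * c + T.degree) / 2 := by
      rw [hc'']; field_simp
    rw [this]; linarith
  -- the slice, its growth and its slopes at the poles
  have h0 : ∀ a ∈ S, ∃ C ε : ℝ, 0 < ε ∧ ∀ τ : ℂ, τ ≠ a → ‖τ - a‖ < ε →
      T.pot (e₀ + τ • e₁) ≤ ((c'' * Real.log ‖τ - a‖ + C : ℝ) : EReal) := fun a ha ↦
    T.exists_pot_add_smul_le_of_mem_lelongSlopes he₁0
      (mem_lelongSlopes_of_lt_lelongNumber hc''0.le (hc''c.trans_le (hS a ha)))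
  obtain ⟨A, R₀, hinf⟩ := T.exists_pot_add_smul_le he₁0 hvw
  have hf_sub : IsSubharmonicOn (fun τ : ℂ ↦ T.pot (e₀ + τ • e₁)) ((↑S : Set ℂ)ᶜ) :=
    (T.isPlurisubharmonicOn_pot.isSubharmonicOn_line e₀ e₁).mono fun τ _ ↦ hvw τ
  have hbot := hf_sub.eq_bot_of_growth_finset T.degree_nonneg hdeg h0 hinf
  -- a point of the chart off the poles, near which `V ≡ -∞`
  obtain ⟨τ₁, hτ₁⟩ := Infinite.exists_notMem_finset S
  set p₁ : Fin (1 + 1) → ℂ := e₀ + τ₁ • e₁ with hp₁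
  have hp₁0 : p₁ ≠ 0 := hvw τ₁
  have hp₁zero : p₁ 0 = 1 := by simp [hp₁, he₀, he₁]
  have hp₁one : p₁ 1 = τ₁ := by simp [hp₁, he₀, he₁]
  have hq : ContinuousAt (fun y : Fin (1 + 1) → ℂ ↦ y 1 / y 0) p₁ := by
    refine ((continuous_apply 1).continuousAt).div ((continuous_apply 0).continuousAt) ?_
    rw [hp₁zero]; exact one_ne_zero
  have hSo : IsOpen ((↑S : Set ℂ)ᶜ) := S.finite_toSet.isClosed.isOpen_compl
  have hev1 : ∀ᶠ y in 𝓝 p₁, y 1 / y 0 ∉ S := by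
    have hmem : ((↑S : Set ℂ)ᶜ) ∈ 𝓝 ((fun y : Fin (1 + 1) → ℂ ↦ y 1 / y 0) p₁) := by
      refine hSo.mem_nhds ?_
      show p₁ 1 / p₁ 0 ∉ (↑S : Set ℂ)
      rw [hp₁zero, hp₁one, div_one]; exact fun h ↦ hτ₁ (Finset.mem_coe.1 h)
    filter_upwards [hq.preimage_mem_nhds hmem] with y hy
    exact fun h ↦ hy (Finset.mem_coe.2 h)
  have hev0 : ∀ᶠ y in 𝓝 p₁, y 0 ≠ (0 : ℂ) :=
    (isOpen_ne.preimage (continuous_apply 0)).eventually_mem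
      (show p₁ 0 ≠ 0 by rw [hp₁zero]; exact one_ne_zero)
  have hev : ∀ᶠ y in 𝓝 p₁, T.pot y = ⊥ := by
    filter_upwards [hev0, hev1] with y hy0 hy1
    have hrep : y = (y 0) • (e₀ + (y 1 / y 0) • e₁) := by
      funext i
      fin_cases i
      · simp [he₀, he₁]
      · simp [he₀, he₁, mul_div_cancel₀ _ hy0]
    rw [hrep, T.pot_smul hy0 (hvw _), hbot _ hy1, EReal.bot_add]
  exact (T.frequently_ne_bot p₁ hp₁0) (hev.mono fun y hy ↦ not_ne_iff.2 hy)

/-- **Finiteness of the Lelong upper level sets on `ℙ¹`**: for a closed positive `(1,1)`-current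
`T` on `ℙ¹(ℂ)` and `c > 0`, `E_c(T)` is a finite set (with at most `deg T / c` points in each
affine chart). [cite: Siu1974, Main Theorem (case of ℙ¹)] -/
theorem finite_lelongUpperLevelSet_of_projectiveLine {c : ℝ} (hc : 0 < c) :
    (T.lelongUpperLevelSet c).Finite := by
  classical
  set e₀ : Fin (1 + 1) → ℂ := Pi.single 0 1 with he₀
  set e₁ : Fin (1 + 1) → ℂ := Pi.single 1 1 with he₁
  have he₁0 : e₁ ≠ 0 := by
    intro h
    have := congrFun h 1
    simp [he₁] at this
  have hvw : ∀ τ : ℂ, e₀ + τ • e₁ ≠ 0 := by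
    intro τ h
    have := congrFun h 0
    simp [he₀, he₁] at this
  set Aset : Set ℂ := {a | c ≤ Pluripotential.lelongNumber T.pot (e₀ + a • e₁)} with hAset
  have hA : Aset.Finite := by
    by_contra hinf
    obtain ⟨S, hS, hcard⟩ := Set.Infinite.exists_subset_card_eq hinf (⌊T.degree / c⌋₊ + 1)
    have h1 := T.card_mul_le_degree_of_le_lelongNumber S fun a ha ↦ hS (Finset.mem_coe.2 ha)
    rw [hcard] at h1
    have h2 : T.degree / c < ((⌊T.degree / c⌋₊ + 1 : ℕ) : ℝ) := by
      push_cast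
      exact Nat.lt_floor_add_one (T.degree / c)
    rw [div_lt_iff₀ hc] at h2
    linarith
  -- every point of the level set is `[e₀ + a e₁]` with `a ∈ Aset`, or the point `[e₁]`
  have hcover : T.lelongUpperLevelSet c ⊆
      (fun a : ℂ ↦ Projectivization.mk ℂ (e₀ + a • e₁) (hvw a)) '' Aset ∪
        {Projectivization.mk ℂ e₁ he₁0} := by
    intro x hx
    rw [mem_lelongUpperLevelSet_iff] at hx
    have hv : x.rep ≠ 0 := x.rep_nonzero
    by_cases hv0 : x.rep 0 = 0
    · right
      have hveq : x.rep = (x.rep 1) • e₁ := by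
        funext i
        fin_cases i
        · simp [he₁, hv0]
        · simp [he₁]
      rw [mem_singleton_iff, ← Projectivization.mk_rep x]
      exact (Projectivization.mk_eq_mk_iff' ℂ _ _ hv he₁0).2 ⟨x.rep 1, hveq.symm⟩
    · left
      have hveq : x.rep = (x.rep 0) • (e₀ + (x.rep 1 / x.rep 0) • e₁) := by
        funext i
        fin_cases i
        · simp [he₀, he₁]
        · simp [he₀, he₁, mul_div_cancel₀ _ hv0]
      have hveq' : (x.rep 0)⁻¹ • x.rep = e₀ + (x.rep 1 / x.rep 0) • e₁ := by
        funext i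
        fin_cases i
        · simp [he₀, he₁, inv_mul_cancel₀ hv0]
        · simp [he₀, he₁, div_eq_inv_mul]
      refine ⟨x.rep 1 / x.rep 0, ?_, ?_⟩
      · show c ≤ Pluripotential.lelongNumber T.pot (e₀ + (x.rep 1 / x.rep 0) • e₁)
        have key := T.isLogHomogeneous_pot.lelongNumber_smul hv0 (hvw (x.rep 1 / x.rep 0))
        rw [← hveq] at key
        rw [← key]; exact hx
      · conv_rhs => rw [← Projectivization.mk_rep x]
        exact (Projectivization.mk_eq_mk_iff' ℂ _ _ (hvw _) hv).2 ⟨(x.rep 0)⁻¹, hveq'⟩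
  exact ((hA.image _).union (Set.finite_singleton _)).subset hcover

/-- **Siu's theorem on `ℙ¹(ℂ)`**: for every closed positive `(1,1)`-current `T` on the projective
line and every `c > 0`, the Lelong upper level set `E_c(T)` is a (finite, hence) analytic subset
of `ℙ¹(ℂ)` — the case `N = 1` of `Siu1974_isAnalyticSet_lelongUpperLevelSet`, proved without
`L²` theory. [cite: Siu1974, Main Theorem (case of ℙ¹)] -/
theorem isAnalyticSet_lelongUpperLevelSet_of_projectiveLine {c : ℝ} (hc : 0 < c) :
    Literature.Geometry.Kaehler.IsAnalyticSet 𝓘(ℂ, Fin 1 → ℂ) (T.lelongUpperLevelSet c) := by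
  haveI : IsManifold 𝓘(ℂ, Fin 1 → ℂ) ω (ℙ ℂ (Fin (1 + 1) → ℂ)) :=
    Literature.NumberTheory.Transcendental.isManifold_projectivization_holds ℂ 1
  have hfin := T.finite_lelongUpperLevelSet_of_projectiveLine hc
  rw [← Set.biUnion_of_singleton (T.lelongUpperLevelSet c), ← hfin.coe_toFinset]
  exact Literature.Geometry.Kaehler.isAnalyticSet_biUnion_finset hfin.toFinset
    fun x _ ↦ Literature.Geometry.Kaehler.isAnalyticSet_singleton x

end ProjectiveLine


/-! ### Level sets meet every non-polar projective line in at most `deg T / c` points -/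

section Lines

/-- If `g = -∞` on a circle off a finite set of points, then the circle mean of `g` is `-∞`
(`∫ g⁻ = ∞`, and `x - ∞ = -∞` for every `x ∈ [-∞, +∞]`). [folklore] -/
theorem circleMean_eq_bot_of_eq_bot_off_finite {g : ℂ → EReal} {c : ℂ} {R : ℝ} (hR : R ≠ 0)
    {Tset : Set ℂ} (hT : Tset.Finite)
    (hbot : ∀ θ ∈ Ioc (0 : ℝ) (2 * Real.pi), circleMap c R θ ∉ Tset → g (circleMap c R θ) = ⊥) :
    circleMean g c R = ⊥ := by
  have hpi : 0 < 2 * Real.pi := by positivity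
  -- the exceptional parameters form a finite, hence null, set
  set A : Set ℝ := Ioc (0 : ℝ) (2 * Real.pi) ∩ (circleMap c R) ⁻¹' Tset with hA
  have hAfin : A.Finite := by
    refine Set.Finite.of_finite_image (f := circleMap c R) (hT.subset ?_) ?_
    · rintro _ ⟨θ, hθ, rfl⟩
      exact hθ.2
    · have hinj := injOn_circleMap_of_abs_sub_le (c := c) (a := 0) (b := 2 * Real.pi) hR
        (by rw [zero_sub, abs_neg, abs_of_pos hpi])
      rw [Set.uIoc_of_le hpi.le] at hinj
      exact hinj.mono inter_subset_left
  have hA0 : volume A = 0 := hAfin.measure_zero volume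
  have hlow : circleLowerMean g c R = ⊤ := by
    unfold circleLowerMean
    have hae : ∀ᵐ θ ∂(volume.restrict (Ioc (0 : ℝ) (2 * Real.pi))),
        (-g (circleMap c R θ)).toENNReal = ⊤ := by
      rw [ae_restrict_iff' measurableSet_Ioc]
      have hA' : ∀ᵐ θ ∂(volume : Measure ℝ), θ ∉ A := by
        rw [ae_iff]
        simpa only [not_not, setOf_mem_eq] using hA0
      filter_upwards [hA'] with θ hθA hθ
      have hnot : circleMap c R θ ∉ Tset := fun h ↦ hθA ⟨hθ, h⟩
      rw [hbot θ hθ hnot, EReal.neg_bot, EReal.toENNReal_top]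
    rw [lintegral_congr_ae hae, lintegral_const, Measure.restrict_apply MeasurableSet.univ,
      univ_inter, Real.volume_Ioc, sub_zero, ENNReal.top_mul (ENNReal.ofReal_pos.2 hpi).ne',
      ENNReal.top_div_of_ne_top ENNReal.ofReal_ne_top]
  rw [circleMean_def, hlow, EReal.coe_ennreal_top]
  exact EReal.sub_top _

variable {N : ℕ} (T : ClosedPositiveOneOneCurrent N)

/-- **Counting Lelong numbers along a projective line.** Let `v, w ∈ ℂ^{N+1}` span a plane
`P` meeting the vertex only at `0` (`v + τ w ≠ 0` for all `τ`, `w ≠ 0`) on which the cone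
potential `V` of `T` is not identically `-∞`. If `k` distinct points `[v + σ w]` of the projective
line `ℙ(P)` have `ν(T, ·) ≥ c`, then `k c ≤ deg T`. (Otherwise the slice `τ ↦ V(v + τ w)` would be
`-∞` off the `k` points by `IsSubharmonicOn.eq_bot_of_growth_finset`, and the sub-mean-value
inequality along lines inside `P` would force `V ≡ -∞` on `P ∖ {0}`.)
[cite: Siu1974, Main Theorem (restriction to lines; on ℙ¹ the Lelong number is a point mass)] -/
theorem card_mul_le_degree_of_le_lelongNumber_line {v w : Fin (N + 1) → ℂ}
    (hvw : ∀ τ : ℂ, v + τ • w ≠ 0) (hw : w ≠ 0)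
    (hP : ∃ a b : ℂ, a • v + b • w ≠ 0 ∧ T.pot (a • v + b • w) ≠ ⊥)
    {c : ℝ} (S : Finset ℂ)
    (hS : ∀ σ ∈ S, c ≤ Pluripotential.lelongNumber T.pot (v + σ • w)) :
    (S.card : ℝ) * c ≤ T.degree := by
  classical
  by_contra hlt
  push Not at hlt
  have hk0 : S.card ≠ 0 := by
    rintro h
    rw [h, Nat.cast_zero, zero_mul] at hlt
    exact (not_lt.2 T.degree_nonneg) hlt
  have hkpos : 0 < (S.card : ℝ) := by exact_mod_cast Nat.pos_of_ne_zero hk0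
  set c'' : ℝ := (c + T.degree / S.card) / 2 with hc''
  have h1 : T.degree / S.card < c := by rw [div_lt_iff₀ hkpos]; linarith
  have hc''c : c'' < c := by rw [hc'']; linarith
  have hc''0 : 0 < c'' := by
    have := div_nonneg T.degree_nonneg hkpos.le
    rw [hc'']; linarith
  have hdeg : T.degree < S.card * c'' := by
    have : (S.card : ℝ) * c'' = (S.card * c + T.degree) / 2 := by
      rw [hc'']; field_simp
    rw [this]; linarith
  -- the slice `τ ↦ V (v + τ w)` is `-∞` off `S`
  have h0 : ∀ σ ∈ S, ∃ C ε : ℝ, 0 < ε ∧ ∀ τ : ℂ, τ ≠ σ → ‖τ - σ‖ < ε →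
      T.pot (v + τ • w) ≤ ((c'' * Real.log ‖τ - σ‖ + C : ℝ) : EReal) := fun σ hσ ↦
    T.exists_pot_add_smul_le_of_mem_lelongSlopes hw
      (mem_lelongSlopes_of_lt_lelongNumber hc''0.le (hc''c.trans_le (hS σ hσ)))
  obtain ⟨A, R₀, hinf⟩ := T.exists_pot_add_smul_le hw hvw
  have hf_sub : IsSubharmonicOn (fun τ : ℂ ↦ T.pot (v + τ • w)) ((↑S : Set ℂ)ᶜ) :=
    (T.isPlurisubharmonicOn_pot.isSubharmonicOn_line v w).mono fun τ _ ↦ hvw τ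
  have hbot := hf_sub.eq_bot_of_growth_finset T.degree_nonneg hdeg h0 hinf
  -- hence `V ≡ -∞` on the punctured plane `P ∖ {0}`; first on the points `v + σ w`, all `σ`
  have hline : ∀ σ : ℂ, T.pot (v + σ • w) = ⊥ := by
    intro σ
    set p : Fin (N + 1) → ℂ := v + σ • w with hp
    have hpτ : ∀ τ : ℂ, p + τ • w = v + (σ + τ) • w := fun τ ↦ by
      rw [hp, add_smul, add_assoc]
    have hU : ∀ τ : ℂ, ‖τ‖ ≤ 1 → p + τ • w ∈ ({0}ᶜ : Set (Fin (N + 1) → ℂ)) := fun τ _ ↦ by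
      rw [hpτ]; exact hvw _
    have hsub := T.isPlurisubharmonicOn_pot.le_circleMean p w one_pos hU
    have hmean : circleMean (fun τ : ℂ ↦ T.pot (p + τ • w)) 0 1 = ⊥ := by
      refine circleMean_eq_bot_of_eq_bot_off_finite one_ne_zero
        (Tset := (fun σ' : ℂ ↦ σ' - σ) '' (↑S : Set ℂ)) ((S.finite_toSet).image _) ?_
      intro θ _ hθ
      show T.pot (p + circleMap 0 1 θ • w) = ⊥
      rw [hpτ]
      refine hbot _ fun hmem ↦ hθ ⟨σ + circleMap 0 1 θ, Finset.mem_coe.2 hmem, ?_⟩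
      show σ + circleMap 0 1 θ - σ = circleMap 0 1 θ
      ring
    have := hsub
    rw [hmean] at this
    exact le_bot_iff.1 this
  -- then on the points `b w`
  have hwbot : T.pot w = ⊥ := by
    have hwτ : ∀ τ : ℂ, w + τ • v ≠ 0 := by
      intro τ h
      rcases eq_or_ne τ 0 with rfl | hτ
      · rw [zero_smul, add_zero] at h; exact hw h
      · apply hvw τ⁻¹
        have h1 : τ • v = -w := eq_neg_of_add_eq_zero_right h
        calc v + τ⁻¹ • w = τ⁻¹ • (τ • v) + τ⁻¹ • w := by rw [inv_smul_smul₀ hτ]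
          _ = 0 := by rw [h1, smul_neg, neg_add_cancel]
    have hU : ∀ τ : ℂ, ‖τ‖ ≤ 1 → w + τ • v ∈ ({0}ᶜ : Set (Fin (N + 1) → ℂ)) := fun τ _ ↦ hwτ τ
    have hsub := T.isPlurisubharmonicOn_pot.le_circleMean w v one_pos hU
    have hmean : circleMean (fun τ : ℂ ↦ T.pot (w + τ • v)) 0 1 = ⊥ := by
      refine circleMean_eq_bot_of_eq_bot_off_finite one_ne_zero (Tset := {0})
        (Set.finite_singleton 0) ?_
      intro θ _ hθ
      have hτ0 : circleMap 0 1 θ ≠ 0 := hθ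
      show T.pot (w + circleMap 0 1 θ • v) = ⊥
      have hdec : w + circleMap 0 1 θ • v = circleMap 0 1 θ • (v + (circleMap 0 1 θ)⁻¹ • w) := by
        rw [smul_add, smul_inv_smul₀ hτ0]; exact add_comm _ _
      rw [hdec, T.pot_smul hτ0 (hvw _), hline, EReal.bot_add]
    have := hsub
    rw [hmean] at this
    exact le_bot_iff.1 this
  -- contradiction with the non-polarity of the plane
  obtain ⟨a, b, hab, hne⟩ := hP
  apply hne
  rcases eq_or_ne a 0 with rfl | ha
  · rw [zero_smul, zero_add] at hab ⊢
    have hb : b ≠ 0 := by rintro rfl; exact hab (zero_smul _ _)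
    rw [T.pot_smul hb hw, hwbot, EReal.bot_add]
  · have hdec : a • v + b • w = a • (v + (b / a) • w) := by
      rw [smul_add, smul_smul, mul_div_cancel₀ _ ha]
    rw [hdec, T.pot_smul ha (hvw _), hline, EReal.bot_add]

/-- **`E_c(T)` meets every non-polar projective line in finitely many points** (at most
`deg T / c` of them in the chart `σ ↦ [v + σ w]`, plus possibly `[w]`), for `c > 0`.
[cite: Siu1974, Main Theorem (restriction to lines)] -/
theorem finite_lelongUpperLevelSet_inter_line {v w : Fin (N + 1) → ℂ}
    (hvw : ∀ τ : ℂ, v + τ • w ≠ 0) (hw : w ≠ 0)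
    (hP : ∃ a b : ℂ, a • v + b • w ≠ 0 ∧ T.pot (a • v + b • w) ≠ ⊥) {c : ℝ} (hc : 0 < c) :
    {x | x ∈ T.lelongUpperLevelSet c ∧ ∃ a b : ℂ, ∃ h : a • v + b • w ≠ 0,
      x = Projectivization.mk ℂ (a • v + b • w) h}.Finite := by
  classical
  set Aset : Set ℂ := {σ | c ≤ Pluripotential.lelongNumber T.pot (v + σ • w)} with hAset
  have hA : Aset.Finite := by
    by_contra hinf
    obtain ⟨S, hS, hcard⟩ := Set.Infinite.exists_subset_card_eq hinf (⌊T.degree / c⌋₊ + 1)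
    have h1 := T.card_mul_le_degree_of_le_lelongNumber_line hvw hw hP S
      fun σ hσ ↦ hS (Finset.mem_coe.2 hσ)
    rw [hcard] at h1
    have h2 : T.degree / c < ((⌊T.degree / c⌋₊ + 1 : ℕ) : ℝ) := by
      push_cast
      exact Nat.lt_floor_add_one (T.degree / c)
    rw [div_lt_iff₀ hc] at h2
    linarith
  have hcover : {x | x ∈ T.lelongUpperLevelSet c ∧ ∃ a b : ℂ, ∃ h : a • v + b • w ≠ 0,
      x = Projectivization.mk ℂ (a • v + b • w) h} ⊆
      (fun σ : ℂ ↦ Projectivization.mk ℂ (v + σ • w) (hvw σ)) '' Aset ∪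
        {Projectivization.mk ℂ w hw} := by
    rintro x ⟨hx, a, b, hab, rfl⟩
    rw [mem_lelongUpperLevelSet_iff] at hx
    rcases eq_or_ne a 0 with rfl | ha
    · right
      have hb : b ≠ 0 := by rintro rfl; exact hab (by rw [zero_smul, zero_smul, add_zero])
      rw [mem_singleton_iff]
      exact (Projectivization.mk_eq_mk_iff' ℂ _ _ hab hw).2 ⟨b, by rw [zero_smul, zero_add]⟩
    · left
      have hdec : a • v + b • w = a • (v + (b / a) • w) := by
        rw [smul_add, smul_smul, mul_div_cancel₀ _ ha]
      refine ⟨b / a, ?_, ?_⟩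
      · show c ≤ Pluripotential.lelongNumber T.pot (v + (b / a) • w)
        have key := T.isLogHomogeneous_pot.lelongNumber_smul ha (hvw (b / a))
        rw [← hdec] at key
        rw [← key, ← T.lelongNumber_mk hab]; exact hx
      · exact (Projectivization.mk_eq_mk_iff' ℂ _ _ (hvw _) hab).2
          ⟨a⁻¹, by rw [hdec, smul_smul, inv_mul_cancel₀ ha, one_smul]⟩
  exact ((hA.image _).union (Set.finite_singleton _)).subset hcover

end Lines


/-! ### Reduction of Siu's theorem on `ℙᴺ` to the standard affine charts -/

section Charts

variable {N : ℕ} (T : ClosedPositiveOneOneCurrent N)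

/-- The chart image of `E_c(T)` in the `i`-th standard affine chart `w ↦ [w₀ : ⋯ : 1 : ⋯ : w_{N-1}]`
is the level set `{w | ν(V, (w₀, …, 1, …, w_{N-1})) ≥ c}` of the Lelong numbers of the cone
potential along the affine slice `{zᵢ = 1}`. [folklore] -/
theorem stdChartInv_mem_lelongUpperLevelSet_iff (i : Fin (N + 1)) (w : Fin N → ℂ) (c : ℝ) :
    Projectivization.stdChartInv i w ∈ T.lelongUpperLevelSet c ↔
      c ≤ Pluripotential.lelongNumber T.pot (Fin.insertNth i 1 w) := by
  rw [mem_lelongUpperLevelSet_iff, Projectivization.stdChartInv, T.lelongNumber_mk]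

/-- **Reduction to charts.** If for every standard affine chart `i` the level set
`{w ∈ ℂᴺ | ν(V, (w₀, …, 1ᵢ, …, w_{N-1})) ≥ c}` is an analytic subset of `ℂᴺ`, then `E_c(T)` is an
analytic subset of `ℙᴺ(ℂ)` (analyticity is local and the `N + 1` standard charts cover `ℙᴺ`;
`Literature.Geometry.Kaehler.IsAnalyticSetAt.of_inExtChart`). This reduces
`Siu1974_isAnalyticSet_lelongUpperLevelSet` to Siu's theorem for the `N + 1` plurisubharmonic
chart potentials on `ℂᴺ`. [cite: Siu1974, Main Theorem (local statement); folklore reduction] -/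
theorem isAnalyticSet_lelongUpperLevelSet_of_charts {c : ℝ}
    (h : ∀ i : Fin (N + 1), Literature.Geometry.Kaehler.IsAnalyticSet 𝓘(ℂ, Fin N → ℂ)
      {w : Fin N → ℂ | c ≤ Pluripotential.lelongNumber T.pot (Fin.insertNth i 1 w)}) :
    Literature.Geometry.Kaehler.IsAnalyticSet 𝓘(ℂ, Fin N → ℂ) (T.lelongUpperLevelSet c) := by
  haveI : IsManifold 𝓘(ℂ, Fin N → ℂ) ω (ℙ ℂ (Fin (N + 1) → ℂ)) :=
    Literature.NumberTheory.Transcendental.isManifold_projectivization_holds ℂ N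
  intro x
  refine Literature.Geometry.Kaehler.IsAnalyticSetAt.of_inExtChart (mem_extChartAt_source x) ?_
  set i : Fin (N + 1) := Classical.choose (Projectivization.exists_rep_apply_ne_zero x) with hi
  have hchart : chartAt (Fin N → ℂ) x = Projectivization.stdChart i := Projectivization.chartAt_eq x
  have hset : (extChartAt 𝓘(ℂ, Fin N → ℂ) x).target ∩
      (extChartAt 𝓘(ℂ, Fin N → ℂ) x).symm ⁻¹' (T.lelongUpperLevelSet c) =
        {w : Fin N → ℂ | c ≤ Pluripotential.lelongNumber T.pot (Fin.insertNth i 1 w)} := by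
    ext w
    simp only [extChartAt_target, extChartAt_coe_symm, hchart, modelWithCornersSelf_coe,
      modelWithCornersSelf_coe_symm, Set.range_id, Set.preimage_id, Set.inter_univ,
      Projectivization.stdChart_target, Set.mem_inter_iff, Set.mem_univ, true_and,
      Set.mem_preimage, Function.comp_apply, id_eq, Projectivization.stdChart_symm_apply,
      T.stdChartInv_mem_lelongUpperLevelSet_iff, Set.mem_setOf_eq]
  rw [hset]
  exact h i _

/-! #### Lelong numbers of the cone potential versus Lelong numbers of the chart potentials -/

/-- Sup norm of a vector with a zero inserted: `‖(u₀, …, 0ᵢ, …, u_{N-1})‖ = ‖u‖`. [folklore] -/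
theorem norm_insertNth_zero (i : Fin (N + 1)) (u : Fin N → ℂ) :
    ‖(Fin.insertNth i (0 : ℂ) u : Fin (N + 1) → ℂ)‖ = ‖u‖ := by
  refine le_antisymm ((pi_norm_le_iff_of_nonneg (norm_nonneg u)).2 fun k ↦ ?_)
    ((pi_norm_le_iff_of_nonneg (norm_nonneg _)).2 fun j ↦ ?_)
  · refine Fin.succAboveCases i ?_ (fun j ↦ ?_) k
    · rw [Fin.insertNth_apply_same, norm_zero]; exact norm_nonneg _
    · rw [Fin.insertNth_apply_succAbove]; exact norm_le_pi_norm u j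
  · have := norm_le_pi_norm (Fin.insertNth i (0 : ℂ) u : Fin (N + 1) → ℂ) (i.succAbove j)
    rwa [Fin.insertNth_apply_succAbove] at this

/-- The affine chart embedding `w ↦ (w₀, …, 1ᵢ, …, w_{N-1})` is an isometry for the sup norms.
[folklore] -/
theorem norm_insertNth_one_sub (i : Fin (N + 1)) (z w : Fin N → ℂ) :
    ‖(Fin.insertNth i (1 : ℂ) z : Fin (N + 1) → ℂ) - Fin.insertNth i (1 : ℂ) w‖ = ‖z - w‖ := by
  rw [← Fin.insertNth_sub, sub_self, norm_insertNth_zero]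

/-- A vector with `zᵢ ≠ 0` is `zᵢ` times the chart vector of its affine coordinates. [folklore] -/
theorem eq_smul_insertNth_one (i : Fin (N + 1)) {z : Fin (N + 1) → ℂ} (hz : z i ≠ 0) :
    z = z i • (Fin.insertNth i (1 : ℂ) (fun j ↦ z (i.succAbove j) / z i) : Fin (N + 1) → ℂ) := by
  funext k
  refine Fin.succAboveCases i ?_ (fun j ↦ ?_) k
  · simp
  · simp [mul_div_cancel₀ _ hz]

/-- A positive admissible Lelong slope forces the value `-∞` at the base point (general psh
version of `pot_eq_bot_of_lelongNumber_pos`). [folklore] -/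
theorem _root_.Literature.Analysis.Pluripotential.IsPlurisubharmonicOn.eq_bot_of_pos_mem_lelongSlopes
    {E : Type*} [NormedAddCommGroup E] [NormedSpace ℂ E] [Nontrivial E] {V : E → EReal}
    {Ω : Set E} (hV : IsPlurisubharmonicOn V Ω) {b : E} {γ : ℝ} (hγ0 : 0 < γ)
    (hγ : γ ∈ lelongSlopes V b) {ε₀ : ℝ} (hε₀ : 0 < ε₀) (hΩ : closedBall b ε₀ ⊆ Ω) : V b = ⊥ := by
  obtain ⟨-, C, hC⟩ := hγ
  obtain ⟨ε, hε, hεle, hball⟩ : ∃ ε > 0, ε ≤ ε₀ ∧ ∀ z : E, z ≠ b → ‖z - b‖ < ε →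
      V z ≤ ((γ * Real.log ‖z - b‖ + C : ℝ) : EReal) := by
    rw [eventually_nhdsWithin_iff, Metric.eventually_nhds_iff_ball] at hC
    obtain ⟨ε, hε, h⟩ := hC
    exact ⟨min ε ε₀, lt_min hε hε₀, min_le_right _ _,
      fun z hzb hz ↦ h z (mem_ball_iff_norm.2 (hz.trans_le (min_le_left _ _))) hzb⟩
  have hΩε : closedBall b ε ⊆ Ω := (closedBall_subset_closedBall hεle).trans hΩ
  by_contra hne
  have htop : V b ≠ ⊤ := (hV.lt_top (hΩ (mem_closedBall_self hε₀.le))).ne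
  set p : ℝ := (V b).toReal with hp
  have hp' : V b = (p : EReal) := (EReal.coe_toReal htop hne).symm
  set s : ℝ := min (ε / 2) (Real.exp ((p - C - 1) / γ)) with hs
  have hs0 : 0 < s := by positivity
  have hsε : s < ε := (min_le_left _ _).trans_lt (half_lt_self hε)
  have hbound : γ * Real.log s + C < p := by
    have hle : Real.log s ≤ (p - C - 1) / γ :=
      calc Real.log s ≤ Real.log (Real.exp ((p - C - 1) / γ)) :=
            Real.log_le_log hs0 (min_le_right _ _)
        _ = (p - C - 1) / γ := Real.log_exp _
    have := mul_le_mul_of_nonneg_left hle hγ0.le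
    rw [mul_div_cancel₀ _ hγ0.ne'] at this
    linarith
  have key : V b ≤ ((γ * Real.log s + C : ℝ) : EReal) :=
    (le_sSup (mem_image_of_mem V (mem_closedBall_self hs0.le))).trans
      (hV.sSup_image_closedBall_le_of_slope hγ0.le hΩε hball hs0 hsε)
  rw [hp', EReal.coe_le_coe_iff] at key
  exact (not_lt.2 key) hbound

/-- **The chart potentials are plurisubharmonic**: `gᵢ = V ∘ (w ↦ (w₀, …, 1ᵢ, …, w_{N-1}))` is psh
on all of `ℂᴺ` (its complex slices are complex slices of `V`, and the embedding is an isometry).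
[folklore] -/
theorem isPlurisubharmonicOn_pot_insertNth (i : Fin (N + 1)) :
    IsPlurisubharmonicOn (fun w : Fin N → ℂ ↦ T.pot (Fin.insertNth i 1 w)) univ := by
  have hιc : Continuous (fun w : Fin N → ℂ ↦ (Fin.insertNth i (1 : ℂ) w : Fin (N + 1) → ℂ)) := by
    fun_prop
  have hι0 : ∀ w : Fin N → ℂ, (Fin.insertNth i (1 : ℂ) w : Fin (N + 1) → ℂ) ∈
      ({0}ᶜ : Set (Fin (N + 1) → ℂ)) := fun w ↦ Projectivization.insertNth_one_ne_zero i w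
  refine ⟨?_, fun w _ ↦ T.pot_lt_top (hι0 w), fun z w ↦ ?_⟩
  · exact T.isPlurisubharmonicOn_pot.upperSemicontinuousOn.comp (t := univ) hιc.continuousOn
      fun w _ ↦ hι0 w
  · -- the slice `τ ↦ ι (z + τ w) = ι z + τ • insertNth i 0 w`
    have hslice : ∀ τ : ℂ, (Fin.insertNth i (1 : ℂ) (z + τ • w) : Fin (N + 1) → ℂ) =
        Fin.insertNth i (1 : ℂ) z + τ • (Fin.insertNth i (0 : ℂ) w : Fin (N + 1) → ℂ) := by
      intro τ
      funext k
      refine Fin.succAboveCases i ?_ (fun j ↦ ?_) k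
      · simp
      · simp
    have := T.isPlurisubharmonicOn_pot.isSubharmonicOn_line (Fin.insertNth i (1 : ℂ) z)
      (Fin.insertNth i (0 : ℂ) w)
    refine (this.mono fun τ _ ↦ ?_).congr fun τ _ ↦ ?_
    · show Fin.insertNth i (1 : ℂ) z + τ • Fin.insertNth i (0 : ℂ) w ∈ ({0}ᶜ : Set _)
      rw [← hslice]; exact hι0 _
    · show T.pot (Fin.insertNth i (1 : ℂ) z + τ • Fin.insertNth i (0 : ℂ) w) =
        T.pot (Fin.insertNth i 1 (z + τ • w))
      rw [hslice]


/-- The chart potentials inherit `≢ -∞` near every point from the cone potential: for every `w`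
there are points `u` arbitrarily close to `w` with `gᵢ(u) = V(ιᵢ u) ≠ -∞`. (So each `gᵢ` is a psh
function on `ℂᴺ`, not identically `-∞` near any point — the hypotheses of the local form of Siu's
theorem.) [folklore] -/
theorem frequently_pot_insertNth_ne_bot (i : Fin (N + 1)) (w : Fin N → ℂ) :
    ∃ᶠ u in 𝓝 w, T.pot (Fin.insertNth i 1 u) ≠ ⊥ := by
  intro hev
  -- `hev : ∀ᶠ u in 𝓝 w, ¬ (g u ≠ ⊥)`; transport to a neighbourhood of `v = ιᵢ w` in `ℂ^{N+1}`
  have hv0 : (Fin.insertNth i (1 : ℂ) w : Fin (N + 1) → ℂ) ≠ 0 :=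
    Projectivization.insertNth_one_ne_zero i w
  have hπc : ContinuousAt (fun y : Fin (N + 1) → ℂ ↦ fun j ↦ y (i.succAbove j) / y i)
      (Fin.insertNth i (1 : ℂ) w) := by
    refine continuousAt_pi.2 fun j ↦ ?_
    refine ((continuous_apply (i.succAbove j)).continuousAt).div
      ((continuous_apply i).continuousAt) ?_
    simp
  have hπv : (fun y : Fin (N + 1) → ℂ ↦ fun j ↦ y (i.succAbove j) / y i)
      (Fin.insertNth i (1 : ℂ) w) = w := by
    funext j; simp
  have h1 : ∀ᶠ y in 𝓝 (Fin.insertNth i (1 : ℂ) w : Fin (N + 1) → ℂ),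
      T.pot (Fin.insertNth i 1 (fun j ↦ y (i.succAbove j) / y i)) = ⊥ := by
    have := hπc.eventually (show ∀ᶠ u in 𝓝 ((fun y : Fin (N + 1) → ℂ ↦
        fun j ↦ y (i.succAbove j) / y i) (Fin.insertNth i (1 : ℂ) w)),
        ¬ (T.pot (Fin.insertNth i 1 u) ≠ ⊥) by rw [hπv]; exact hev)
    exact this.mono fun y hy ↦ not_ne_iff.1 hy
  have h2 : ∀ᶠ y in 𝓝 (Fin.insertNth i (1 : ℂ) w : Fin (N + 1) → ℂ), y i ≠ 0 :=
    (isOpen_ne.preimage (continuous_apply i)).eventually_mem (by simp)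
  have h3 : ∀ᶠ y in 𝓝 (Fin.insertNth i (1 : ℂ) w : Fin (N + 1) → ℂ), T.pot y = ⊥ := by
    filter_upwards [h1, h2] with y hy hyi
    rw [eq_smul_insertNth_one i hyi, T.pot_smul hyi (Projectivization.insertNth_one_ne_zero i _),
      hy, EReal.bot_add]
  exact (T.frequently_ne_bot _ hv0) (h3.mono fun y hy ↦ not_ne_iff.2 hy)

/-- **Lelong numbers may be computed in the affine charts**: for the cone potential `V` of `T`
(`N ≥ 1`) and the chart potential `gᵢ = V ∘ ιᵢ`, `ιᵢ(w) = (w₀, …, 1ᵢ, …, w_{N-1})`, the admissible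
Lelong slopes of `V` at `ιᵢ(w)` and of `gᵢ` at `w` coincide; hence `ν(V, ιᵢ w) = ν(gᵢ, w)`
(`= ν(T, [ιᵢ w])`). Off the slice one uses `V(z) = gᵢ(π z) + deg T · log |zᵢ|` with
`‖π z - w‖ ≤ 2 (1 + ‖w‖) ‖z - ιᵢ w‖. [cite: DangDoPham2025, §2.1 (ν is computed in local
coordinates); folklore] -/
theorem lelongSlopes_pot_insertNth (hN : 1 ≤ N) (i : Fin (N + 1)) (w : Fin N → ℂ) :
    lelongSlopes T.pot (Fin.insertNth i 1 w) =
      lelongSlopes (fun w' : Fin N → ℂ ↦ T.pot (Fin.insertNth i 1 w')) w := by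
  haveI : Nontrivial (Fin N → ℂ) := by
    haveI : Nonempty (Fin N) := ⟨⟨0, hN⟩⟩
    infer_instance
  have hv0 : (Fin.insertNth i (1 : ℂ) w : Fin (N + 1) → ℂ) ≠ 0 :=
    Projectivization.insertNth_one_ne_zero i w
  have hvi : (Fin.insertNth i (1 : ℂ) w : Fin (N + 1) → ℂ) i = 1 := by simp
  have hvj : ∀ j, (Fin.insertNth i (1 : ℂ) w : Fin (N + 1) → ℂ) (i.succAbove j) = w j :=
    fun j ↦ by simp
  ext γ
  constructor
  · -- from `V` to the chart potential (restriction)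
    rintro ⟨hγ0, C, hC⟩
    refine ⟨hγ0, C, ?_⟩
    have htend : Tendsto (fun u : Fin N → ℂ ↦ (Fin.insertNth i (1 : ℂ) u : Fin (N + 1) → ℂ))
        (𝓝[≠] w) (𝓝[≠] (Fin.insertNth i (1 : ℂ) w)) := by
      refine tendsto_nhdsWithin_of_tendsto_nhds_of_eventually_within _ ?_ ?_
      · have hc : Continuous (fun u : Fin N → ℂ ↦ (Fin.insertNth i (1 : ℂ) u : Fin (N + 1) → ℂ)) := by
          fun_prop
        exact (hc.continuousAt (x := w)).mono_left nhdsWithin_le_nhds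
      · refine eventually_nhdsWithin_of_forall fun u hu h ↦ hu ?_
        have : (Fin.insertNth i (1 : ℂ) u : Fin (N + 1) → ℂ) = Fin.insertNth i (1 : ℂ) w :=
          mem_singleton_iff.1 h
        funext j
        have hj := congrFun this (i.succAbove j)
        simpa using hj
    filter_upwards [htend.eventually hC] with u hu
    rwa [norm_insertNth_one_sub] at hu
  · -- from the chart potential to `V`
    rintro ⟨hγ0, C, hC⟩
    rcases hγ0.eq_or_lt with rfl | hγpos
    · -- `γ = 0`: `V` is bounded above near `v`
      obtain ⟨C', hvC, -⟩ := EReal.lt_iff_exists_real_btwn.1 (T.pot_lt_top hv0)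
      have h1 : ∀ᶠ y in 𝓝[({0}ᶜ : Set (Fin (N + 1) → ℂ))] (Fin.insertNth i (1 : ℂ) w),
          T.pot y < (C' : EReal) :=
        T.isPlurisubharmonicOn_pot.upperSemicontinuousOn _ hv0 _ hvC
      have h2 : ({0}ᶜ : Set (Fin (N + 1) → ℂ)) ∈ 𝓝 (Fin.insertNth i (1 : ℂ) w : Fin (N + 1) → ℂ) :=
        isOpen_compl_singleton.mem_nhds hv0
      rw [nhdsWithin_eq_nhds.2 h2] at h1
      exact zero_mem_lelongSlopes (C := C')
        ((h1.mono fun y hy ↦ hy.le).filter_mono nhdsWithin_le_nhds)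
    · -- `γ > 0`: first `g w = V v = ⊥`
      have hg := T.isPlurisubharmonicOn_pot_insertNth i
      have hgw : T.pot (Fin.insertNth i (1 : ℂ) w) = ⊥ :=
        hg.eq_bot_of_pos_mem_lelongSlopes hγpos ⟨hγ0, C, hC⟩ one_pos (subset_univ _)
      -- ε-ball form of the chart slope
      obtain ⟨ε, hε, hball⟩ : ∃ ε > 0, ∀ u : Fin N → ℂ, u ≠ w → ‖u - w‖ < ε →
          T.pot (Fin.insertNth i 1 u) ≤ ((γ * Real.log ‖u - w‖ + C : ℝ) : EReal) := by
        rw [eventually_nhdsWithin_iff, Metric.eventually_nhds_iff_ball] at hC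
        obtain ⟨ε, hε, h⟩ := hC
        exact ⟨ε, hε, fun u huw hu ↦ h u (mem_ball_iff_norm.2 hu) huw⟩
      -- constants
      set K : ℝ := 2 * (1 + ‖w‖) with hK
      have hK0 : 0 < K := by positivity
      set C' : ℝ := C + γ * Real.log K + T.degree * Real.log 2 with hC'
      refine ⟨hγ0, C', ?_⟩
      set δ : ℝ := min (1 / 2) (ε / K) with hδ
      have hδ0 : 0 < δ := lt_min one_half_pos (div_pos hε hK0)
      have hballv : ∀ᶠ z in 𝓝 (Fin.insertNth i (1 : ℂ) w : Fin (N + 1) → ℂ),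
          z ∈ ball (Fin.insertNth i (1 : ℂ) w : Fin (N + 1) → ℂ) δ := ball_mem_nhds _ hδ0
      filter_upwards [self_mem_nhdsWithin, mem_nhdsWithin_of_mem_nhds hballv] with z hzv hz
      have hzδ : ‖z - Fin.insertNth i (1 : ℂ) w‖ < δ := mem_ball_iff_norm.1 hz
      have hz12 : ‖z - Fin.insertNth i (1 : ℂ) w‖ < 1 / 2 := hzδ.trans_le (min_le_left _ _)
      have hzε : ‖z - Fin.insertNth i (1 : ℂ) w‖ < ε / K := hzδ.trans_le (min_le_right _ _)
      -- the `i`-th coordinate of `z` is close to `1`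
      have hzi1 : ‖z i - 1‖ ≤ ‖z - Fin.insertNth i (1 : ℂ) w‖ := by
        have := norm_le_pi_norm (z - Fin.insertNth i (1 : ℂ) w) i
        rwa [Pi.sub_apply, hvi] at this
      have hzi : z i ≠ 0 := by
        intro h
        rw [h, zero_sub, norm_neg, norm_one] at hzi1
        linarith
      have hzi_ge : 1 / 2 ≤ ‖z i‖ := by
        have := norm_sub_norm_le (1 : ℂ) (1 - z i)
        rw [sub_sub_cancel, norm_one, ← norm_neg (1 - z i), neg_sub] at this
        linarith
      have hzi_le : ‖z i‖ ≤ 2 := by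
        have := norm_add_le (z i - 1) 1
        rw [sub_add_cancel, norm_one] at this
        linarith
      have hzi_pos : 0 < ‖z i‖ := lt_of_lt_of_le one_half_pos hzi_ge
      -- affine coordinates of `z`
      set u : Fin N → ℂ := fun j ↦ z (i.succAbove j) / z i with hu
      have hzu : z = z i • (Fin.insertNth i (1 : ℂ) u : Fin (N + 1) → ℂ) :=
        eq_smul_insertNth_one i hzi
      have hVz : T.pot z = T.pot (Fin.insertNth i (1 : ℂ) u) +
          ((T.degree * Real.log ‖z i‖ : ℝ) : EReal) := by
        conv_lhs => rw [hzu]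
        exact T.pot_smul hzi (Projectivization.insertNth_one_ne_zero i u)
      -- `‖u - w‖ ≤ K ‖z - v‖`
      have huw : ‖u - w‖ ≤ K * ‖z - Fin.insertNth i (1 : ℂ) w‖ := by
        refine (pi_norm_le_iff_of_nonneg (by positivity)).2 fun j ↦ ?_
        have hj : (u - w) j = (z (i.succAbove j) - w j - (z i - 1) * w j) / z i := by
          simp only [Pi.sub_apply, hu]
          field_simp
          ring
        rw [hj, norm_div]
        have h1 : ‖z (i.succAbove j) - w j‖ ≤ ‖z - Fin.insertNth i (1 : ℂ) w‖ := by
          have := norm_le_pi_norm (z - Fin.insertNth i (1 : ℂ) w) (i.succAbove j)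
          rwa [Pi.sub_apply, hvj] at this
        have h2 : ‖(z i - 1) * w j‖ ≤ ‖z - Fin.insertNth i (1 : ℂ) w‖ * ‖w‖ := by
          rw [norm_mul]
          exact mul_le_mul hzi1 (norm_le_pi_norm w j) (norm_nonneg _) (norm_nonneg _)
        have h3 : ‖z (i.succAbove j) - w j - (z i - 1) * w j‖ ≤
            ‖z - Fin.insertNth i (1 : ℂ) w‖ * (1 + ‖w‖) := by
          refine (norm_sub_le _ _).trans ?_
          linarith
        rw [div_le_iff₀ hzi_pos, hK]
        calc ‖z (i.succAbove j) - w j - (z i - 1) * w j‖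
            ≤ ‖z - Fin.insertNth i (1 : ℂ) w‖ * (1 + ‖w‖) := h3
          _ = 2 * (1 + ‖w‖) * ‖z - Fin.insertNth i (1 : ℂ) w‖ * (1 / 2) := by ring
          _ ≤ 2 * (1 + ‖w‖) * ‖z - Fin.insertNth i (1 : ℂ) w‖ * ‖z i‖ := by gcongr
      rcases eq_or_ne u w with huw' | huw'
      · -- on the line through the vertex: `V z = V v + c log |z i| = -∞`
        rw [hVz, huw', hgw, EReal.bot_add]
        exact bot_le
      · have hKz : K * ‖z - Fin.insertNth i (1 : ℂ) w‖ < ε := by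
          have := (lt_div_iff₀ hK0).1 hzε
          linarith [mul_comm K ‖z - Fin.insertNth i (1 : ℂ) w‖]
        have huwε : ‖u - w‖ < ε := huw.trans_lt hKz
        have hgu := hball u huw' huwε
        have hpos_zv : 0 < ‖z - Fin.insertNth i (1 : ℂ) w‖ := norm_pos_iff.2 (sub_ne_zero.2 hzv)
        have hpos_uw : 0 < ‖u - w‖ := norm_pos_iff.2 (sub_ne_zero.2 huw')
        have hlog1 : Real.log ‖u - w‖ ≤ Real.log ‖z - Fin.insertNth i (1 : ℂ) w‖ + Real.log K := by
          rw [← Real.log_mul hpos_zv.ne' hK0.ne']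
          refine Real.log_le_log hpos_uw ?_
          linarith [mul_comm K ‖z - Fin.insertNth i (1 : ℂ) w‖]
        have hlog2 : Real.log ‖z i‖ ≤ Real.log 2 := Real.log_le_log hzi_pos hzi_le
        rw [hVz]
        calc T.pot (Fin.insertNth i (1 : ℂ) u) + ((T.degree * Real.log ‖z i‖ : ℝ) : EReal)
            ≤ ((γ * Real.log ‖u - w‖ + C : ℝ) : EReal) +
                ((T.degree * Real.log ‖z i‖ : ℝ) : EReal) := add_le_add hgu le_rfl
          _ ≤ ((γ * Real.log ‖z - Fin.insertNth i (1 : ℂ) w‖ + C' : ℝ) : EReal) := by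
              rw [← EReal.coe_add, EReal.coe_le_coe_iff, hC']
              have e1 := mul_le_mul_of_nonneg_left hlog1 hγ0
              have e2 := mul_le_mul_of_nonneg_left hlog2 T.degree_nonneg
              rw [mul_add] at e1
              linarith

/-- **`ν(T, x)` in charts**: `ν(V, ιᵢ w) = ν(gᵢ, w)` for the chart potential `gᵢ = V ∘ ιᵢ`
(`N ≥ 1`). [cite: DangDoPham2025, §2.1; folklore] -/
theorem lelongNumber_pot_insertNth (hN : 1 ≤ N) (i : Fin (N + 1)) (w : Fin N → ℂ) :
    Pluripotential.lelongNumber T.pot (Fin.insertNth i 1 w) =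
      Pluripotential.lelongNumber (fun w' : Fin N → ℂ ↦ T.pot (Fin.insertNth i 1 w')) w := by
  rw [lelongNumber_eq_sSup, lelongNumber_eq_sSup, T.lelongSlopes_pot_insertNth hN i w]

/-- **Reduction of Siu's theorem on `ℙᴺ` to the chart potentials** (`N ≥ 1`): if for every
standard chart `i` the Lelong upper level set `{w ∈ ℂᴺ | ν(gᵢ, w) ≥ c}` of the plurisubharmonic
chart potential `gᵢ = V ∘ ιᵢ` on `ℂᴺ` (`isPlurisubharmonicOn_pot_insertNth`) is analytic, then
`E_c(T)` is an analytic subset of `ℙᴺ(ℂ)`. Thus `Siu1974_isAnalyticSet_lelongUpperLevelSet`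
follows from Siu's theorem for psh functions on `ℂᴺ` applied to the `N + 1` functions `gᵢ`
(for `N = 0`, `ℙ⁰` is a point). [cite: Siu1974, Main Theorem (local statement); folklore] -/
theorem isAnalyticSet_lelongUpperLevelSet_of_chartPotentials (hN : 1 ≤ N) {c : ℝ}
    (h : ∀ i : Fin (N + 1), Literature.Geometry.Kaehler.IsAnalyticSet 𝓘(ℂ, Fin N → ℂ)
      {w : Fin N → ℂ | c ≤ Pluripotential.lelongNumber
        (fun w' : Fin N → ℂ ↦ T.pot (Fin.insertNth i 1 w')) w}) :
    Literature.Geometry.Kaehler.IsAnalyticSet 𝓘(ℂ, Fin N → ℂ) (T.lelongUpperLevelSet c) := by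
  refine T.isAnalyticSet_lelongUpperLevelSet_of_charts fun i ↦ ?_
  have hset : {w : Fin N → ℂ | c ≤ Pluripotential.lelongNumber T.pot (Fin.insertNth i 1 w)} =
      {w : Fin N → ℂ | c ≤ Pluripotential.lelongNumber
        (fun w' : Fin N → ℂ ↦ T.pot (Fin.insertNth i 1 w')) w} := by
    ext w
    rw [mem_setOf_eq, mem_setOf_eq, T.lelongNumber_pot_insertNth hN i w]
  rw [hset]
  exact h i

end Charts

end ClosedPositiveOneOneCurrent

/-! ## Algebraic logarithmic potentials

Towards Siu's theorem for the currents `T = (c/d) [F = 0]` with cone potential `(c/d) log |F|`,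
`F` a homogeneous polynomial of degree `d`: `log |F|` is plurisubharmonic (this section), its
Lelong numbers are orders of vanishing, and the level sets of the order of vanishing are
algebraic. Throughout, `log |x|` is the `[-∞, +∞]`-valued `ENNReal.log ‖x‖ₑ` (`= -∞` at `x = 0`). -/

section LogPoly

open Polynomial

/-- `log ‖x‖ₑ = log ‖x‖` for `x ≠ 0`. [folklore] -/
theorem log_enorm_eq_coe {F : Type*} [NormedAddCommGroup F] {x : F} (hx : x ≠ 0) :
    ENNReal.log ‖x‖ₑ = ((Real.log ‖x‖ : ℝ) : EReal) := by
  rw [← ofReal_norm, ENNReal.log_ofReal_of_pos (norm_pos_iff.2 hx)]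

/-- Circle means only depend on the values at almost every parameter. [folklore] -/
theorem circleMean_congr_ae {g₁ g₂ : ℂ → EReal} {c : ℂ} {R : ℝ}
    (h : ∀ᵐ θ ∂(volume.restrict (Ioc (0 : ℝ) (2 * Real.pi))),
      g₁ (circleMap c R θ) = g₂ (circleMap c R θ)) :
    circleMean g₁ c R = circleMean g₂ c R := by
  have hup : circleUpperMean g₁ c R = circleUpperMean g₂ c R := by
    unfold circleUpperMean
    congr 1
    exact lintegral_congr_ae (h.mono fun θ hθ ↦ by simp only [hθ])
  have hlo : circleLowerMean g₁ c R = circleLowerMean g₂ c R := by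
    unfold circleLowerMean
    congr 1
    exact lintegral_congr_ae (h.mono fun θ hθ ↦ by simp only [hθ])
  rw [circleMean_def, circleMean_def, hup, hlo]

/-- For almost every parameter the point of the circle avoids a given finite set. [folklore] -/
theorem ae_circleMap_notMem {c : ℂ} {R : ℝ} (hR : R ≠ 0) {Tset : Set ℂ} (hT : Tset.Finite) :
    ∀ᵐ θ ∂(volume.restrict (Ioc (0 : ℝ) (2 * Real.pi))), circleMap c R θ ∉ Tset := by
  have hpi : 0 < 2 * Real.pi := by positivity
  set A : Set ℝ := Ioc (0 : ℝ) (2 * Real.pi) ∩ (circleMap c R) ⁻¹' Tset with hA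
  have hAfin : A.Finite := by
    refine Set.Finite.of_finite_image (f := circleMap c R) (hT.subset ?_) ?_
    · rintro _ ⟨θ, hθ, rfl⟩
      exact hθ.2
    · have hinj := injOn_circleMap_of_abs_sub_le (c := c) (a := 0) (b := 2 * Real.pi) hR
        (by rw [zero_sub, abs_neg, abs_of_pos hpi])
      rw [Set.uIoc_of_le hpi.le] at hinj
      exact hinj.mono inter_subset_left
  have hA0 : volume A = 0 := hAfin.measure_zero volume
  rw [ae_restrict_iff' measurableSet_Ioc]
  have hA' : ∀ᵐ θ ∂(volume : Measure ℝ), θ ∉ A := by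
    rw [ae_iff]
    simpa only [not_not, setOf_mem_eq] using hA0
  filter_upwards [hA'] with θ hθA hθ h
  exact hθA ⟨hθ, h⟩

/-- **`log |τ - r|` is subharmonic on `ℂ`** (value `-∞` at `r`): continuous into `[-∞, +∞]`,
and the mean over a circle about `c ≠ r` is `log R + log⁺(|c - r|/R) ≥ log |c - r|`.
[cite: HormanderSCV1973, Thm. 1.6.2 and Cor. 1.6.6] -/
theorem isSubharmonicOn_log_enorm_sub (r : ℂ) :
    IsSubharmonicOn (fun τ : ℂ ↦ ENNReal.log ‖τ - r‖ₑ) univ := by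
  refine ⟨?_, fun τ _ ↦ ENNReal.log_lt_top_iff.2 enorm_lt_top, fun c R hR _ ↦ ?_⟩
  · have hc : Continuous fun τ : ℂ ↦ ENNReal.log ‖τ - r‖ₑ :=
      ENNReal.continuous_log.comp (continuous_enorm.comp (continuous_id.sub continuous_const))
    exact upperSemicontinuousOn_of_continuousOn hc.continuousOn
  · rcases eq_or_ne c r with rfl | hcr
    · simp only [sub_self, enorm_zero, ENNReal.log_zero]
      exact bot_le
    · have hae : ∀ᵐ θ ∂(volume.restrict (Ioc (0 : ℝ) (2 * Real.pi))),
          ENNReal.log ‖circleMap c R θ - r‖ₑ =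
            ((Real.log ‖circleMap c R θ - r‖ : ℝ) : EReal) := by
        filter_upwards [ae_circleMap_notMem hR.ne' (Set.finite_singleton r)] with θ hθ
        exact log_enorm_eq_coe (sub_ne_zero.2 hθ)
      have hint : CircleIntegrable (fun τ : ℂ ↦ Real.log ‖τ - r‖) c R :=
        MeromorphicOn.circleIntegrable_log_norm (fun _ _ ↦ by fun_prop)
      show ENNReal.log ‖c - r‖ₑ ≤ _
      rw [circleMean_congr_ae (g₂ := fun τ ↦ ((Real.log ‖τ - r‖ : ℝ) : EReal)) hae,
        circleMean_coe_eq_circleAverage _ c R hint,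
        log_enorm_eq_coe (sub_ne_zero.2 hcr), EReal.coe_le_coe_iff,
        circleAverage_log_norm_sub_const_eq_log_radius_add_posLog hR.ne']
      have hpos : 0 < ‖c - r‖ := norm_pos_iff.2 (sub_ne_zero.2 hcr)
      calc Real.log ‖c - r‖ = Real.log R + Real.log (R⁻¹ * ‖c - r‖) := by
            rw [Real.log_mul (inv_ne_zero hR.ne') hpos.ne', Real.log_inv]; ring
        _ ≤ Real.log R + Real.posLog (R⁻¹ * ‖c - r‖) := by
            gcongr
            rw [Real.posLog_apply]
            exact le_max_right _ _

/-- `log |a|` (a constant) is subharmonic: a real constant, or `≡ -∞` for `a = 0`. [folklore] -/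
theorem isSubharmonicOn_log_enorm_const (a : ℂ) (U : Set ℂ) :
    IsSubharmonicOn (fun _ : ℂ ↦ ENNReal.log ‖a‖ₑ) U := by
  rcases eq_or_ne a 0 with rfl | ha
  · simp only [enorm_zero, ENNReal.log_zero]
    exact isSubharmonicOn_bot U
  · rw [log_enorm_eq_coe ha]
    exact isSubharmonicOn_const _ U

/-- **`log |p|` is subharmonic on `ℂ` for every complex polynomial `p`**: factor `p` over `ℂ` and
add up the subharmonic functions `log |τ - r|` over the roots (`log` of a product is the sum, in
`[-∞, +∞)`). [cite: HormanderSCV1973, Cor. 1.6.6 (log |f| is subharmonic for holomorphic f)] -/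
theorem isSubharmonicOn_log_enorm_polynomial_eval (p : ℂ[X]) :
    IsSubharmonicOn (fun τ : ℂ ↦ ENNReal.log ‖p.eval τ‖ₑ) univ := by
  have key : ∀ (s : Multiset ℂ) (a : ℂ),
      IsSubharmonicOn (fun τ : ℂ ↦ ENNReal.log ‖(C a * (s.map fun r ↦ X - C r).prod).eval τ‖ₑ)
        univ := by
    intro s a
    induction s using Multiset.induction_on with
    | empty =>
      simpa using isSubharmonicOn_log_enorm_const a univ
    | cons r s ih =>
      have hfun : (fun τ : ℂ ↦ ENNReal.log
          ‖(C a * ((r ::ₘ s).map fun r ↦ X - C r).prod).eval τ‖ₑ) =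
          (fun τ : ℂ ↦ ENNReal.log ‖τ - r‖ₑ) +
            fun τ : ℂ ↦ ENNReal.log ‖(C a * (s.map fun r ↦ X - C r).prod).eval τ‖ₑ := by
        funext τ
        simp only [Multiset.map_cons, Multiset.prod_cons, Pi.add_apply, eval_mul, eval_sub, eval_X,
          eval_C]
        rw [← mul_assoc, mul_comm a (τ - r), mul_assoc, enorm_mul, ENNReal.log_mul_add]
      rw [hfun]
      exact (isSubharmonicOn_log_enorm_sub r).add ih
  have hp : p = C p.leadingCoeff * (p.roots.map fun a ↦ X - C a).prod :=
    (IsAlgClosed.splits p).eq_prod_roots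
  have := key p.roots p.leadingCoeff
  rwa [← hp] at this

/-- The restriction of a polynomial in several variables to a complex line `z + ℂ w` is the
one-variable polynomial obtained by substituting `Xᵢ ↦ zᵢ + wᵢ X`. [folklore] -/
theorem mvPolynomial_eval_add_smul {σ : Type*} (g : MvPolynomial σ ℂ) (z w : σ → ℂ) (τ : ℂ) :
    MvPolynomial.eval (z + τ • w) g =
      (MvPolynomial.aeval (fun i ↦ Polynomial.C (z i) + Polynomial.C (w i) * Polynomial.X) g).eval
        τ := by
  induction g using MvPolynomial.induction_on with
  | C a => simp
  | add p q hp hq => simp [hp, hq]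
  | mul_X p i hp =>
    simp [hp, mul_comm τ]

/-- **`log |g|` is plurisubharmonic on `ℂᴺ` for every polynomial `g` in `N` variables**: it is
continuous into `[-∞, +∞]` and its restrictions to complex lines are `log |p|` for one-variable
polynomials `p`. [cite: HormanderSCV1973, Cor. 1.6.6 and §2.6 (log |f| is psh for holomorphic f)] -/
theorem isPlurisubharmonicOn_log_enorm_mvPolynomial_eval {N : ℕ} (g : MvPolynomial (Fin N) ℂ) :
    IsPlurisubharmonicOn (fun z : Fin N → ℂ ↦ ENNReal.log ‖MvPolynomial.eval z g‖ₑ) univ := by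
  refine ⟨?_, fun z _ ↦ ENNReal.log_lt_top_iff.2 enorm_lt_top, fun z w ↦ ?_⟩
  · have hc : Continuous fun z : Fin N → ℂ ↦ ENNReal.log ‖MvPolynomial.eval z g‖ₑ :=
      ENNReal.continuous_log.comp (continuous_enorm.comp (MvPolynomial.continuous_eval g))
    exact upperSemicontinuousOn_of_continuousOn hc.continuousOn
  · have h := isSubharmonicOn_log_enorm_polynomial_eval
      (MvPolynomial.aeval (fun i ↦ Polynomial.C (z i) + Polynomial.C (w i) * Polynomial.X) g)
    refine (h.mono (subset_univ _)).congr fun τ _ ↦ ?_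
    simp only [mvPolynomial_eval_add_smul]

/-- Non-negative real multiples of psh functions are psh (with `a · (-∞) = -∞` for `a > 0` and
`0 · (-∞) = 0`). [cite: HormanderSCV1973, Thm. 1.6.2] -/
theorem IsPlurisubharmonicOn.const_mul {E : Type*} [NormedAddCommGroup E] [NormedSpace ℂ E]
    {V : E → EReal} {Ω : Set E} (hV : IsPlurisubharmonicOn V Ω) {a : ℝ} (ha : 0 ≤ a) :
    IsPlurisubharmonicOn (fun z ↦ (a : EReal) * V z) Ω := by
  rcases ha.eq_or_lt with rfl | ha'
  · simp only [EReal.coe_zero, zero_mul]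
    exact isPlurisubharmonicOn_const 0 Ω
  refine ⟨fun x hx ↦ ?_, fun z hz ↦ coe_mul_lt_top_of_pos ha' (hV.lt_top hz), fun z w ↦ ?_⟩
  · exact (continuous_coe_mul_left ha'.ne').continuousAt.comp_upperSemicontinuousWithinAt
      (hV.upperSemicontinuousOn x hx) (monotone_coe_mul_left ha'.le)
  · exact (hV.isSubharmonicOn_line z w).const_mul ha'.le

end LogPoly

/-! ### Lelong numbers of `log |g|` are orders of vanishing (Hörmander, Cor. 4.1.18) -/

section VanishingOrder

open MvPolynomial

variable {N : ℕ}

/-- The shifted polynomial `g(X + w)`: `eval h (g(X + w)) = g(h + w)`. [folklore] -/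
theorem eval_aeval_X_add_C (g : MvPolynomial (Fin N) ℂ) (w h : Fin N → ℂ) :
    eval h (aeval (fun i ↦ X i + C (w i)) g) = eval (h + w) g := by
  induction g using MvPolynomial.induction_on with
  | C a => simp only [aeval_C, algebraMap_eq, eval_C]
  | add p q hp hq => simp only [map_add, hp, hq]
  | mul_X p i hp => simp only [map_mul, hp, aeval_X, map_add, eval_X, eval_C, Pi.add_apply]

/-- The shift of a non-zero polynomial is non-zero. [folklore] -/
theorem aeval_X_add_C_ne_zero {g : MvPolynomial (Fin N) ℂ} (hg : g ≠ 0) (w : Fin N → ℂ) :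
    aeval (fun i ↦ X i + C (w i)) g ≠ 0 := by
  intro h
  apply hg
  refine MvPolynomial.funext fun z ↦ ?_
  have := eval_aeval_X_add_C g w (z - w)
  rw [h, map_zero, sub_add_cancel] at this
  rw [← this, map_zero]

/-- **Expansion along a complex line by homogeneous components**: with `g_w = g(X + w)` and its
homogeneous components `H_j`, `g(w + τ y) = Σ_j τ^j H_j(y)`. [folklore] -/
theorem eval_add_smul_eq_sum_homogeneousComponent (g : MvPolynomial (Fin N) ℂ) (w y : Fin N → ℂ)
    (τ : ℂ) :
    eval (w + τ • y) g =
      ∑ j ∈ Finset.range ((aeval (fun i ↦ X i + C (w i)) g).totalDegree + 1),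
        τ ^ j * eval y (homogeneousComponent j (aeval (fun i ↦ X i + C (w i)) g)) := by
  set gw := aeval (fun i ↦ X i + C (w i)) g with hgw
  have h1 : eval (w + τ • y) g = eval (τ • y) gw := by rw [eval_aeval_X_add_C, add_comm]
  rw [h1]
  conv_lhs => rw [← sum_homogeneousComponent gw]
  rw [map_sum]
  refine Finset.sum_congr rfl fun j _ ↦ ?_
  exact Projectivization.eval_smul_of_isHomogeneous (homogeneousComponent_isHomogeneous j gw) τ y

/-- Evaluation at `0` of a homogeneous polynomial of positive degree vanishes. [folklore] -/
theorem eval_zero_of_isHomogeneous {F : MvPolynomial (Fin N) ℂ} {d : ℕ} (hF : F.IsHomogeneous d)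
    (hd : 0 < d) : eval (0 : Fin N → ℂ) F = 0 := by
  have := Projectivization.eval_smul_of_isHomogeneous hF (0 : ℂ) (0 : Fin N → ℂ)
  rwa [zero_smul, zero_pow hd.ne', zero_mul] at this

/-- **Upper bound from vanishing homogeneous components**: if the components `H_j`, `j < k`, of
`g(X + w)` vanish, then `|g(w + h)| ≤ C ‖h‖^k` for `‖h‖ ≤ 1`. [folklore] -/
theorem norm_eval_le_of_homogeneousComponent_eq_zero (g : MvPolynomial (Fin N) ℂ) (w : Fin N → ℂ)
    {k : ℕ} (hk : ∀ j < k, homogeneousComponent j (aeval (fun i ↦ X i + C (w i)) g) = 0) :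
    ∃ Cst : ℝ, 0 < Cst ∧ ∀ h : Fin N → ℂ, ‖h‖ ≤ 1 → ‖eval (w + h) g‖ ≤ Cst * ‖h‖ ^ k := by
  set gw := aeval (fun i ↦ X i + C (w i)) g with hgw
  set T := gw.totalDegree with hT
  -- bounds of the homogeneous components on the unit ball
  have hM : ∀ j, ∃ M : ℝ, 0 ≤ M ∧ ∀ v : Fin N → ℂ, ‖v‖ ≤ 1 →
      ‖eval v (homogeneousComponent j gw)‖ ≤ M := by
    intro j
    obtain ⟨M, hM⟩ := (isCompact_closedBall (0 : Fin N → ℂ) 1).exists_bound_of_continuousOn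
      ((MvPolynomial.continuous_eval (homogeneousComponent j gw)).continuousOn)
    exact ⟨max M 0, le_max_right _ _, fun v hv ↦
      (hM v (mem_closedBall_zero_iff.2 hv)).trans (le_max_left _ _)⟩
  choose M hM0 hMb using hM
  refine ⟨(∑ j ∈ Finset.range (T + 1), M j) + 1,
    add_pos_of_nonneg_of_pos (Finset.sum_nonneg fun j _ ↦ hM0 j) one_pos, fun h hh ↦ ?_⟩
  have hexp : eval (w + h) g = ∑ j ∈ Finset.range (T + 1), eval h (homogeneousComponent j gw) := by
    have := eval_add_smul_eq_sum_homogeneousComponent g w h 1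
    simp only [one_smul, one_pow, one_mul] at this
    exact this
  have hterm : ∀ j ∈ Finset.range (T + 1),
      ‖eval h (homogeneousComponent j gw)‖ ≤ M j * ‖h‖ ^ k := by
    intro j _
    by_cases hjk : j < k
    · rw [hk j hjk, map_zero, norm_zero]; exact mul_nonneg (hM0 j) (by positivity)
    · push Not at hjk
      rcases eq_or_ne h 0 with rfl | hh0
      · rcases Nat.eq_zero_or_pos j with rfl | hjpos
        · have hk0 : k = 0 := Nat.le_zero.1 hjk
          subst hk0
          rw [pow_zero, mul_one]
          exact hMb 0 0 (by simp)
        · rw [eval_zero_of_isHomogeneous (homogeneousComponent_isHomogeneous j gw) hjpos, norm_zero]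
          exact mul_nonneg (hM0 j) (by positivity)
      · have hnpos : 0 < ‖h‖ := norm_pos_iff.2 hh0
        have hnC : ((‖h‖ : ℝ) : ℂ) ≠ 0 := by exact_mod_cast hnpos.ne'
        have hdecomp : h = ((‖h‖ : ℝ) : ℂ) • (((‖h‖ : ℝ) : ℂ)⁻¹ • h) := by
          rw [smul_smul, mul_inv_cancel₀ hnC, one_smul]
        have hunit : ‖((‖h‖ : ℝ) : ℂ)⁻¹ • h‖ ≤ 1 := by
          rw [norm_smul, norm_inv, Complex.norm_real, Real.norm_eq_abs, abs_of_pos hnpos,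
            inv_mul_cancel₀ hnpos.ne']
        conv_lhs => rw [hdecomp]
        rw [Projectivization.eval_smul_of_isHomogeneous (homogeneousComponent_isHomogeneous j gw),
          norm_mul, norm_pow, Complex.norm_real, Real.norm_eq_abs, abs_of_pos hnpos, mul_comm]
        exact mul_le_mul (hMb j _ hunit) (pow_le_pow_of_le_one hnpos.le hh hjk) (by positivity)
          (hM0 j)
  calc ‖eval (w + h) g‖ = ‖∑ j ∈ Finset.range (T + 1), eval h (homogeneousComponent j gw)‖ := by
        rw [hexp]
    _ ≤ ∑ j ∈ Finset.range (T + 1), ‖eval h (homogeneousComponent j gw)‖ := norm_sum_le _ _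
    _ ≤ ∑ j ∈ Finset.range (T + 1), M j * ‖h‖ ^ k := Finset.sum_le_sum hterm
    _ = (∑ j ∈ Finset.range (T + 1), M j) * ‖h‖ ^ k := by rw [Finset.sum_mul]
    _ ≤ ((∑ j ∈ Finset.range (T + 1), M j) + 1) * ‖h‖ ^ k := by
        have : 0 ≤ ‖h‖ ^ k := by positivity
        nlinarith

/-- **Lower bound along a good direction**: if `H_j = 0` for `j < k` and `H_k ≠ 0` (components of
`g(X + w)`), there is a direction `y ≠ 0` with `|g(w + τ y)| ≥ c₀ |τ|^k` for small `τ`. [folklore] -/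
theorem exists_dir_norm_eval_ge (g : MvPolynomial (Fin N) ℂ) (w : Fin N → ℂ) (hN : 1 ≤ N) {k : ℕ}
    (hk : ∀ j < k, homogeneousComponent j (aeval (fun i ↦ X i + C (w i)) g) = 0)
    (hne : homogeneousComponent k (aeval (fun i ↦ X i + C (w i)) g) ≠ 0) :
    ∃ y : Fin N → ℂ, y ≠ 0 ∧ ∃ c₀ : ℝ, 0 < c₀ ∧ ∃ δ : ℝ, 0 < δ ∧
      ∀ τ : ℂ, ‖τ‖ ≤ δ → c₀ * ‖τ‖ ^ k ≤ ‖eval (w + τ • y) g‖ := by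
  haveI : Nonempty (Fin N) := ⟨⟨0, hN⟩⟩
  set gw := aeval (fun i ↦ X i + C (w i)) g with hgw
  set T := gw.totalDegree with hT
  -- a direction where `H_k` does not vanish
  obtain ⟨y₀, hy₀⟩ : ∃ y : Fin N → ℂ, eval y (homogeneousComponent k gw) ≠ 0 := by
    by_contra h
    push Not at h
    exact hne (MvPolynomial.funext fun y ↦ by rw [h y, map_zero])
  rcases Nat.eq_zero_or_pos k with hk0 | hkpos
  · -- `k = 0`: `g(w) ≠ 0` and continuity
    subst hk0
    have hgw0 : eval w g ≠ 0 := by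
      have hexp := eval_add_smul_eq_sum_homogeneousComponent g w y₀ 0
      rw [zero_smul, add_zero] at hexp
      rw [hexp, Finset.sum_eq_single_of_mem 0 (Finset.mem_range.2 (Nat.succ_pos _))
        (fun j _ hj ↦ by rw [zero_pow hj, zero_mul]), pow_zero, one_mul]
      exact hy₀
    set y : Fin N → ℂ := fun _ ↦ 1 with hy
    have hy0 : y ≠ 0 := by
      intro h
      have := congrFun h ⟨0, hN⟩
      simp [hy] at this
    have hcont : ContinuousAt (fun τ : ℂ ↦ ‖eval (w + τ • y) g‖) 0 :=
      ((MvPolynomial.continuous_eval g).comp (by fun_prop)).norm.continuousAt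
    have hpos : 0 < ‖eval w g‖ / 2 := half_pos (norm_pos_iff.2 hgw0)
    have hev : ∀ᶠ τ in 𝓝 (0 : ℂ), ‖eval w g‖ / 2 < ‖eval (w + τ • y) g‖ := by
      refine hcont.eventually (lt_mem_nhds ?_)
      simp only [zero_smul, add_zero]
      linarith [norm_pos_iff.2 hgw0]
    obtain ⟨δ, hδ, hball⟩ := Metric.eventually_nhds_iff_ball.1 hev
    refine ⟨y, hy0, ‖eval w g‖ / 2, hpos, δ / 2, half_pos hδ, fun τ hτ ↦ ?_⟩
    rw [pow_zero, mul_one]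
    exact (hball τ (mem_ball_zero_iff.2 (hτ.trans_lt (half_lt_self hδ)))).le
  · -- `k ≥ 1`: `y₀ ≠ 0` and the expansion `g(w + τ y₀) = τ^k (c_k + O(τ))`
    have hy₀0 : y₀ ≠ 0 := by
      intro h
      rw [h, eval_zero_of_isHomogeneous (homogeneousComponent_isHomogeneous k gw) hkpos] at hy₀
      exact hy₀ rfl
    set c : ℕ → ℂ := fun j ↦ eval y₀ (homogeneousComponent j gw) with hc
    have hck : c k ≠ 0 := hy₀
    have hkT : k ∈ Finset.range (T + 1) := by
      rw [Finset.mem_range, Nat.lt_succ_iff]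
      by_contra h
      push Not at h
      exact hne (homogeneousComponent_eq_zero k gw h)
    set S : ℝ := ∑ j ∈ (Finset.range (T + 1)).erase k, ‖c j‖ with hS
    have hS0 : 0 ≤ S := Finset.sum_nonneg fun j _ ↦ norm_nonneg _
    set δ : ℝ := min 1 (‖c k‖ / (2 * S + 1)) with hδ
    have hδ0 : 0 < δ := lt_min one_pos (div_pos (norm_pos_iff.2 hck) (by linarith))
    refine ⟨y₀, hy₀0, ‖c k‖ / 2, half_pos (norm_pos_iff.2 hck), δ, hδ0, fun τ hτ ↦ ?_⟩
    have hτ1 : ‖τ‖ ≤ 1 := hτ.trans (min_le_left _ _)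
    have hτ2 : ‖τ‖ * (2 * S + 1) ≤ ‖c k‖ := by
      have := hτ.trans (min_le_right _ _)
      rwa [le_div_iff₀ (by linarith)] at this
    -- split the expansion
    have hexp := eval_add_smul_eq_sum_homogeneousComponent g w y₀ τ
    rw [← Finset.add_sum_erase _ _ hkT] at hexp
    -- the tail is `O(|τ|^{k+1})`
    have htail : ‖∑ j ∈ (Finset.range (T + 1)).erase k, τ ^ j * c j‖ ≤ ‖τ‖ ^ (k + 1) * S := by
      rw [hS, Finset.mul_sum]
      refine (norm_sum_le _ _).trans (Finset.sum_le_sum fun j hj ↦ ?_)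
      rw [norm_mul, norm_pow]
      have hjk : j ≠ k := Finset.ne_of_mem_erase hj
      rcases lt_or_gt_of_ne hjk with hlt | hgt
      · have : c j = 0 := by
          show eval y₀ (homogeneousComponent j gw) = 0
          rw [hk j hlt, map_zero]
        rw [this, norm_zero, mul_zero, mul_zero]
      · exact mul_le_mul_of_nonneg_right (pow_le_pow_of_le_one (norm_nonneg _) hτ1 hgt)
          (norm_nonneg _)
    -- assemble: `‖g‖ ≥ |τ|^k ‖c_k‖ - |τ|^{k+1} S ≥ |τ|^k ‖c_k‖ / 2`
    have hmain : ‖τ‖ ^ k * ‖c k‖ - ‖τ‖ ^ (k + 1) * S ≤ ‖eval (w + τ • y₀) g‖ := by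
      rw [hexp]
      have h1 : ‖τ ^ k * c k‖ = ‖τ‖ ^ k * ‖c k‖ := by rw [norm_mul, norm_pow]
      have h2 := norm_sub_le_norm_add (τ ^ k * c k) (∑ j ∈ (Finset.range (T + 1)).erase k, τ ^ j * c j)
      -- ‖a‖ - ‖b‖ ≤ ‖a + b‖
      have h3 : ‖τ ^ k * c k‖ - ‖∑ j ∈ (Finset.range (T + 1)).erase k, τ ^ j * c j‖ ≤
          ‖τ ^ k * c k + ∑ j ∈ (Finset.range (T + 1)).erase k, τ ^ j * c j‖ := by
        have := norm_add_le (τ ^ k * c k + ∑ j ∈ (Finset.range (T + 1)).erase k, τ ^ j * c j)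
          (-(∑ j ∈ (Finset.range (T + 1)).erase k, τ ^ j * c j))
        rw [add_neg_cancel_right, norm_neg] at this
        linarith
      rw [h1] at h3
      linarith [htail]
    have hpow : ‖τ‖ ^ (k + 1) * S = ‖τ‖ ^ k * (‖τ‖ * S) := by ring
    have hτS : ‖τ‖ * S ≤ ‖c k‖ / 2 := by
      have e : ‖τ‖ * (2 * S + 1) = 2 * (‖τ‖ * S) + ‖τ‖ := by ring
      linarith [norm_nonneg τ]
    calc ‖c k‖ / 2 * ‖τ‖ ^ k ≤ ‖τ‖ ^ k * ‖c k‖ - ‖τ‖ ^ (k + 1) * S := by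
          rw [hpow]
          have h0 : 0 ≤ ‖τ‖ ^ k := by positivity
          have h1 := mul_le_mul_of_nonneg_left hτS h0
          have h2 : ‖τ‖ ^ k * ‖c k‖ = 2 * (‖τ‖ ^ k * (‖c k‖ / 2)) := by ring
          have h3 : ‖c k‖ / 2 * ‖τ‖ ^ k = ‖τ‖ ^ k * (‖c k‖ / 2) := by ring
          linarith
      _ ≤ ‖eval (w + τ • y₀) g‖ := hmain

/-- **The Lelong number of `log |g|` is the order of vanishing** (Hörmander, *Notions of
Convexity*, Cor. 4.1.18): for a non-zero polynomial `g` on `ℂᴺ` (`N ≥ 1`), a point `w` and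
`k ∈ ℕ`, `ν(log |g|, w) ≥ k` iff the homogeneous components of degree `< k` of `g(X + w)` vanish,
i.e. iff `g` vanishes to order `≥ k` at `w`. [cite: HormanderSCV1973, Cor. 1.6.6; Hörmander,
Notions of Convexity, Cor. 4.1.18] -/
theorem exists_lelongNumber_log_enorm_eval_eq {g : MvPolynomial (Fin N) ℂ} (hg : g ≠ 0)
    (hN : 1 ≤ N) (w : Fin N → ℂ) :
    ∃ k₀ : ℕ, lelongNumber (fun z : Fin N → ℂ ↦ ENNReal.log ‖eval z g‖ₑ) w = k₀ ∧
      (∀ j < k₀, homogeneousComponent j (aeval (fun i ↦ X i + C (w i)) g) = 0) ∧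
      homogeneousComponent k₀ (aeval (fun i ↦ X i + C (w i)) g) ≠ 0 := by
  classical
  haveI : Nonempty (Fin N) := ⟨⟨0, hN⟩⟩
  set gw := aeval (fun i ↦ X i + C (w i)) g with hgw
  set G : (Fin N → ℂ) → EReal := fun z ↦ ENNReal.log ‖eval z g‖ₑ with hG
  -- the order of vanishing `k₀`
  have hex : ∃ j, homogeneousComponent j gw ≠ 0 := by
    by_contra h
    push Not at h
    apply aeval_X_add_C_ne_zero hg w
    show gw = 0
    rw [← sum_homogeneousComponent gw]
    exact Finset.sum_eq_zero fun j _ ↦ h j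
  set k₀ := Nat.find hex with hk₀
  have hk₀ne : homogeneousComponent k₀ gw ≠ 0 := Nat.find_spec hex
  have hk₀min : ∀ j < k₀, homogeneousComponent j gw = 0 := fun j hj ↦ by
    by_contra h
    exact Nat.find_min hex hj h
  -- (a) `k₀` is an admissible slope
  have hslope : (k₀ : ℝ) ∈ lelongSlopes G w := by
    obtain ⟨Cst, hCst, hbd⟩ := norm_eval_le_of_homogeneousComponent_eq_zero g w hk₀min
    refine ⟨Nat.cast_nonneg _, Real.log Cst, ?_⟩
    have hball : ∀ᶠ z in 𝓝[≠] w, z ∈ ball w 1 := mem_nhdsWithin_of_mem_nhds (ball_mem_nhds w one_pos)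
    filter_upwards [hball, self_mem_nhdsWithin] with z hz hzw
    have hh1 : ‖z - w‖ ≤ 1 := (mem_ball_iff_norm.1 hz).le
    have hpos : 0 < ‖z - w‖ := norm_pos_iff.2 (sub_ne_zero.2 hzw)
    have hgz := hbd (z - w) hh1
    rw [add_sub_cancel] at hgz
    show ENNReal.log ‖eval z g‖ₑ ≤ _
    rcases eq_or_ne (eval z g) 0 with h0 | h0
    · rw [h0, enorm_zero, ENNReal.log_zero]; exact bot_le
    · rw [log_enorm_eq_coe h0, EReal.coe_le_coe_iff]
      calc Real.log ‖eval z g‖ ≤ Real.log (Cst * ‖z - w‖ ^ k₀) :=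
            Real.log_le_log (norm_pos_iff.2 h0) hgz
        _ = (k₀ : ℝ) * Real.log ‖z - w‖ + Real.log Cst := by
            rw [Real.log_mul hCst.ne' (pow_pos hpos _).ne', Real.log_pow]; ring
  -- (b) every admissible slope is `≤ k₀`
  have hupper : ∀ γ ∈ lelongSlopes G w, γ ≤ k₀ := by
    rintro γ ⟨hγ0, Cγ, hCγ⟩
    obtain ⟨y, hy0, c₀, hc₀, δ, hδ, hlow⟩ := exists_dir_norm_eval_ge g w hN hk₀min hk₀ne
    by_contra hlt
    push Not at hlt
    rw [eventually_nhdsWithin_iff, Metric.eventually_nhds_iff_ball] at hCγ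
    obtain ⟨ε, hε, hballγ⟩ := hCγ
    have hypos : 0 < ‖y‖ := norm_pos_iff.2 hy0
    -- constants: `(k₀ - γ) log t ≤ C'` for small real `t > 0`
    set C' : ℝ := Cγ + γ * Real.log ‖y‖ - Real.log c₀ with hC'
    set t : ℝ := min (min δ (ε / (2 * ‖y‖))) (Real.exp ((C' + 1) / (k₀ - γ))) with ht
    have ht0 : 0 < t := lt_min (lt_min hδ (by positivity)) (Real.exp_pos _)
    have htδ : t ≤ δ := (min_le_left _ _).trans (min_le_left _ _)
    have htε : t * ‖y‖ < ε := by
      have : t ≤ ε / (2 * ‖y‖) := (min_le_left _ _).trans (min_le_right _ _)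
      calc t * ‖y‖ ≤ ε / (2 * ‖y‖) * ‖y‖ := mul_le_mul_of_nonneg_right this hypos.le
        _ = ε / 2 := by field_simp
        _ < ε := half_lt_self hε
    have htlog : (k₀ - γ) * Real.log t ≥ C' + 1 := by
      -- `log t ≤ (C' + 1)/(k₀ - γ)` and `k₀ - γ < 0`
      have hle : Real.log t ≤ (C' + 1) / (k₀ - γ) :=
        calc Real.log t ≤ Real.log (Real.exp ((C' + 1) / (k₀ - γ))) :=
              Real.log_le_log ht0 (min_le_right _ _)
          _ = (C' + 1) / (k₀ - γ) := Real.log_exp _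
      have hneg : (k₀ : ℝ) - γ < 0 := by linarith
      have := mul_le_mul_of_nonpos_left hle hneg.le
      rwa [mul_div_cancel₀ _ hneg.ne] at this
    -- the point `z = w + t • y`
    set z : Fin N → ℂ := w + ((t : ℝ) : ℂ) • y with hz
    have hzw : z - w = ((t : ℝ) : ℂ) • y := by rw [hz, add_sub_cancel_left]
    have hnzw : ‖z - w‖ = t * ‖y‖ := by
      rw [hzw, norm_smul, Complex.norm_real, Real.norm_eq_abs, abs_of_pos ht0]
    have hzne : z ≠ w := by
      intro h
      have : ‖z - w‖ = 0 := by rw [h, sub_self, norm_zero]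
      rw [hnzw] at this
      exact (mul_pos ht0 hypos).ne' this
    have hup : G z ≤ ((γ * Real.log ‖z - w‖ + Cγ : ℝ) : EReal) :=
      hballγ z (mem_ball_iff_norm.2 (by rw [hnzw]; exact htε)) hzne
    have hlo : c₀ * t ^ k₀ ≤ ‖eval z g‖ := by
      have := hlow ((t : ℝ) : ℂ) (by rw [Complex.norm_real, Real.norm_eq_abs, abs_of_pos ht0]; exact htδ)
      rwa [Complex.norm_real, Real.norm_eq_abs, abs_of_pos ht0] at this
    have hgz : eval z g ≠ 0 := by
      intro h
      rw [h, norm_zero] at hlo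
      exact (not_lt.2 hlo) (by positivity)
    have hup' : Real.log ‖eval z g‖ ≤ γ * Real.log ‖z - w‖ + Cγ := by
      have := hup
      rw [hG] at this
      simp only at this
      rw [log_enorm_eq_coe hgz, EReal.coe_le_coe_iff] at this
      exact this
    have hlo' : Real.log c₀ + k₀ * Real.log t ≤ Real.log ‖eval z g‖ := by
      rw [← Real.log_pow, ← Real.log_mul hc₀.ne' (pow_pos ht0 _).ne']
      exact Real.log_le_log (by positivity) hlo
    rw [hnzw, Real.log_mul ht0.ne' hypos.ne'] at hup'
    -- combine: `(k₀ - γ) log t ≤ C'`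
    have : (k₀ - γ) * Real.log t ≤ C' := by rw [hC']; linarith
    linarith
  -- (c) conclusion: `ν = k₀`
  have hbdd : BddAbove (lelongSlopes G w) := ⟨k₀, fun γ hγ ↦ hupper γ hγ⟩
  have hν : lelongNumber G w = k₀ := by
    rw [lelongNumber_eq_sSup]
    exact le_antisymm (csSup_le ⟨_, hslope⟩ hupper) (le_csSup hbdd hslope)
  exact ⟨k₀, hν, hk₀min, hk₀ne⟩

/-- **The Lelong number of `log |g|` is the order of vanishing**, level-set form: for `k ∈ ℕ`,
`ν(log |g|, w) ≥ k` iff the homogeneous components of degree `< k` of `g(X + w)` vanish.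
[cite: HormanderSCV1973, Cor. 1.6.6; Hörmander, Notions of Convexity, Cor. 4.1.18] -/
theorem natCast_le_lelongNumber_log_enorm_eval_iff {g : MvPolynomial (Fin N) ℂ} (hg : g ≠ 0)
    (hN : 1 ≤ N) (w : Fin N → ℂ) (k : ℕ) :
    (k : ℝ) ≤ lelongNumber (fun z : Fin N → ℂ ↦ ENNReal.log ‖eval z g‖ₑ) w ↔
      ∀ j < k, homogeneousComponent j (aeval (fun i ↦ X i + C (w i)) g) = 0 := by
  obtain ⟨k₀, hν, hk₀min, hk₀ne⟩ := exists_lelongNumber_log_enorm_eval_eq hg hN w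
  rw [hν]
  constructor
  · intro hk j hj
    have hjk₀ : j < k₀ := by exact_mod_cast (Nat.cast_lt.2 hj).trans_le hk
    exact hk₀min j hjk₀
  · intro hk
    have : k ≤ k₀ := by
      by_contra h
      push Not at h
      exact hk₀ne (hk k₀ h)
    exact_mod_cast this

/-- Real-level form: `{ν(log |g|, ·) ≥ c} = {all components of degree < ⌈c⌉ of g(X + w) vanish}`.
[folklore] -/
theorem setOf_le_lelongNumber_log_enorm_eval {g : MvPolynomial (Fin N) ℂ} (hg : g ≠ 0)
    (hN : 1 ≤ N) (c : ℝ) :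
    {w : Fin N → ℂ | c ≤ lelongNumber (fun z : Fin N → ℂ ↦ ENNReal.log ‖eval z g‖ₑ) w} =
      {w : Fin N → ℂ | ∀ j < ⌈c⌉₊,
        homogeneousComponent j (aeval (fun i ↦ X i + C (w i)) g) = 0} := by
  ext w
  rw [mem_setOf_eq, mem_setOf_eq, ← natCast_le_lelongNumber_log_enorm_eval_iff hg hN w ⌈c⌉₊]
  obtain ⟨k₀, hν, -, -⟩ := exists_lelongNumber_log_enorm_eval_eq hg hN w
  rw [hν]
  exact_mod_cast (Nat.ceil_le (a := c) (n := k₀)).symm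

end VanishingOrder

/-! ### The level sets of the order of vanishing of a polynomial are analytic -/

section OrderLevelSets

open MvPolynomial

variable {N : ℕ}

/-- Polynomial maps `ℂᴺ → ℂ` are complex differentiable. [folklore] -/
theorem mvPolynomial_differentiable_eval (q : MvPolynomial (Fin N) ℂ) :
    Differentiable ℂ fun w : Fin N → ℂ ↦ eval w q := by
  induction q using MvPolynomial.induction_on with
  | C a => simp only [eval_C]; exact differentiable_const _
  | add p q hp hq => simp only [map_add]; exact hp.add hq
  | mul_X p i hp =>
    simp only [map_mul, eval_X]
    exact hp.mul (differentiable_apply (𝕜 := ℂ) i)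

/-- The restriction of `g` to the line `w + ℂ y` with SYMBOLIC base point: a one-variable
polynomial whose coefficients are polynomials in `w`. [folklore] -/
theorem polynomial_eval_map_eval_lineRestriction (g : MvPolynomial (Fin N) ℂ) (y w : Fin N → ℂ)
    (τ : ℂ) :
    ((aeval (fun i ↦ Polynomial.C (X i) + Polynomial.C (C (y i)) * Polynomial.X) g).map
        (eval w)).eval τ = eval (w + τ • y) g := by
  induction g using MvPolynomial.induction_on with
  | C a =>
    simp only [aeval_C, Polynomial.algebraMap_apply, algebraMap_eq, Polynomial.map_C, eval_C,
      Polynomial.eval_C]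
  | add p q hp hq => simp only [map_add, Polynomial.map_add, Polynomial.eval_add, hp, hq]
  | mul_X p i hp =>
    simp only [map_mul, Polynomial.map_mul, Polynomial.eval_mul, hp, aeval_X, Polynomial.map_add,
      Polynomial.map_mul, Polynomial.map_C, eval_X, eval_C, Polynomial.map_X, Polynomial.eval_add,
      Polynomial.eval_mul, Polynomial.eval_C, Polynomial.eval_X, Pi.add_apply, Pi.smul_apply,
      smul_eq_mul, mul_comm τ]

/-- **Coefficients of the line restriction are the homogeneous components**: the `j`-th
coefficient of `τ ↦ g(w + τ y)` is `H_j(y)`, `H_j` the degree-`j` component of `g(X + w)`; as a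
function of `w` it is the polynomial `eval w (coeff j 𝒬_y)`. [folklore] -/
theorem eval_coeff_lineRestriction (g : MvPolynomial (Fin N) ℂ) (y w : Fin N → ℂ) (j : ℕ) :
    eval w ((aeval (fun i ↦ Polynomial.C (X i) + Polynomial.C (C (y i)) * Polynomial.X) g).coeff j)
      = eval y (homogeneousComponent j (aeval (fun i ↦ X i + C (w i)) g)) := by
  classical
  set gw := aeval (fun i ↦ X i + C (w i)) g with hgw
  set P₁ : Polynomial ℂ := (aeval (fun i ↦ Polynomial.C (X i) + Polynomial.C (C (y i)) *
    Polynomial.X) g).map (eval w) with hP₁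
  set P₂ : Polynomial ℂ := ∑ i ∈ Finset.range (gw.totalDegree + 1),
    Polynomial.C (eval y (homogeneousComponent i gw)) * Polynomial.X ^ i with hP₂
  have hP : P₁ = P₂ := by
    refine Polynomial.funext fun τ ↦ ?_
    rw [hP₁, polynomial_eval_map_eval_lineRestriction, eval_add_smul_eq_sum_homogeneousComponent,
      hP₂, Polynomial.eval_finsetSum]
    refine Finset.sum_congr rfl fun i _ ↦ ?_
    rw [Polynomial.eval_mul, Polynomial.eval_C, Polynomial.eval_pow, Polynomial.eval_X, mul_comm]
  have hcoeff : eval w ((aeval (fun i ↦ Polynomial.C (X i) + Polynomial.C (C (y i)) *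
      Polynomial.X) g).coeff j) = P₁.coeff j := by
    rw [hP₁, Polynomial.coeff_map]
  rw [hcoeff, hP, hP₂, Polynomial.finsetSum_coeff]
  simp only [Polynomial.coeff_C_mul, Polynomial.coeff_X_pow, mul_ite, mul_one, mul_zero]
  rw [Finset.sum_ite_eq]
  split_ifs with hj
  · rfl
  · rw [Finset.mem_range, not_lt] at hj
    rw [homogeneousComponent_eq_zero j gw (Nat.lt_of_succ_le hj), map_zero]

/-- A finite grid of test points `{0, 1, …, K}ᴺ ⊆ ℂᴺ`. [folklore] -/
theorem eq_zero_of_eval_eq_zero_on_grid {P : MvPolynomial (Fin N) ℂ} {K : ℕ} (hP : P.totalDegree ≤ K)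
    (h : ∀ y ∈ Fintype.piFinset (fun _ : Fin N ↦ (Finset.range (K + 1)).image (Nat.cast : ℕ → ℂ)),
      eval y P = 0) : P = 0 := by
  classical
  refine MvPolynomial.eq_zero_of_eval_zero_at_prod_finset P
    (fun _ ↦ (Finset.range (K + 1)).image (Nat.cast : ℕ → ℂ)) (fun i ↦ ?_) (fun x hx ↦ ?_)
  · rw [Finset.card_image_of_injective _ Nat.cast_injective, Finset.card_range]
    exact Nat.lt_succ_of_le ((degreeOf_le_totalDegree P i).trans hP)
  · exact h x (Fintype.mem_piFinset.2 hx)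

/-- **The level sets of the order of vanishing are analytic** (indeed algebraic): for a polynomial
`g` on `ℂᴺ` and `k ∈ ℕ`, the set of points `w` at which all homogeneous components of `g(X + w)`
of degree `< k` vanish is the common zero set of the finitely many polynomials
`w ↦ coeff_j (τ ↦ g(w + τ y))`, `j < k`, `y ∈ {0, …, k}ᴺ`. [folklore] -/
theorem isAnalyticSet_setOf_homogeneousComponent_eq_zero (g : MvPolynomial (Fin N) ℂ) (k : ℕ) :
    Literature.Geometry.Kaehler.IsAnalyticSet 𝓘(ℂ, Fin N → ℂ)
      {w : Fin N → ℂ | ∀ j < k, homogeneousComponent j (aeval (fun i ↦ X i + C (w i)) g) = 0} := by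
  classical
  set Grid : Finset (Fin N → ℂ) :=
    Fintype.piFinset (fun _ : Fin N ↦ (Finset.range (k + 1)).image (Nat.cast : ℕ → ℂ)) with hGrid
  set Q : (Fin N → ℂ) → Polynomial (MvPolynomial (Fin N) ℂ) := fun y ↦
    aeval (fun i ↦ Polynomial.C (X i) + Polynomial.C (C (y i)) * Polynomial.X) g with hQ
  have hset : {w : Fin N → ℂ | ∀ j < k, homogeneousComponent j (aeval (fun i ↦ X i + C (w i)) g) = 0}
      = ⋂ j ∈ Finset.range k, ⋂ y ∈ Grid,
          (fun w : Fin N → ℂ ↦ fun _ : Fin 1 ↦ eval w ((Q y).coeff j)) ⁻¹' {0} := by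
    ext w
    simp only [mem_setOf_eq, mem_iInter, mem_preimage, mem_singleton_iff, funext_iff,
      Pi.zero_apply, Finset.mem_range]
    constructor
    · intro h j hj y _ _
      rw [hQ]
      simp only
      rw [eval_coeff_lineRestriction, h j hj, map_zero]
    · intro h j hj
      refine eq_zero_of_eval_eq_zero_on_grid
        ((homogeneousComponent_isHomogeneous j _).totalDegree_le.trans hj.le) fun y hy ↦ ?_
      have := h j hj y hy 0
      rw [hQ] at this
      simp only at this
      rwa [eval_coeff_lineRestriction] at this
  rw [hset]
  refine Literature.Geometry.Kaehler.isAnalyticSet_biInter_finset _ fun j _ ↦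
    Literature.Geometry.Kaehler.isAnalyticSet_biInter_finset _ fun y _ ↦
      Literature.Geometry.Kaehler.isAnalyticSet_preimage_singleton_zero ?_
  rw [mdifferentiable_iff_differentiable]
  exact differentiable_pi.2 fun _ ↦ mvPolynomial_differentiable_eval _

/-- **Siu's theorem for `log |g|`, `g` a polynomial on `ℂᴺ`**: for a non-zero polynomial `g` in
`N ≥ 1` variables and every real `c`, the Lelong upper level set `{w | ν(log |g|, w) ≥ c}` is an
analytic subset of `ℂᴺ` (the set where `g` vanishes to order `≥ ⌈c⌉`).
[cite: Siu1974, Main Theorem (case of log |g|); Hörmander, Notions of Convexity, Cor. 4.1.18] -/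
theorem isAnalyticSet_lelongUpperLevelSet_log_enorm_eval {g : MvPolynomial (Fin N) ℂ} (hg : g ≠ 0)
    (hN : 1 ≤ N) (c : ℝ) :
    Literature.Geometry.Kaehler.IsAnalyticSet 𝓘(ℂ, Fin N → ℂ)
      {w : Fin N → ℂ | c ≤ lelongNumber (fun z : Fin N → ℂ ↦ ENNReal.log ‖eval z g‖ₑ) w} := by
  rw [setOf_le_lelongNumber_log_enorm_eval hg hN c]
  exact isAnalyticSet_setOf_homogeneousComponent_eq_zero g ⌈c⌉₊

end OrderLevelSets

/-! ### Further helpers for currents with algebraic potential -/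

section AlgebraicHelpers

open MvPolynomial
open scoped Pointwise

/-- **Scaling of Lelong numbers**: `ν(a u, x) = a ν(u, x)` for a real constant `a > 0`.
[cite: DangDoPham2025, §2.1; folklore] -/
theorem lelongNumber_const_mul {E : Type*} [NormedAddCommGroup E] {u : E → EReal} {x : E}
    {a : ℝ} (ha : 0 < a) :
    lelongNumber (fun z ↦ (a : EReal) * u z) x = a * lelongNumber u x := by
  have hmono := monotone_coe_mul_left ha.le
  have hinv : ∀ y : EReal, ((a⁻¹ : ℝ) : EReal) * ((a : EReal) * y) = y := fun y ↦ by
    rw [← mul_assoc, ← EReal.coe_mul, inv_mul_cancel₀ ha.ne', EReal.coe_one, one_mul]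
  have hinv' : ∀ y : EReal, (a : EReal) * (((a⁻¹ : ℝ) : EReal) * y) = y := fun y ↦ by
    rw [← mul_assoc, ← EReal.coe_mul, mul_inv_cancel₀ ha.ne', EReal.coe_one, one_mul]
  have hset : lelongSlopes (fun z ↦ (a : EReal) * u z) x = a • lelongSlopes u x := by
    ext γ
    rw [Set.mem_smul_set]
    constructor
    · rintro ⟨hγ0, C, hC⟩
      refine ⟨a⁻¹ * γ, ⟨by positivity, a⁻¹ * C, ?_⟩, by rw [smul_eq_mul, mul_inv_cancel_left₀ ha.ne']⟩
      filter_upwards [hC] with z hz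
      have := monotone_coe_mul_left (inv_pos.2 ha).le hz
      simp only at this
      rw [hinv] at this
      refine this.trans_eq ?_
      rw [← EReal.coe_mul]
      congr 1; ring
    · rintro ⟨γ', ⟨hγ'0, C, hC⟩, rfl⟩
      refine ⟨by rw [smul_eq_mul]; positivity, a * C, ?_⟩
      filter_upwards [hC] with z hz
      have := hmono hz
      simp only at this
      refine this.trans_eq ?_
      rw [← EReal.coe_mul, smul_eq_mul]
      congr 1; ring
  rw [lelongNumber_eq_sSup, lelongNumber_eq_sSup, hset, Real.sSup_smul_of_nonneg ha.le, smul_eq_mul]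

/-- The Lelong number of the zero function vanishes. [folklore] -/
theorem lelongNumber_zero_fun {E : Type*} [NormedAddCommGroup E] (x : E) [NeBot (𝓝[≠] x)] :
    lelongNumber (fun _ : E ↦ (0 : EReal)) x = 0 :=
  lelongNumber_eq_zero_of_continuousAt (f := fun _ ↦ (0 : ℝ)) continuousAt_const
    (Eventually.of_forall fun _ ↦ by simp)

/-- **A non-zero polynomial does not vanish identically near any point** of `ℂ^σ` (`σ` finite):
sup-norm balls are boxes of infinite discs (`MvPolynomial.funext_set`). [folklore] -/
theorem frequently_eval_ne_zero {σ : Type*} [Fintype σ] {F : MvPolynomial σ ℂ} (hF : F ≠ 0)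
    (v : σ → ℂ) : ∃ᶠ y in 𝓝 v, eval y F ≠ 0 := by
  intro hev
  apply hF
  simp only [not_ne_iff] at hev
  obtain ⟨δ, hδ, hball⟩ := Metric.eventually_nhds_iff_ball.1 hev
  refine MvPolynomial.funext_set (fun i ↦ ball (v i) δ) (fun i ↦ ?_) fun x hx ↦ ?_
  · -- a disc of `ℂ` is infinite: it contains a real segment
    have hseg : (fun t : ℝ ↦ v i + (t : ℂ)) '' Ioo (-δ) δ ⊆ ball (v i) δ := by
      rintro _ ⟨t, ht, rfl⟩
      rw [mem_ball, dist_eq_norm, add_sub_cancel_left, Complex.norm_real, Real.norm_eq_abs, abs_lt]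
      exact ht
    have hinj : Set.InjOn (fun t : ℝ ↦ v i + (t : ℂ)) (Ioo (-δ) δ) := fun a _ b _ hab ↦
      Complex.ofReal_injective (add_left_cancel hab)
    exact (Set.Infinite.image hinj (Set.Ioo_infinite (by linarith))).mono hseg
  · rw [map_zero]
    rcases isEmpty_or_nonempty σ with hσ | hσ
    · -- no variables: `x = v`
      have : x = v := funext fun i ↦ (IsEmpty.false i).elim
      rw [this]
      exact hball v (mem_ball_self hδ)
    · refine hball x ?_
      rw [ball_pi v hδ]
      exact hx

/-- Restriction of a polynomial in `N + 1` variables to the affine chart `{zᵢ = 1}`: a polynomial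
`gᵢ` in `N` variables with `gᵢ(w) = F(w₀, …, 1ᵢ, …, w_{N-1})`. [folklore] -/
theorem eval_aeval_insertNth {N : ℕ} (F : MvPolynomial (Fin (N + 1)) ℂ) (i : Fin (N + 1))
    (w : Fin N → ℂ) :
    eval w (aeval (Fin.insertNth i (1 : MvPolynomial (Fin N) ℂ) X) F) =
      eval (Fin.insertNth i (1 : ℂ) w) F := by
  induction F using MvPolynomial.induction_on with
  | C a => simp only [aeval_C, algebraMap_eq, eval_C]
  | add p q hp hq => simp only [map_add, hp, hq]
  | mul_X p k hp =>
    simp only [map_mul, hp, aeval_X, eval_X]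
    congr 1
    refine Fin.succAboveCases i ?_ (fun j ↦ ?_) k
    · simp
    · simp

/-- The chart restriction of a non-zero HOMOGENEOUS polynomial is non-zero: otherwise `F` would
vanish on `{zᵢ ≠ 0}`, a box of infinite sides. [folklore] -/
theorem aeval_insertNth_ne_zero {N : ℕ} {F : MvPolynomial (Fin (N + 1)) ℂ} {d : ℕ}
    (hF : F.IsHomogeneous d) (hF0 : F ≠ 0) (i : Fin (N + 1)) :
    aeval (Fin.insertNth i (1 : MvPolynomial (Fin N) ℂ) X) F ≠ 0 := by
  intro h
  apply hF0
  refine MvPolynomial.funext_set (fun k ↦ if k = i then {0}ᶜ else univ) (fun k ↦ ?_) fun z hz ↦ ?_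
  · split_ifs
    · exact (Set.finite_singleton (0 : ℂ)).infinite_compl
    · exact Set.infinite_univ
  · have hzi : z i ≠ 0 := by
      have := hz i (mem_univ i)
      simp only [if_true] at this
      exact this
    rw [map_zero, ClosedPositiveOneOneCurrent.eq_smul_insertNth_one i hzi,
      Projectivization.eval_smul_of_isHomogeneous hF,
      ← eval_aeval_insertNth, h, map_zero, mul_zero]

/-- `ℙ⁰(ℂ) = ℙ(ℂ¹)` is a single point. [folklore] -/
theorem subsingleton_projectivization_fin_one : Subsingleton (ℙ ℂ (Fin (0 + 1) → ℂ)) := by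
  refine ⟨fun x y ↦ ?_⟩
  induction x using Projectivization.ind with
  | h v hv =>
    induction y using Projectivization.ind with
    | h u hu =>
      have hu0 : u 0 ≠ 0 := fun h ↦ hu (funext fun k ↦ by fin_cases k; exact h)
      have hv0 : v 0 ≠ 0 := fun h ↦ hv (funext fun k ↦ by fin_cases k; exact h)
      exact (Projectivization.mk_eq_mk_iff' ℂ _ _ hv hu).2
        ⟨v 0 / u 0, funext fun k ↦ by fin_cases k; simp [div_mul_cancel₀ _ hu0]⟩

/-- Every subset of a one-point complex manifold is analytic. [folklore] -/
theorem isAnalyticSet_of_subsingleton {E : Type*} [NormedAddCommGroup E] [NormedSpace ℂ E]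
    {H : Type*} [TopologicalSpace H] (I : ModelWithCorners ℂ E H) {M : Type*} [TopologicalSpace M]
    [ChartedSpace H M] [Subsingleton M] (Z : Set M) :
    Literature.Geometry.Kaehler.IsAnalyticSet I Z := by
  rcases Set.eq_empty_or_nonempty Z with rfl | ⟨x, hx⟩
  · exact Literature.Geometry.Kaehler.isAnalyticSet_empty
  · have : Z = univ := eq_univ_of_forall fun y ↦ (Subsingleton.elim x y) ▸ hx
    rw [this]
    exact Literature.Geometry.Kaehler.isAnalyticSet_univ

/-- **Sums of plurisubharmonic functions are plurisubharmonic** (values in `[-∞, +∞)`).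
[cite: HormanderSCV1973, Thm. 1.6.2 and Def. 2.6.1] -/
theorem IsPlurisubharmonicOn.add {E : Type*} [NormedAddCommGroup E] [NormedSpace ℂ E]
    {u v : E → EReal} {Ω : Set E} (hu : IsPlurisubharmonicOn u Ω) (hv : IsPlurisubharmonicOn v Ω) :
    IsPlurisubharmonicOn (u + v) Ω := by
  refine ⟨UpperSemicontinuousOn.add' hu.upperSemicontinuousOn hv.upperSemicontinuousOn
    fun x hx ↦ ?_, fun z hz ↦ EReal.add_lt_top (hu.lt_top hz).ne (hv.lt_top hz).ne, fun z w ↦ ?_⟩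
  · exact EReal.continuousAt_add (Or.inl (hu.lt_top hx).ne) (Or.inr (hv.lt_top hx).ne)
  · exact (hu.isSubharmonicOn_line z w).add (hv.isSubharmonicOn_line z w)

end AlgebraicHelpers

end Literature.Analysis.Pluripotential

end
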